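import Mathlib
import HarnessLib
import Literature.Combinatorics.Additive.Kneser
import Literature.Combinatorics.Additive.KempermanScherk

/-!
# Quasi-periodic decompositions, non-extendible pairs, and the first reduction lemmas of
# Grynkiewicz's «A step beyond Kemperman's structure theorem» (§2 incl. Prop 2.3 and the layers
# `N_i^U`; §5, Lemmas 5.1–5.4, Prop 5.5, Lemma 5.11)

Topic `Literature/Combinatorics/Additive`.  Cell `mm-stpp` (D-0046), seat `mm-stpp-lit` (gen 21):
second section file of the port of [Grynkiewicz2009] (KST+1; LIT-INDEX §26; §3 = Theorem 3.1 is
`SumsetVersusDifferenceSet.lean`).  This file supplies the VOCABULARY in which Kemperman's structure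
theorem (KST) and Theorem 4.1 of the paper are stated — `H`-periodic sets, quasi-periodic decompositions,
quasi-periodic sets, non-extendible sets/pairs — as definitions with bodies, the elementary §2
propositions, and the first two «preliminary lemmas» of §5, which begin the reduction of Theorem 4.1 to
pairs of non-quasi-periodic generating sets.

## Definitions (print §2, pp. 2–3 and 6)

* `IsPeriodicWith H A` — «a subset `A ⊆ G` is `H`-periodic if `A` is a union of `H`-cosets …
  Note that `A` being `H`-periodic is equivalent to `A + H = A`»: `∀ h ∈ H, h + A = A`, for a finset `A`
  and a subgroup `H : AddSubgroup G`.  Bridge to the tree's stabilizer finset (`Kneser.lean`):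
  `isPeriodicWith_iff_subset_addStab` (`H ⊆ H(A)`).  [cite: Grynkiewicz2009, §2]
* `IsQuasiPeriodicDecomp H A A₁ A₀` — «a quasi-periodic decomposition of `A` with quasi-period `H`,
  where `H` is a nontrivial subgroup, is a partition `A₁ ∪ A₀` of `A` into two disjoint (each possibly
  empty) subsets such that `A₁` is `H`-periodic or empty, and `A₀` is a subset of an `H`-coset» (the last
  clause rendered as «all differences of elements of `A₀` lie in `H`»).  [cite: Grynkiewicz2009, §2]
* `IsQuasiPeriodic A` — «`A` is quasi-periodic if `A` has a quasi-periodic decomposition `A = A₁ ∪ A₀`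
  with `A₁` nonempty».  [cite: Grynkiewicz2009, §2]
* `IsNonExtendible A B` — «`A` is non-extendible, with respect to `B`, if `(A ∪ {a₀}) + B ≠ A + B` for
  all `a₀ ∈ Ā`» (display (2)); the PAIR `(A, B)` is non-extendible when both `IsNonExtendible A B` and
  `IsNonExtendible B A` hold (we keep the two hypotheses separate).  [cite: Grynkiewicz2009, §2, (2)]
* «aperiodic» is spelled, as elsewhere in the tree (`KempermanStructureTheorem.lean`), `A.addStab = {0}`.
* `layer A B i` = `N_i(A, B)` (`N_0 = A`, `N_i = (A + iB) ∖ (A + (i−1)B)`), `repTrace A B i x` =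
  `(x − (A + (i−1)B)) ∩ B`, `layerWith A B i U` = `N_i^U(A, B)`, `layerWithin A B i U` = `N_i^{≤U}(A, B)`
  (print pp. 3–4; end of this file), with `mem_layerWithin_iff_exists` (`N_i^{≤U} = ⋃_{V ⊆ U} N_i^V`),
  `add_nsmul_add_sdiff_eq` («`A + (i−1)B + (B ∖ U) = (A + iB) ∖ N_i^{≤U}`»), `layerWith_subset_layer`
  (`0 ∉ U`), `addConvolution_eq_card_filter` / `card_repTrace_one` (`r_{A,B}(x) = |(x − A) ∩ B|`),
  `card_layerWith_one_singleton` («`|N_1^b(A,B)|` is the number of `a ∈ A` with `a + b` a unique expression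
  element»).  [cite: Grynkiewicz2009, §2]
* `cosetTrace H A a` = `A_{a,H} = (a + H) ∩ A` and `periodicPart H B` = «the maximal subset of `B` that is
  `H`-periodic» (print p. 3 and the first sentence of the proofs of Lemmas 5.6/5.7; end of this file), with
  the `H`-coset-decomposition API (`cosetTrace_disjoint_or_eq`, `biUnion_cosetTrace`, `cosetTrace_eq_inter_vadd`,
  `isPeriodicWith_periodicPart`, `subset_periodicPart_of_isPeriodicWith` (maximality),
  `cosetTrace_subset_sdiff_periodicPart`, `card_cosetTrace_lt_of_mem_sdiff_periodicPart` (the traces of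
  `B ∖ B′` are partially filled), `cosetTrace_eq_vadd_of_mem_periodicPart`).  [cite: Grynkiewicz2009, §2]

## Results

* Proposition 2.1 (i) `add_eq_univ_of_card_le_card_add_card` (`|A| + |B| ≥ |G| + 1 ⇒ A + B = G`),
  (ii) `lt_addConvolution_of_card_add_lt` (`|A + B| < |A| + |B| − r ⇒ r_{A,B}(g) > r` on `A + B`; this is
  the tree's Kemperman–Scherk theorem `kempermanScherk_card_add_card_le_add`).
  [cite: Grynkiewicz2009, Prop 2.1]
* Proposition 2.2 `le_addConvolution_add_nsmul` (`r_{X,Y} ≥ t` on `X + Y` ⇒ `r_{X+(i−1)Y, Y} ≥ t` on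
  `X + iY`). [cite: Grynkiewicz2009, Prop 2.2]
* Proposition 2.3 `Grynkiewicz2009.sub_mem_layerWithin_of_mem_layerWith` /
  `Grynkiewicz2009.layerWith_sub_subset_layerWithin` (`N_{i+1}^U(X,Y) − U ⊆ N_i^{≤U}(X,Y)`, `i ≥ 1`;
  end of this file). [cite: Grynkiewicz2009, Prop 2.3]
* Proposition 2.4 `isNonExtendible_iff_neg_add_compl_eq` (`A` non-extendible iff `−B + (A+B)ᶜ = Aᶜ`,
  display (4); the inclusion `⊆` always holds, `neg_add_compl_add_subset_compl`, display (3)), and its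
  second part `isNonExtendible_pair_neg_compl` / `isNonExtendible_pair_neg_compl'` (the pairs
  `(−A, (A+B)ᶜ)`, `(−B, (A+B)ᶜ)` are non-extendible), with the cardinality remark
  `card_neg_add_compl_add` (`|−A + (A+B)ᶜ| = |−A| + |(A+B)ᶜ| + r` when `|A + B| = |A| + |B| + r`).
  [cite: Grynkiewicz2009, Prop 2.4]
* **Lemma 5.1** `exists_isQuasiPeriodicDecomp_closure`: «Let `A` and `B` be finite, nonempty subsets of
  an abelian group `G` with `|A| ≥ 3`, `|A + B| = |A| + |B|`, and `0 ∈ A`, and let `H = ⟨A⟩`.  If `A + B`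
  is aperiodic and `B` is non-extendible, then `B` has a quasi-periodic decomposition with quasi-period
  `H`.»  Proof as printed (displays (18)–(23): the `H`-coset decomposition of `B`, Kneser's theorem on the
  two partially filled cosets, and aperiodicity of `A`), with the tree's `add_kneser`.
  [cite: Grynkiewicz2009, Lemma 5.1]
* **Lemma 5.2** `closure_eq_closure_of_not_isQuasiPeriodic`: under `|A + B| = |A| + |B|`, `0 ∈ A ∩ B`,
  `|A|, |B| ≥ 3`, `A + B` aperiodic, `(A, B)` non-extendible and neither `A` nor `B` quasi-periodic,
  `⟨A⟩ = ⟨B⟩`. [cite: Grynkiewicz2009, Lemma 5.2]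
* **Lemma 5.3** `Grynkiewicz2009.exists_isQuasiPeriodicDecomp_of_isQuasiPeriodicDecomp`: the transfer
  lemma — if `A = A₁ ∪ A₀` is a quasi-periodic decomposition with `A₁ ≠ ∅` of maximal period `H`,
  `|A + B| = |A| + |B|`, `A + B` aperiodic and `(A, B)` non-extendible, then `B = B₁ ∪ B₀` is
  quasi-periodic with the same quasi-period, `|A₀ + B₀| = |A₀| + |B₀|`, `A + B = (A₁ + B) ⊔ (A₀ + B₀)`,
  `|A₁ + B| + |H| = |A₁| + |B + H|` and the coset of `A₀ + B₀` is uniquely expressed (print (i)–(iii)).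
  [cite: Grynkiewicz2009, Lemma 5.3]
* **Lemma 5.4** `Grynkiewicz2009.not_isQuasiPeriodic_and_closure_eq_top` (first part: `⟨A⟩ = G`, `A`
  not quasi-periodic ⇒ `B` not quasi-periodic and `⟨B⟩ = G`) and
  `Grynkiewicz2009.not_isQuasiPeriodic_add_and_compl` (second part, finite `G`: neither `A + B` nor its
  complement is quasi-periodic, and `⟨−γ + \overline{A + B}⟩ = G`), with the invariance lemmas for the
  §2 notions under translation / negation / complement (`IsQuasiPeriodicDecomp.vadd/neg/exists_compl`,
  `isQuasiPeriodic_vadd_iff`, `isQuasiPeriodic_neg_iff`, `IsNonExtendible.vadd_left/vadd_right/neg`,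
  `addStab_neg`, `addStab_compl`). [cite: Grynkiewicz2009, Lemma 5.4]
* **Proposition 5.5** (the matching proposition) `Grynkiewicz2009.exists_two_edges_or_card_eq_two`:
  `C ⊆ A + B`, `|A|, |B|, |C| ≥ 2`, every `a + B` and every `b + A` meets `C` ⇒ two «disjoint edges of
  distinct colours» (`a ≠ a'`, `b ≠ b'`, `a + b ≠ a' + b'` in `C`) or `|A| = |B| = |C| = 2` with
  `a + B = b + A = C`. [cite: Grynkiewicz2009, Prop 5.5]
* **Lemma 5.6, displays (31)–(32)** (end of this file): `Grynkiewicz2009.addStab_add_eq_and_display31`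
  (for `A = A′ ∪ A₁ ∪ A₂` as in Lemma 5.6, `A` not quasi-periodic and non-extendible w.r.t. `B ≠ ∅`:
  `H(A′ + B) = H(A′) = H` and `|A′| + |B + H| ≤ |A′ + B| + |H|` — the printed (31) times `|H|`, proved
  WITHOUT passing to `G/H`), `Grynkiewicz2009.display32` (`A′ + B ⊆ C′ = periodicPart H (A + B)` and
  `|A′| + |B + H| + |(A + B) ∖ C′| ≤ |A + B| + |H|`), with `isQuasiPeriodic_union_of_isPeriodicWith` and
  `Grynkiewicz2009.isQuasiPeriodic_of_coset_subset`; and the set-up sentences of the printed proof: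
  `Grynkiewicz2009.parts_of_not_isQuasiPeriodic` (`A₁, A₂ ≠ ∅`, disjoint from `A′` and each other, distinct
  cosets, each coset with a hole), `Grynkiewicz2009.exists_two_cosets_sdiff_periodicPart` (`l ≥ 2`, finite `G`,
  via Lemma 5.4), `Grynkiewicz2009.exists_row_colour` / `exists_col_colour` (the non-extendibility conditions
  that feed Proposition 5.5), `Grynkiewicz2009.exists_eq_add_of_mem_sdiff_periodicPart`
  (`φ_H(C ∖ C′) ⊆ φ_H(A₁ ∪ A₂) + φ_H(B ∖ B′)`), and **the reduction modulo `H`**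
  `Grynkiewicz2009.prop55_cases_mod` (finite `G`; in `G ⧸ H` with `𝒜 = {ā₁, ā₂}`, `ℬ = φ_H(B ∖ B′)`,
  `𝒞 = φ_H((A+B) ∖ C′)`: the disjunction of Proposition 5.5 holds), and **Case 1 is impossible**:
  `Grynkiewicz2009.case_one_false` (display (33), Kneser inside two cosets, `|H_i| ≤ ½|H|`, `|H| ∈ {2, 4}`,
  and a periodic superset of `A + B` with at most two new elements), with the helpers
  `addStab_subset_of_subset_vadd`, `two_mul_card_addStab_le`, `sub_mem_addStab_of_mem`,
  `card_mul_card_le_of_addStab_inter`.  The rest of Lemma 5.6 (Case 2, display (34), the conclusion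
  `d⊆(C, QP) = 1` for the six sets and (17)) is successor work. [cite: Grynkiewicz2009, Lemma 5.6 (proof)]
* **Lemma 5.11** (a special case of the Fainting Lemma of Hamidoune–Serra–Zémor)
  `Grynkiewicz2009.finite_and_card_le_of_two_le_addConvolution`: `0 ∈ A ∩ B`, `|A| = 3`, `⟨A⟩ = G`,
  `r_{A,B} ≥ 2` on `A + B` ⇒ `G` is finite and `|G| ≤ |B| + C(|A+B| − |B| + 1, 2)` (print:
  `|B| ≥ |G| − C(m+4, 2)` with `|A + B| = |A| + |B| + m`), any abelian `G`, with the layer step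
  `Grynkiewicz2009.card_layer_lt` (`|N_i| < |N_{i−1}|` via (39) and Kneser) and
  `addConvolution_comm`.  The tree's `fainting_three` (`TwoAtomsOfSmallSumsets.lean`,
  [HamidouneSerraZemor2008, Lemma 19] for `|Y| = 3`) is the finite-`G` statement under that paper's layer
  hypotheses; Lemma 5.11 is proved here independently, as printed. [cite: Grynkiewicz2009, Lemma 5.11]

Numbering: print (Mathematika 55) Lemma 5.1 / 5.2 / 5.3 / 5.4 / Prop 5.5 / Lemma 5.11 = arXiv:0710.1041v2 Lemma
4.5 / 4.7 / 4.6 / 4.8 / Prop 4.9 / Lemma 4.15; Propositions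
2.1–2.4 carry the same numbers in both.  DEVIATIONS: (a) Prop 2.4 is stated for a FINITE ambient group
(complements as finsets); print allows any abelian `G` with set complements — only the finite case is used
later (§5 from Lemma 5.6 on assumes `G` finite).  (b) In Props 2.2 and 2.3 the hypotheses `0 ∈ X ∩ Y`
(and, in 2.3, `U ⊆ Y`, nonemptiness) of print are not needed and omitted.  (c) In Lemma 5.11 the printed parameter `m` (`|A + B| = |A| + |B| + m`) is
eliminated: `m + 4 = |A + B| − |B| + 1`; "`G` is finite" is `Finite G` for the ambient TYPE (print: the
group generated by `A`, assumed to be all of `G`).  WHAT THIS FILE IS NOT: not KST, not Theorem 4.1, not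
Lemmas 5.6–5.10 beyond displays (31)–(32) of 5.6 (Lemma 5.8 is `QuasiProgressions.lean`; the rest of
5.6 and 5.7/5.9/5.10 are successor work); no `instance`, no notation, no named facts.

## References
* D. J. Grynkiewicz, *A step beyond Kemperman's structure theorem*, Mathematika 55 (2009) 67–114,
  doi:10.1112/S0025579300000966 — §2 (pp. 2–7), §5 Lemmas 5.1–5.4, Prop 5.5 (pp. 14–17), Lemma 5.11
  (p. 22) (held `paper:doi-10-1112-s0025579300000966`, read 2026-08-28; arXiv:0710.1041 §2, Lemmas
  4.5–4.8, Prop 4.9, Lemma 4.15)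
  [cite: Grynkiewicz2009, §2, Prop 2.3, Lemma 5.1, Lemma 5.2, Lemma 5.3, Lemma 5.4, Prop 5.5, Lemma 5.11].
* Y. O. Hamidoune, O. Serra, G. Zémor, *On the critical pair theory in abelian groups: beyond Chowla's
  theorem*, Combinatorica 28 (2008) 441–467 — the Fainting Lemma (Lemma 19), of which Lemma 5.11 is a
  special case; in the tree as `fainting_three` / `fainting` (`TwoAtomsOfSmallSumsets.lean`)
  [cite: HamidouneSerraZemor2008, Lemma 19].
* D. J. Grynkiewicz, *Quasi-periodic decompositions and the Kemperman structure theorem*, European J.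
  Combin. 26 (2005) 559–575 — origin of the quasi-periodic language (held
  `paper:doi-10-1016-j-ejc-2004-06-011`; not used in proofs here).
-/

namespace Literature.Combinatorics.Additive

open Finset
open scoped Pointwise

variable {G : Type*} [AddCommGroup G] [DecidableEq G]

/-! ### §2. `H`-periodic sets -/

/-- «A subset `A ⊆ G` is `H`-periodic if `A` is a union of `H`-cosets … equivalent to `A + H = A`»:
every element of the subgroup `H` is a period of the finset `A`. [cite: Grynkiewicz2009, §2] -/
def IsPeriodicWith (H : AddSubgroup G) (A : Finset G) : Prop := ∀ h ∈ H, h +ᵥ A = A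

namespace IsPeriodicWith

/-- The empty set is `H`-periodic for every `H`. [cite: Grynkiewicz2009, §2] -/
theorem empty (H : AddSubgroup G) : IsPeriodicWith H (∅ : Finset G) := fun h _ => by simp

/-- «Note that every set is `H`-periodic with `H` the trivial group.» [cite: Grynkiewicz2009, §2] -/
theorem bot (A : Finset G) : IsPeriodicWith (⊥ : AddSubgroup G) A := by
  intro h hh
  rw [AddSubgroup.mem_bot] at hh
  subst hh
  exact zero_vadd G A

/-- `H`-periodicity is inherited by smaller subgroups. [cite: Grynkiewicz2009, §2] -/
theorem mono {H K : AddSubgroup G} (hKH : K ≤ H) {A : Finset G} (hA : IsPeriodicWith H A) :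
    IsPeriodicWith K A := fun k hk => hA k (hKH hk)

/-- «Hence if `A` is `H`-periodic, then so is `A + B`.» [cite: Grynkiewicz2009, §2] -/
theorem add_right {H : AddSubgroup G} {A : Finset G} (hA : IsPeriodicWith H A) (B : Finset G) :
    IsPeriodicWith H (A + B) := by
  intro h hh
  rw [← vadd_add_assoc, hA h hh]

/-- If `A` is `H`-periodic then so is `B + A`. [cite: Grynkiewicz2009, §2] -/
theorem add_left {H : AddSubgroup G} {A : Finset G} (hA : IsPeriodicWith H A) (B : Finset G) :
    IsPeriodicWith H (B + A) := by
  rw [add_comm]; exact hA.add_right B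

/-- Translates of elements of an `H`-periodic set by elements of `H` stay in the set.
[cite: Grynkiewicz2009, §2] -/
theorem add_mem {H : AddSubgroup G} {A : Finset G} (hA : IsPeriodicWith H A) {h a : G} (hh : h ∈ H)
    (ha : a ∈ A) : h + a ∈ A := by
  rw [← hA h hh]; exact mem_vadd_finset.2 ⟨a, ha, rfl⟩

end IsPeriodicWith

/-- Bridge to `Kneser.lean`: a nonempty finset `A` is `H`-periodic iff `H ⊆ H(A)`, the stabilizer
(period) finset `A.addStab`. [cite: Grynkiewicz2009, §2] -/
theorem isPeriodicWith_iff_subset_addStab {H : AddSubgroup G} {A : Finset G} (hA : A.Nonempty) :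
    IsPeriodicWith H A ↔ (H : Set G) ⊆ (A.addStab : Set G) := by
  constructor
  · intro h x hx
    rw [mem_coe, mem_addStab hA]
    exact h x hx
  · intro h x hx
    have := h hx
    rw [mem_coe, mem_addStab hA] at this
    exact this

/-- A nonempty `H`-periodic finset with `H ≠ ⊥` is periodic: its stabilizer is not `{0}`.
[cite: Grynkiewicz2009, §2] -/
theorem IsPeriodicWith.addStab_ne_singleton_zero {H : AddSubgroup G} {A : Finset G}
    (hA : IsPeriodicWith H A) (hne : A.Nonempty) (hH : H ≠ ⊥) : A.addStab ≠ {0} := by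
  intro h0
  apply hH
  rw [eq_bot_iff]
  intro x hx
  have := (isPeriodicWith_iff_subset_addStab hne).1 hA hx
  rw [h0, coe_singleton, Set.mem_singleton_iff] at this
  rw [this]; exact (⊥ : AddSubgroup G).zero_mem

/-! ### §2. Quasi-periodic decompositions -/

/-- «A quasi-periodic decomposition of `A` with quasi-period `H`, where `H` is a nontrivial subgroup,
is a partition `A₁ ∪ A₀` of `A` into two disjoint (each possibly empty) subsets such that `A₁` is
`H`-periodic or empty, and `A₀` is a subset of an `H`-coset» (the last clause: all differences of
elements of `A₀` lie in `H`).  `A₁` is the periodic part, `A₀` the aperiodic part.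
[cite: Grynkiewicz2009, §2] -/
structure IsQuasiPeriodicDecomp (H : AddSubgroup G) (A A₁ A₀ : Finset G) : Prop where
  /-- the quasi-period is a nontrivial subgroup -/
  ne_bot : H ≠ ⊥
  /-- the two parts are disjoint -/
  disjoint : Disjoint A₁ A₀
  /-- and cover `A` -/
  union_eq : A₁ ∪ A₀ = A
  /-- the periodic part is `H`-periodic (or empty) -/
  periodic : IsPeriodicWith H A₁
  /-- the aperiodic part lies inside one `H`-coset -/
  sub_mem : ∀ x ∈ A₀, ∀ y ∈ A₀, x - y ∈ H

namespace IsQuasiPeriodicDecomp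

variable {H : AddSubgroup G} {A A₁ A₀ : Finset G}

/-- The periodic part is a subset of `A`. [cite: Grynkiewicz2009, §2] -/
theorem left_subset (h : IsQuasiPeriodicDecomp H A A₁ A₀) : A₁ ⊆ A := by
  rw [← h.union_eq]; exact subset_union_left

/-- The aperiodic part is a subset of `A`. [cite: Grynkiewicz2009, §2] -/
theorem right_subset (h : IsQuasiPeriodicDecomp H A A₁ A₀) : A₀ ⊆ A := by
  rw [← h.union_eq]; exact subset_union_right

/-- `|A| = |A₁| + |A₀|`. [cite: Grynkiewicz2009, §2] -/
theorem card_eq (h : IsQuasiPeriodicDecomp H A A₁ A₀) : #A = #A₁ + #A₀ := by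
  rw [← h.union_eq, card_union_of_disjoint h.disjoint]

/-- «Note every set has a quasi-periodic decomposition with `H = G` and `A₁ = ∅`» (in a nontrivial
group). [cite: Grynkiewicz2009, §2] -/
theorem top (A : Finset G) (hG : (⊤ : AddSubgroup G) ≠ ⊥) : IsQuasiPeriodicDecomp ⊤ A ∅ A where
  ne_bot := hG
  disjoint := disjoint_empty_left A
  union_eq := empty_union A
  periodic := IsPeriodicWith.empty ⊤
  sub_mem := fun _ _ _ _ => AddSubgroup.mem_top _

/-- The aperiodic part lies in the coset `a₀ + H` of any of its elements. [cite: Grynkiewicz2009, §2] -/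
theorem right_subset_vadd (h : IsQuasiPeriodicDecomp H A A₁ A₀) {a₀ : G} (ha₀ : a₀ ∈ A₀) :
    (A₀ : Set G) ⊆ a₀ +ᵥ (H : Set G) := by
  intro x hx
  refine ⟨x - a₀, h.sub_mem x (mem_coe.1 hx) a₀ ha₀, ?_⟩
  simp [vadd_eq_add]

end IsQuasiPeriodicDecomp

/-- «A set `A ⊆ G` is quasi-periodic if `A` has a quasi-periodic decomposition `A = A₁ ∪ A₀` with `A₁`
nonempty.» [cite: Grynkiewicz2009, §2] -/
def IsQuasiPeriodic (A : Finset G) : Prop :=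
  ∃ (H : AddSubgroup G) (A₁ A₀ : Finset G), IsQuasiPeriodicDecomp H A A₁ A₀ ∧ A₁.Nonempty

/-- A nonempty `H`-periodic set with `H ≠ ⊥` is quasi-periodic (`A₁ = A`, `A₀ = ∅`); in particular
periodic sets are quasi-periodic («`𝒫 ⊆ 𝒬𝒫`»). [cite: Grynkiewicz2009, §2] -/
theorem IsPeriodicWith.isQuasiPeriodic {H : AddSubgroup G} {A : Finset G} (hA : IsPeriodicWith H A)
    (hne : A.Nonempty) (hH : H ≠ ⊥) : IsQuasiPeriodic A :=
  ⟨H, A, ∅, ⟨hH, disjoint_empty_right A, union_empty A, hA, fun _ h => by simp at h⟩, hne⟩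

/-- A set which is not quasi-periodic has, in any quasi-periodic decomposition, an empty periodic part;
so it lies inside one coset of the quasi-period. [cite: Grynkiewicz2009, §2] -/
theorem IsQuasiPeriodicDecomp.left_eq_empty_of_not_isQuasiPeriodic {H : AddSubgroup G}
    {A A₁ A₀ : Finset G} (h : IsQuasiPeriodicDecomp H A A₁ A₀) (hA : ¬ IsQuasiPeriodic A) :
    A₁ = ∅ ∧ A₀ = A := by
  have h1 : A₁ = ∅ := by
    by_contra hne
    exact hA ⟨H, A₁, A₀, h, nonempty_iff_ne_empty.2 hne⟩
  refine ⟨h1, ?_⟩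
  have := h.union_eq
  rwa [h1, empty_union] at this

/-! ### §2. Non-extendible sets and pairs -/

/-- «We say that `A` is non-extendible, with respect to `B`, if `(A ∪ {a₀}) + B ≠ A + B` for all
`a₀ ∈ Ā`» (display (2)).  The pair `(A, B)` is non-extendible when `IsNonExtendible A B` and
`IsNonExtendible B A` both hold. [cite: Grynkiewicz2009, §2, display (2)] -/
def IsNonExtendible (A B : Finset G) : Prop := ∀ a ∉ A, insert a A + B ≠ A + B

/-- Unfolding: `A` is non-extendible w.r.t. `B` iff every `a ∉ A` has some `b ∈ B` with
`a + b ∉ A + B`. [cite: Grynkiewicz2009, §2, display (2)] -/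
theorem isNonExtendible_iff {A B : Finset G} :
    IsNonExtendible A B ↔ ∀ a ∉ A, ∃ b ∈ B, a + b ∉ A + B := by
  unfold IsNonExtendible
  refine forall₂_congr fun a ha => ?_
  constructor
  · intro h
    by_contra hcon
    push Not at hcon
    apply h
    apply Subset.antisymm
    · intro x hx
      obtain ⟨u, hu, b, hb, rfl⟩ := mem_add.1 hx
      rcases mem_insert.1 hu with rfl | hu
      · exact hcon b hb
      · exact add_mem_add hu hb
    · exact add_subset_add_right (subset_insert a A)
  · rintro ⟨b, hb, hab⟩ h
    apply hab
    rw [← h]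
    exact add_mem_add (mem_insert_self a A) hb

/-- A set non-extendible with respect to a nonempty `B`, in the ambient group of a proper sumset, misses
some element; conversely trivial: if `A + B = univ` in a finite group then every `A' ⊇ A` has the same
sumset, so non-extendibility forces `A = univ`. [cite: Grynkiewicz2009, §2] -/
theorem IsNonExtendible.eq_univ_of_add_eq_univ [Fintype G] {A B : Finset G} (h : IsNonExtendible A B)
    (hAB : A + B = univ) : A = univ := by
  rw [eq_univ_iff_forall]
  intro a
  by_contra ha
  obtain ⟨b, _, hab⟩ := isNonExtendible_iff.1 h a ha
  exact hab (hAB ▸ mem_univ _)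

/-! ### Proposition 2.1 -/

/-- **Proposition 2.1 (i):** «If `G` is finite, and `|A| + |B| ≥ |G| + 1`, then `A + B = G`.»
[cite: Grynkiewicz2009, Prop 2.1 (i)] -/
theorem add_eq_univ_of_card_le_card_add_card [Fintype G] {A B : Finset G}
    (h : Fintype.card G + 1 ≤ #A + #B) : A + B = univ := by
  rw [eq_univ_iff_forall]
  intro g
  have hB : #(g +ᵥ (-B)) = #B := by rw [card_vadd_finset, card_neg]
  have : #(univ : Finset G) < #A + #(g +ᵥ (-B)) := by rw [hB, card_univ]; omega
  obtain ⟨x, hx⟩ := inter_nonempty_of_card_lt_card_add_card (subset_univ _) (subset_univ _) this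
  rw [mem_inter] at hx
  obtain ⟨hxA, hxB⟩ := hx
  rw [mem_vadd_finset] at hxB
  obtain ⟨y, hy, rfl⟩ := hxB
  rw [mem_neg'] at hy
  exact mem_add.2 ⟨_, hxA, -y, hy, by simp [vadd_eq_add]⟩

/-- **Proposition 2.1 (ii):** «If `|A + B| < |A| + |B| − r`, then `r_{A,B}(g) > r` for every
`g ∈ A + B`» — the Kemperman–Scherk theorem of the tree (`kempermanScherk_card_add_card_le_add`), with
`r_{A,B} = Finset.addConvolution`. [cite: Grynkiewicz2009, Prop 2.1 (ii)] -/
theorem lt_addConvolution_of_card_add_lt {A B : Finset G} {r : ℕ} (h : #(A + B) + r < #A + #B)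
    {g : G} (hg : g ∈ A + B) : r < A.addConvolution B g := by
  have := kempermanScherk_card_add_card_le_add hg
  unfold addConvolution
  omega

/-! ### Proposition 2.2 -/

/-- **Proposition 2.2:** «Let `X, Y ⊆ G` be finite and nonempty … and let `i ≥ 1`.  If `r_{X,Y}(z) ≥ t`
for every `z ∈ X + Y`, then `r_{X+(i−1)Y, Y}(z) ≥ t` for every `z ∈ X + iY`» (here `iY` is the `i`-fold
sumset `i • Y`, `0 • Y = {0}`).  Proof as printed (shift `t` representations of `w ∈ X + (i−1)Y + Y` by
the last summand). [cite: Grynkiewicz2009, Prop 2.2] -/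
theorem le_addConvolution_add_nsmul (X Y : Finset G) (t : ℕ)
    (h : ∀ z ∈ X + Y, t ≤ X.addConvolution Y z) :
    ∀ i : ℕ, 1 ≤ i → ∀ z ∈ X + i • Y, t ≤ (X + (i - 1) • Y).addConvolution Y z := by
  intro i hi
  induction i with
  | zero => omega
  | succ i ih =>
    intro z hz
    rcases Nat.eq_zero_or_pos i with rfl | hi0
    · simpa using h z (by simpa using hz)
    simp only [add_tsub_cancel_right]
    rw [succ_nsmul, ← add_assoc] at hz
    obtain ⟨w, hw, y', hy', rfl⟩ := mem_add.1 hz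
    have ih' := ih hi0 w hw
    refine ih'.trans ?_
    unfold addConvolution
    refine card_le_card_of_injOn (fun p => (p.1 + y', p.2)) (fun p hp => ?_) (fun p hp q hq hpq => ?_)
    · rw [mem_coe, mem_filter, mem_product] at hp ⊢
      obtain ⟨⟨hp1, hp2⟩, hpw⟩ := hp
      refine ⟨⟨?_, hp2⟩, ?_⟩
      · have : X + i • Y = X + (i - 1) • Y + Y := by
          rw [add_assoc, ← succ_nsmul, show i - 1 + 1 = i by omega]
        rw [this]
        exact add_mem_add hp1 hy'
      · simp only
        rw [← hpw]; abel
    · simp only [Prod.mk.injEq, add_left_inj] at hpq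
      exact Prod.ext hpq.1 hpq.2

/-! ### Proposition 2.4 -/

/-- Display (3): `−B + (A + B)ᶜ ⊆ Aᶜ` for all `A, B` (finite ambient group).
[cite: Grynkiewicz2009, §2, display (3)] -/
theorem neg_add_compl_add_subset_compl [Fintype G] (A B : Finset G) : -B + (A + B)ᶜ ⊆ Aᶜ := by
  intro x hx
  obtain ⟨u, hu, c, hc, rfl⟩ := mem_add.1 hx
  rw [mem_neg'] at hu
  rw [mem_compl] at hc ⊢
  intro hA
  apply hc
  have : c = (u + c) + (-u) := by abel
  rw [this]
  exact add_mem_add hA hu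

/-- **Proposition 2.4 (first part):** «`A` is non-extendible, with respect to `B`, if and only if
`−B + (A + B)ᶜ = Aᶜ`» (display (4); finite ambient group, complements as finsets).
[cite: Grynkiewicz2009, Prop 2.4] -/
theorem isNonExtendible_iff_neg_add_compl_eq [Fintype G] {A B : Finset G} :
    IsNonExtendible A B ↔ -B + (A + B)ᶜ = Aᶜ := by
  rw [isNonExtendible_iff]
  constructor
  · intro h
    refine Subset.antisymm (neg_add_compl_add_subset_compl A B) fun a ha => ?_
    rw [mem_compl] at ha
    obtain ⟨b, hb, hab⟩ := h a ha
    exact mem_add.2 ⟨-b, by simpa using hb, a + b, mem_compl.2 hab, by abel⟩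
  · intro h a ha
    have ha' : a ∈ -B + (A + B)ᶜ := by rw [h]; exact mem_compl.2 ha
    obtain ⟨u, hu, c, hc, rfl⟩ := mem_add.1 ha'
    rw [mem_neg'] at hu
    refine ⟨-u, hu, ?_⟩
    rw [mem_compl] at hc
    simpa using hc

/-- `(−s)ᶜ = −(sᶜ)` for finsets of a finite group. [folklore] -/
private theorem compl_neg_eq [Fintype G] (s : Finset G) : (-s)ᶜ = -sᶜ := by
  ext x; simp [mem_neg']

/-- **Proposition 2.4 (second part):** if the pair `(A, B)` is non-extendible then so is the pair
`(−A, (A + B)ᶜ)` (whose sumset is `Bᶜ`, display (5)). [cite: Grynkiewicz2009, Prop 2.4] -/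
theorem isNonExtendible_pair_neg_compl [Fintype G] {A B : Finset G}
    (hA : IsNonExtendible A B) (hB : IsNonExtendible B A) :
    -A + (A + B)ᶜ = Bᶜ ∧ IsNonExtendible (-A) (A + B)ᶜ ∧ IsNonExtendible (A + B)ᶜ (-A) := by
  have h4 := isNonExtendible_iff_neg_add_compl_eq.1 hA
  have h5 := isNonExtendible_iff_neg_add_compl_eq.1 hB
  rw [add_comm B A] at h5
  refine ⟨h5, ?_, ?_⟩
  · rw [isNonExtendible_iff_neg_add_compl_eq, h5, compl_compl, compl_neg_eq, ← h4, neg_add, neg_neg,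
      add_comm]
  · rw [isNonExtendible_iff_neg_add_compl_eq, add_comm ((A + B)ᶜ) (-A), h5, compl_compl, neg_neg,
      compl_compl]

/-- **Proposition 2.4 (second part, the other pair):** if `(A, B)` is non-extendible then so is
`(−B, (A + B)ᶜ)` (whose sumset is `Aᶜ`). [cite: Grynkiewicz2009, Prop 2.4] -/
theorem isNonExtendible_pair_neg_compl' [Fintype G] {A B : Finset G}
    (hA : IsNonExtendible A B) (hB : IsNonExtendible B A) :
    -B + (A + B)ᶜ = Aᶜ ∧ IsNonExtendible (-B) (A + B)ᶜ ∧ IsNonExtendible (A + B)ᶜ (-B) := by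
  have := isNonExtendible_pair_neg_compl hB hA
  rwa [add_comm B A] at this

/-- «When `G` is finite … if `|A + B| = |A| + |B| + r` with `B` non-extendible, then Proposition 2.4
implies that `|−A + (A + B)ᶜ| = |−A| + |(A + B)ᶜ| + r` as well» (so a non-extendible pair with excess
`r` is part of a triple of such pairs). [cite: Grynkiewicz2009, §2 (after Prop 2.4)] -/
theorem card_neg_add_compl_add [Fintype G] {A B : Finset G} (hB : IsNonExtendible B A) (r : ℕ)
    (hAB : #(A + B) = #A + #B + r) : #(-A + (A + B)ᶜ) = #(-A) + #(A + B)ᶜ + r := by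
  have h5 := isNonExtendible_iff_neg_add_compl_eq.1 hB
  rw [add_comm B A] at h5
  rw [h5, card_compl, card_compl, card_neg]
  have : #(A + B) ≤ Fintype.card G := by
    rw [← card_univ]; exact card_le_card (subset_univ _)
  omega

end Literature.Combinatorics.Additive

/-! ### §5.  Preliminary lemmas: Lemma 5.1 and Lemma 5.2 -/

namespace Literature.Combinatorics.Additive.Grynkiewicz2009

open Finset Literature.Combinatorics.Additive
open scoped Pointwise

variable {G : Type*} [AddCommGroup G] [DecidableEq G]

/-- If `h + S ≠ S` then some element of `S` is moved out of `S` by `h`. [folklore] -/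
private theorem exists_vadd_not_mem_of_vadd_ne {S : Finset G} {h : G} (hS : h +ᵥ S ≠ S) :
    ∃ b ∈ S, h + b ∉ S := by
  by_contra hcon
  push Not at hcon
  apply hS
  apply eq_of_subset_of_card_le
  · intro x hx
    obtain ⟨b, hb, rfl⟩ := mem_vadd_finset.1 hx
    exact hcon b hb
  · rw [card_vadd_finset]

/-- If every `a ∈ A` is a period of `S`, then every element of `⟨A⟩` is (the periods form the subgroup
`AddAction.stabilizer G S`). [folklore] -/
private theorem forall_closure_vadd_eq {A : Finset G} {S : Finset G} (h : ∀ a ∈ A, a +ᵥ S = S) :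
    ∀ g ∈ AddSubgroup.closure (A : Set G), g +ᵥ S = S := by
  intro g hg
  have hle : AddSubgroup.closure (A : Set G) ≤ AddAction.stabilizer G S := by
    rw [AddSubgroup.closure_le]
    intro a ha
    exact AddAction.mem_stabilizer_iff.2 (h a (mem_coe.1 ha))
  exact AddAction.mem_stabilizer_iff.1 (hle hg)

/-- **Lemma 5.1 (Grynkiewicz 2009).**  «Let `A` and `B` be finite, nonempty subsets of an abelian group
`G` with `|A| ≥ 3`, `|A + B| = |A| + |B|`, and `0 ∈ A`, and let `H = ⟨A⟩`.  If `A + B` is aperiodic and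
`B` is non-extendible, then `B` has a quasi-periodic decomposition with quasi-period `H`.»
Proof as printed: let `B′` be the maximal `H`-periodic subset of `B` and `B ∖ B′ = B_{b₁} ∪ … ∪ B_{b_l}`
its `H`-coset decomposition; non-extendibility gives (18) `A + B_{bᵢ} ≠ bᵢ + H`; counting gives (19)
and, if `l ≥ 2`, (20) `|A + B_{b₁}| + |A + B_{b₂}| ≤ |A| + |B_{b₁}| + |B_{b₂}|`; Kneser's theorem (21) on
the two pieces with (22) `|A| ≥ 2|Hᵢ| − ρᵢ` forces `A` to be `Hᵢ`-periodic, whence (aperiodicity)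
`|Hᵢ| = 1` and `|A| ≤ 2`, a contradiction; so `l ≤ 1`, which is the decomposition.
(arXiv v2: Lemma 4.5.) [cite: Grynkiewicz2009, Lemma 5.1] -/
theorem exists_isQuasiPeriodicDecomp_closure {A B : Finset G} (hA3 : 3 ≤ #A) (h0 : (0 : G) ∈ A)
    (hBne : B.Nonempty) (hAB : #(A + B) = #A + #B) (haper : (A + B).addStab = {0})
    (hB : IsNonExtendible B A) :
    ∃ B₁ B₀ : Finset G, IsQuasiPeriodicDecomp (AddSubgroup.closure (A : Set G)) B B₁ B₀ := by
  classical
  set H := AddSubgroup.closure (A : Set G) with hH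
  have hAH : ∀ a ∈ A, a ∈ H := fun a ha => AddSubgroup.subset_closure (mem_coe.2 ha)
  -- `H` is nontrivial
  have hHbot : H ≠ ⊥ := by
    intro hbot
    have : A ⊆ {0} := fun a ha => by
      have := hAH a ha
      rw [hbot, AddSubgroup.mem_bot] at this
      exact mem_singleton.2 this
    have := card_le_card this
    rw [card_singleton] at this
    omega
  let π : G →+ G ⧸ H := QuotientAddGroup.mk' H
  have hπA : ∀ a ∈ A, π a = 0 := fun a ha => by
    rw [QuotientAddGroup.mk'_apply, QuotientAddGroup.eq_zero_iff]; exact hAH a ha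
  have hπeq : ∀ x y : G, π x = π y ↔ x - y ∈ H := fun x y => by
    rw [QuotientAddGroup.mk'_apply, QuotientAddGroup.mk'_apply, QuotientAddGroup.eq,
      ← neg_mem_iff (H := H)]
    simp [neg_add_eq_sub]
  -- the `H`-coset decomposition of `B`: fibres of `π`
  let fib : G ⧸ H → Finset G := fun c => B.filter (fun b => π b = c)
  have hfibB : ∀ c, fib c ⊆ B := fun c => filter_subset _ _
  have hmem_fib : ∀ c x, x ∈ fib c ↔ x ∈ B ∧ π x = c := fun c x => by simp [fib]
  -- `P` = the full (`H`-periodic) fibres (their union is `B′`), `Q` = the partially filled ones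
  let P : Finset (G ⧸ H) := (B.image π).filter (fun c => ∀ h ∈ H, h +ᵥ fib c = fib c)
  let Q : Finset (G ⧸ H) := (B.image π).filter (fun c => ¬ ∀ h ∈ H, h +ᵥ fib c = fib c)
  -- the fibre sums `A + B_{bᵢ}`
  let S : G ⧸ H → Finset G := fun c => A + fib c
  have hπS : ∀ c, ∀ x ∈ S c, π x = c := by
    intro c x hx
    obtain ⟨a, ha, b, hb, rfl⟩ := mem_add.1 hx
    rw [map_add, hπA a ha, zero_add]
    exact ((hmem_fib c b).1 hb).2
  have hfib_sub_S : ∀ c, fib c ⊆ S c := fun c => subset_add_right _ h0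
  -- (18): for a partially filled fibre, `A + B_{bᵢ}` is not `H`-invariant (non-extendibility of `B`)
  have step18 : ∀ c ∈ Q, ¬ ∀ h ∈ H, h +ᵥ S c = S c := by
    intro c hc hinv
    rw [mem_filter] at hc
    obtain ⟨_, hnot⟩ := hc
    push Not at hnot
    obtain ⟨h, hh, hne⟩ := hnot
    obtain ⟨b, hb, hhb⟩ := exists_vadd_not_mem_of_vadd_ne hne
    have hhbB : h + b ∉ B := by
      intro hcon
      apply hhb
      rw [hmem_fib]
      refine ⟨hcon, ?_⟩
      rw [map_add, ((hmem_fib c b).1 hb).2]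
      have : π h = 0 := by
        rw [QuotientAddGroup.mk'_apply, QuotientAddGroup.eq_zero_iff]; exact hh
      rw [this, zero_add]
    obtain ⟨a, ha, hab⟩ := isNonExtendible_iff.1 hB (h + b) hhbB
    apply hab
    have h1 : a + b ∈ S c := add_mem_add ha hb
    have h2 : h + (a + b) ∈ S c := by
      rw [← hinv h hh]; exact mem_vadd_finset.2 ⟨_, h1, rfl⟩
    have h3 : S c ⊆ A + B := add_subset_add_left (hfibB c)
    rw [add_comm B A, show h + b + a = h + (a + b) by abel]
    exact h3 h2
  -- (19): counting `|A + B|` and `|B|` fibrewise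
  have hBdecomp : B = (B.image π).biUnion fib := by
    ext x
    simp only [mem_biUnion, mem_image, hmem_fib]
    constructor
    · intro hx; exact ⟨π x, ⟨x, hx, rfl⟩, hx, rfl⟩
    · rintro ⟨c, _, hx, _⟩; exact hx
  have hABdecomp : A + B = (B.image π).biUnion S := by
    ext x
    simp only [mem_biUnion, mem_image]
    constructor
    · intro hx
      obtain ⟨a, ha, b, hb, rfl⟩ := mem_add.1 hx
      exact ⟨π b, ⟨b, hb, rfl⟩, add_mem_add ha ((hmem_fib _ b).2 ⟨hb, rfl⟩)⟩
    · rintro ⟨c, _, hx⟩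
      exact add_subset_add_left (hfibB c) hx
  have hdisjS : ((B.image π) : Set (G ⧸ H)).PairwiseDisjoint S := by
    intro c _ d _ hcd
    rw [Function.onFun, disjoint_left]
    intro x hxc hxd
    exact hcd ((hπS c x hxc).symm.trans (hπS d x hxd))
  have hdisjfib : ((B.image π) : Set (G ⧸ H)).PairwiseDisjoint fib := by
    intro c hc d hd hcd
    exact (hdisjS hc hd hcd).mono (hfib_sub_S c) (hfib_sub_S d)
  have hcardAB : #(A + B) = ∑ c ∈ B.image π, #(S c) := by
    rw [hABdecomp, card_biUnion hdisjS]
  have hcardB : #B = ∑ c ∈ B.image π, #(fib c) := by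
    conv_lhs => rw [hBdecomp]
    rw [card_biUnion hdisjfib]
  -- on a full fibre `A + B_c = B_c` (as `A ⊆ H`)
  have hSP : ∀ c ∈ P, S c = fib c := by
    intro c hc
    rw [mem_filter] at hc
    refine Subset.antisymm ?_ (hfib_sub_S c)
    intro x hx
    obtain ⟨a, ha, b, hb, rfl⟩ := mem_add.1 hx
    have := hc.2 a (hAH a ha)
    rw [← this]
    exact mem_vadd_finset.2 ⟨b, hb, rfl⟩
  have hPQ : ∀ f : G ⧸ H → ℕ, ∑ c ∈ B.image π, f c = ∑ c ∈ P, f c + ∑ c ∈ Q, f c := by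
    intro f
    rw [← sum_filter_add_sum_filter_not (B.image π) (fun c => ∀ h ∈ H, h +ᵥ fib c = fib c) f]
  have h19 : ∑ c ∈ Q, #(S c) = #A + ∑ c ∈ Q, #(fib c) := by
    have e1 := hcardAB
    have e2 := hcardB
    rw [hPQ] at e1 e2
    rw [sum_congr rfl (fun c hc => by rw [hSP c hc] : ∀ c ∈ P, #(S c) = #(fib c))] at e1
    omega
  -- the claim: at most one partially filled fibre (`l ≤ 1`)
  have hQ : #Q ≤ 1 := by
    by_contra hQ1
    rw [not_le, one_lt_card] at hQ1
    obtain ⟨c₁, hc₁, c₂, hc₂, hne⟩ := hQ1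
    -- (20)
    have hge : ∀ c ∈ Q, #(fib c) ≤ #(S c) := fun c _ => card_le_card (hfib_sub_S c)
    have h20 : #(S c₁) + #(S c₂) ≤ #A + #(fib c₁) + #(fib c₂) := by
      have hsub : ({c₁, c₂} : Finset (G ⧸ H)) ⊆ Q := by
        intro c hc; simp only [mem_insert, mem_singleton] at hc
        rcases hc with rfl | rfl <;> assumption
      have eS := sum_sdiff hsub (f := fun c => #(S c))
      have eF := sum_sdiff hsub (f := fun c => #(fib c))
      rw [sum_pair hne] at eS eF
      have hrest : ∑ c ∈ Q \ {c₁, c₂}, #(fib c) ≤ ∑ c ∈ Q \ {c₁, c₂}, #(S c) :=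
        sum_le_sum fun c hc => hge c (mem_sdiff.1 hc).1
      omega
    have hfibne : ∀ c ∈ Q, (fib c).Nonempty := by
      intro c hc
      rw [mem_filter, mem_image] at hc
      obtain ⟨⟨b, hb, hbc⟩, _⟩ := hc
      exact ⟨b, (hmem_fib c b).2 ⟨hb, hbc⟩⟩
    have hAne : A.Nonempty := ⟨0, h0⟩
    -- (21)–(22): Kneser's theorem on `A + B_{bᵢ}` with stabilizer `Hᵢ`, and `|A + Hᵢ| ≥ 2|Hᵢ|`
    have kneser : ∀ c ∈ Q, 2 * #(S c).addStab ≤ #(A + (S c).addStab) ∧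
        #(A + (S c).addStab) + #(fib c) ≤ #(S c) + #(S c).addStab ∧ #A ≤ #(A + (S c).addStab) := by
      intro c hc
      set K := (S c).addStab with hK
      have hSne : (S c).Nonempty := hAne.add (hfibne c hc)
      have hKne : K.Nonempty := hSne.addStab
      have h0K : (0 : G) ∈ K := hSne.zero_mem_addStab
      have hkn := add_kneser A (fib c)
      change #(A + K) + #(fib c + K) ≤ #(S c) + #K at hkn
      have hBK : #(fib c) ≤ #(fib c + K) := card_le_card (subset_add_left _ h0K)
      have hAK : #A ≤ #(A + K) := card_le_card (subset_add_left _ h0K)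
      refine ⟨?_, by omega, hAK⟩
      have hdvd : #K ∣ #(A + K) := card_addStab_dvd_card_add_addStab A (S c)
      obtain ⟨m, hm⟩ := hdvd
      have hKpos : 0 < #K := card_pos.2 hKne
      have hm2 : 2 ≤ m := by
        by_contra hm2
        rcases Nat.eq_zero_or_pos m with hm0 | hm0
        · rw [hm0, mul_zero] at hm; have := card_pos.2 (hAne.add hKne); omega
        have hm1' : m = 1 := by omega
        rw [hm1', mul_one] at hm
        -- `A + Hᵢ = Hᵢ`, so `A ⊆ Hᵢ`, so all of `H = ⟨A⟩` stabilises `A + B_{bᵢ}`: against (18)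
        have hKsub : K ⊆ A + K := subset_add_right _ h0
        have hAKeq : A + K = K := (eq_of_subset_of_card_le hKsub hm.le).symm
        have hAsubK : A ⊆ K := by
          intro a ha
          have : a + 0 ∈ A + K := add_mem_add ha h0K
          rw [add_zero, hAKeq] at this
          exact this
        apply step18 c hc
        apply forall_closure_vadd_eq
        intro a ha
        exact (mem_addStab hSne).1 (hAsubK ha)
      calc 2 * #K ≤ m * #K := Nat.mul_le_mul_right _ hm2
        _ = #(A + K) := by rw [hm, mul_comm]
    obtain ⟨k1a, k1b, k1c⟩ := kneser c₁ hc₁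
    obtain ⟨k2a, k2b, k2c⟩ := kneser c₂ hc₂
    -- (23): the arithmetic leaves `|A + Hᵢ| = |A|`, i.e. `A` is `Hᵢ`-periodic
    have hAK1 : #(A + (S c₁).addStab) = #A := by omega
    have hAK2 : #(A + (S c₂).addStab) = #A := by omega
    -- `A + Hᵢ = A` puts `Hᵢ` inside `H(A) ⊆ H(A + B) = {0}`
    have hKsmall : ∀ c ∈ Q, #(A + (S c).addStab) = #A → #(S c).addStab ≤ 1 := by
      intro c hc hAKc
      have hSne : (S c).Nonempty := hAne.add (hfibne c hc)
      have h0K : (0 : G) ∈ (S c).addStab := hSne.zero_mem_addStab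
      have hAKeq : A + (S c).addStab = A :=
        eq_of_subset_of_card_le (subset_add_left _ h0K) hAKc.le |>.symm
      have hsub : (S c).addStab ⊆ (A + B).addStab := by
        intro k hk
        have hkA : k ∈ A.addStab := by
          rw [mem_addStab hAne]
          apply eq_of_subset_of_card_le
          · intro x hx
            obtain ⟨a, ha, rfl⟩ := mem_vadd_finset.1 hx
            have hak : a + k ∈ A + (S c).addStab := add_mem_add ha hk
            rw [hAKeq] at hak
            rwa [vadd_eq_add, add_comm]
          · rw [card_vadd_finset]
        exact subset_addStab_add_left hBne hkA
      rw [haper] at hsub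
      simpa using card_le_card hsub
    have := hKsmall c₁ hc₁ hAK1
    have := hKsmall c₂ hc₂ hAK2
    omega
  -- conclusion: `B₁` = union of the full fibres, `B₀` = the (at most one) partially filled fibre
  refine ⟨B.filter (fun b => π b ∈ P), B.filter (fun b => π b ∉ P), ?_⟩
  refine ⟨hHbot, disjoint_filter_filter_not B B _, filter_union_filter_not_eq _ B, ?_, ?_⟩
  · intro h hh
    apply eq_of_subset_of_card_le
    · intro x hx
      obtain ⟨b, hb, rfl⟩ := mem_vadd_finset.1 hx
      rw [mem_filter] at hb ⊢
      obtain ⟨hbB, hbP⟩ := hb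
      have hπh : π h = 0 := by
        rw [QuotientAddGroup.mk'_apply, QuotientAddGroup.eq_zero_iff]; exact hh
      have hπ : π (h +ᵥ b) = π b := by rw [vadd_eq_add, map_add, hπh, zero_add]
      refine ⟨?_, by rw [hπ]; exact hbP⟩
      have hbfib : b ∈ fib (π b) := (hmem_fib _ b).2 ⟨hbB, rfl⟩
      have := (mem_filter.1 hbP).2 h hh
      have : h +ᵥ b ∈ fib (π b) := by rw [← this]; exact mem_vadd_finset.2 ⟨b, hbfib, rfl⟩
      exact hfibB _ this
    · rw [card_vadd_finset]
  · intro x hx y hy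
    rw [mem_filter] at hx hy
    have hxQ : π x ∈ Q := mem_filter.2 ⟨mem_image_of_mem _ hx.1, fun hcon =>
      hx.2 (mem_filter.2 ⟨mem_image_of_mem _ hx.1, hcon⟩)⟩
    have hyQ : π y ∈ Q := mem_filter.2 ⟨mem_image_of_mem _ hy.1, fun hcon =>
      hy.2 (mem_filter.2 ⟨mem_image_of_mem _ hy.1, hcon⟩)⟩
    have : π x = π y := card_le_one.1 hQ _ hxQ _ hyQ
    exact (hπeq x y).1 this

/-- **Lemma 5.1, for a set which is not quasi-periodic:** under the hypotheses of Lemma 5.1, if `B` is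
not quasi-periodic then `B` lies in ONE coset of `⟨A⟩`; if moreover `0 ∈ B` then `B ⊆ ⟨A⟩`
(the use made of Lemma 5.1 in Lemma 5.2). [cite: Grynkiewicz2009, Lemma 5.1, Lemma 5.2 (proof)] -/
theorem subset_closure_of_not_isQuasiPeriodic {A B : Finset G} (hA3 : 3 ≤ #A) (h0 : (0 : G) ∈ A)
    (h0B : (0 : G) ∈ B) (hAB : #(A + B) = #A + #B) (haper : (A + B).addStab = {0})
    (hB : IsNonExtendible B A) (hBqp : ¬ IsQuasiPeriodic B) :
    (B : Set G) ⊆ AddSubgroup.closure (A : Set G) := by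
  obtain ⟨B₁, B₀, hdec⟩ := exists_isQuasiPeriodicDecomp_closure hA3 h0 ⟨0, h0B⟩ hAB haper hB
  obtain ⟨-, hB0⟩ := hdec.left_eq_empty_of_not_isQuasiPeriodic hBqp
  intro b hb
  have := hdec.sub_mem b (by rw [hB0]; exact mem_coe.1 hb) 0 (by rw [hB0]; exact h0B)
  simpa using this

/-- **Lemma 5.2 (Grynkiewicz 2009).**  «Let `A` and `B` be finite, nonempty subsets of an abelian group
`G` with `|A + B| = |A| + |B|`, `0 ∈ A ∩ B`, and `|A|, |B| ≥ 3`.  If `A + B` is aperiodic, `(A, B)` is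
non-extendible, and neither `A` nor `B` is quasi-periodic, then `⟨A⟩ = ⟨B⟩`.»  Proof as printed: Lemma
5.1 twice. (arXiv v2: Lemma 4.7.) [cite: Grynkiewicz2009, Lemma 5.2] -/
theorem closure_eq_closure_of_not_isQuasiPeriodic {A B : Finset G} (hA3 : 3 ≤ #A) (hB3 : 3 ≤ #B)
    (h0A : (0 : G) ∈ A) (h0B : (0 : G) ∈ B) (hAB : #(A + B) = #A + #B)
    (haper : (A + B).addStab = {0}) (hA : IsNonExtendible A B) (hB : IsNonExtendible B A)
    (hAqp : ¬ IsQuasiPeriodic A) (hBqp : ¬ IsQuasiPeriodic B) :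
    AddSubgroup.closure (A : Set G) = AddSubgroup.closure (B : Set G) := by
  have hBA : #(B + A) = #B + #A := by rw [add_comm, hAB, add_comm]
  have haper' : (B + A).addStab = {0} := by rw [add_comm]; exact haper
  have h1 := subset_closure_of_not_isQuasiPeriodic hA3 h0A h0B hAB haper hB hBqp
  have h2 := subset_closure_of_not_isQuasiPeriodic hB3 h0B h0A hBA haper' hA hAqp
  exact le_antisymm ((AddSubgroup.closure_le _).2 h2) ((AddSubgroup.closure_le _).2 h1)

/-! ### §5.  Lemma 5.3: the transfer lemma for a quasi-periodic set -/

/-- **Lemma 5.3 (Grynkiewicz 2009).**  «Let `A` and `B` be finite, nonempty subsets of an abelian group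
`G` with `A + B` aperiodic and `(A, B)` non-extendible, and let `A = A₁ ∪ A₀` be a quasi-periodic
decomposition with `A₁` nonempty and periodic with maximal period `H`.  If `|A + B| = |A| + |B|`, then
`B` has a quasi-periodic decomposition `B = B₁ ∪ B₀` with quasi-period `H`, such that:
(i) `φ_H(A₀) + φ_H(B₀)` is a unique expression element in `φ_H(A) + φ_H(B)`,
(ii) `|φ_H(A + B)| = |φ_H(A)| + |φ_H(B)| − 1`, (iii) `|A₀ + B₀| = |A₀| + |B₀|`.»
Here «maximal period `H`» is the hypothesis `(H : Set G) = H(A₁)` (`= ↑A₁.addStab`).  The conclusion is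
given as: the decomposition; `A₀ ≠ ∅`, `B₀ ≠ ∅`; (iii); the disjoint splitting
`A + B = (A₁ + B) ⊔ (A₀ + B₀)` of the printed proof (from which (ii) is read off: `A₁ + B` is
`H`-periodic with `|φ_H(A₁ + B)| = |φ_H(A₁)| + |φ_H(B)| − 1`, recorded as display (27)
`|A₁ + B| + |H| = |A₁| + |B + H|`); and (i) in membership form: every representation `a + b`
(`a ∈ A`, `b ∈ B`) of an element of the coset `A₀ + B₀ + H` has `a ∈ A₀` and `b ∈ B₀`.
Proof as printed, displays (24)–(30): the `H`-coset decomposition of `B`, non-extendibility for (24)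
and for the disjointness of each `A₀ + B_{bᵢ}` from `A₁ + B`, maximality of `H` + non-extendibility of
`A` for `H(A₁ + B) = H`, Kneser's theorem for (25)/(27) and on each `A₀ + B_{bᵢ}` for (29), and the
final count (30). (arXiv v2: Lemma 4.6.) [cite: Grynkiewicz2009, Lemma 5.3] -/
theorem exists_isQuasiPeriodicDecomp_of_isQuasiPeriodicDecomp {A B A₁ A₀ : Finset G} {H : AddSubgroup G}
    (hdec : IsQuasiPeriodicDecomp H A A₁ A₀) (hA₁ : A₁.Nonempty)
    (hHA₁ : (H : Set G) = (A₁.addStab : Set G))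
    (hBne : B.Nonempty) (hAB : #(A + B) = #A + #B) (haper : (A + B).addStab = {0})
    (hA : IsNonExtendible A B) (hB : IsNonExtendible B A) :
    ∃ B₁ B₀ : Finset G, IsQuasiPeriodicDecomp H B B₁ B₀ ∧ A₀.Nonempty ∧ B₀.Nonempty ∧
      #(A₀ + B₀) = #A₀ + #B₀ ∧
      A + B = (A₁ + B) ∪ (A₀ + B₀) ∧ Disjoint (A₁ + B) (A₀ + B₀) ∧
      #(A₁ + B) + #A₁.addStab = #A₁ + #(B + A₁.addStab) ∧
      (∀ a ∈ A, ∀ b ∈ B, ∀ a₀ ∈ A₀, ∀ b₀ ∈ B₀, a + b - (a₀ + b₀) ∈ H → a ∈ A₀ ∧ b ∈ B₀) := by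
  classical
  -- the period finset `Hf = H(A₁)` and its identification with `H`
  set Hf := A₁.addStab with hHf
  have hmemH : ∀ x : G, x ∈ H ↔ x ∈ Hf := fun x => by
    rw [← SetLike.mem_coe, hHA₁, mem_coe]
  have h0Hf : (0 : G) ∈ Hf := hA₁.zero_mem_addStab
  have hHfne : Hf.Nonempty := ⟨0, h0Hf⟩
  have hper : ∀ h ∈ Hf, h +ᵥ A₁ = A₁ := fun h hh => (mem_addStab hA₁).1 hh
  have hperH : ∀ h ∈ H, h +ᵥ A₁ = A₁ := fun h hh => hper h ((hmemH h).1 hh)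
  have hA₁Hf : A₁ + Hf = A₁ := add_addStab A₁
  -- `Hf ≠ {0}`
  have hHf0 : Hf ≠ {0} := by
    intro h0
    apply hdec.ne_bot
    rw [eq_bot_iff]; intro x hx
    have := (hmemH x).1 hx
    rw [h0, mem_singleton] at this
    rw [this]; exact AddSubgroup.zero_mem _
  have hA₁A : A₁ ⊆ A := by rw [← hdec.union_eq]; exact subset_union_left
  have hA₀A : A₀ ⊆ A := by rw [← hdec.union_eq]; exact subset_union_right
  have hAcard := hdec.card_eq
  -- `A₁ + B` is `Hf`-periodic
  have hA₁Bper : ∀ h ∈ Hf, h +ᵥ (A₁ + B) = A₁ + B := fun h hh => by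
    rw [← vadd_add_assoc, hper h hh]
  -- F2: `A₀` is nonempty (else `A + B = A₁ + B` periodic)
  have hA₀ne : A₀.Nonempty := by
    rw [nonempty_iff_ne_empty]; intro h0
    have hAeq : A = A₁ := by rw [← hdec.union_eq, h0, union_empty]
    have : Hf ⊆ (A + B).addStab := by rw [hAeq]; exact subset_addStab_add_left hBne
    rw [haper] at this
    exact hHf0 (subset_singleton_iff'.1 this |> fun h => by
      exact eq_singleton_iff_unique_mem.2 ⟨h0Hf, h⟩)
  obtain ⟨a₀, ha₀⟩ := hA₀ne
  -- the coset of `A₀` misses `A₁`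
  have hA₀coset : ∀ x ∈ A₀, ∀ h ∈ Hf, h + x ∉ A₁ := by
    intro x hx h hh hcon
    have : x ∈ A₁ := by
      have hneg : -h ∈ Hf := by rw [← hmemH] at hh ⊢; exact H.neg_mem hh
      have := hper (-h) hneg
      rw [← this]; exact mem_vadd_finset.2 ⟨h + x, hcon, by simp⟩
    exact disjoint_left.1 hdec.disjoint this hx
  -- F4: `A₀` is not a full `Hf`-coset: `#A₀ < #Hf`
  have hA₀sub : A₀ ⊆ a₀ +ᵥ Hf := by
    intro x hx
    exact mem_vadd_finset.2 ⟨x - a₀, (hmemH _).1 (hdec.sub_mem x hx a₀ ha₀), by simp⟩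
  have hA₀lt : #A₀ < #Hf := by
    rw [← card_vadd_finset a₀ Hf]
    refine card_lt_card ⟨hA₀sub, fun hsub => ?_⟩
    have hA₀eq : A₀ = a₀ +ᵥ Hf := Subset.antisymm hA₀sub hsub
    -- then `A` is `Hf`-periodic, so `A + B` is periodic
    have hAper : ∀ h ∈ Hf, h +ᵥ A = A := by
      intro h hh
      apply eq_of_subset_of_card_le _ (by rw [card_vadd_finset])
      intro y hy
      obtain ⟨x, hx, rfl⟩ := mem_vadd_finset.1 hy
      rw [← hdec.union_eq, mem_union] at hx ⊢
      rcases hx with hx | hx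
      · left; rw [← hper h hh]; exact mem_vadd_finset.2 ⟨x, hx, rfl⟩
      · right
        rw [hA₀eq] at hx ⊢
        obtain ⟨k, hk, rfl⟩ := mem_vadd_finset.1 hx
        refine mem_vadd_finset.2 ⟨h + k, ?_, by simp [vadd_eq_add]; abel⟩
        rw [← hmemH] at hh hk ⊢; exact H.add_mem hh hk
    have hAne : A.Nonempty := ⟨a₀, hA₀A ha₀⟩
    have : Hf ⊆ (A + B).addStab := fun h hh =>
      subset_addStab_add_left hBne ((mem_addStab hAne).2 (hAper h hh))
    rw [haper] at this
    exact hHf0 (eq_singleton_iff_unique_mem.2 ⟨h0Hf, fun x hx => mem_singleton.1 (this hx)⟩)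
  -- the quotient map and the fibres of `B`
  let π : G →+ G ⧸ H := QuotientAddGroup.mk' H
  have hπH : ∀ h : G, π h = 0 ↔ h ∈ H := fun h => by
    rw [QuotientAddGroup.mk'_apply, QuotientAddGroup.eq_zero_iff]
  have hπeq : ∀ x y : G, π x = π y ↔ x - y ∈ H := fun x y => by
    rw [QuotientAddGroup.mk'_apply, QuotientAddGroup.mk'_apply, QuotientAddGroup.eq,
      ← neg_mem_iff (H := H)]
    simp [neg_add_eq_sub]
  let fib : G ⧸ H → Finset G := fun c => B.filter (fun b => π b = c)
  have hfibB : ∀ c, fib c ⊆ B := fun c => filter_subset _ _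
  have hmem_fib : ∀ c x, x ∈ fib c ↔ x ∈ B ∧ π x = c := fun c x => by simp [fib]
  let P : Finset (G ⧸ H) := (B.image π).filter (fun c => ∀ h ∈ Hf, h +ᵥ fib c = fib c)
  let Q : Finset (G ⧸ H) := (B.image π).filter (fun c => ¬ ∀ h ∈ Hf, h +ᵥ fib c = fib c)
  have hPQ : ∀ f : G ⧸ H → ℕ, ∑ c ∈ B.image π, f c = ∑ c ∈ P, f c + ∑ c ∈ Q, f c := by
    intro f
    rw [← sum_filter_add_sum_filter_not (B.image π) (fun c => ∀ h ∈ Hf, h +ᵥ fib c = fib c) f]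
  have hBdecomp : B = (B.image π).biUnion fib := by
    ext x
    simp only [mem_biUnion, mem_image, hmem_fib]
    constructor
    · intro hx; exact ⟨π x, ⟨x, hx, rfl⟩, hx, rfl⟩
    · rintro ⟨c, _, hx, _⟩; exact hx
  -- a partially filled fibre has an element of its coset outside `B`, next to an element of `B`
  have hpartial : ∀ c ∈ Q, ∃ b ∈ fib c, ∃ h ∈ Hf, h + b ∉ B := by
    intro c hc
    rw [mem_filter] at hc
    obtain ⟨_, hnot⟩ := hc
    push Not at hnot
    obtain ⟨h, hh, hne⟩ := hnot
    obtain ⟨b, hb, hhb⟩ := exists_vadd_not_mem_of_vadd_ne hne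
    refine ⟨b, hb, h, hh, fun hcon => hhb ?_⟩
    rw [hmem_fib]
    refine ⟨hcon, ?_⟩
    rw [map_add, ((hmem_fib c b).1 hb).2, (hπH h).2 ((hmemH h).2 hh), zero_add]
  -- the piece sums `A₀ + B_c` lie in single cosets
  let S : G ⧸ H → Finset G := fun c => A₀ + fib c
  have hπS : ∀ c, ∀ x ∈ S c, π x = π a₀ + c := by
    intro c x hx
    obtain ⟨a, ha, b, hb, rfl⟩ := mem_add.1 hx
    rw [map_add, ((hmem_fib c b).1 hb).2, (hπeq a a₀).2 (hdec.sub_mem a ha a₀ ha₀)]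
  -- if some element of a coset lies in the `Hf`-periodic set `A₁ + B`, the whole coset does
  have hcoset_sub : ∀ x ∈ A₁ + B, ∀ y : G, y - x ∈ H → y ∈ A₁ + B := by
    intro x hx y hy
    have := hA₁Bper (y - x) ((hmemH _).1 hy)
    rw [← this]
    exact mem_vadd_finset.2 ⟨x, hx, by simp⟩
  -- extending `B` by a coset-neighbour `h + b ∉ B` of `b ∈ B`: `A₁ + (h + b) ⊆ A + B` always
  have hA₁ext : ∀ b ∈ B, ∀ h ∈ Hf, ∀ a ∈ A₁, h + b + a ∈ B + A := by
    intro b hb h hh a ha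
    rw [add_comm B A, show h + b + a = (h + a) + b by abel]
    apply add_mem_add _ hb
    apply hA₁A
    rw [← hper h hh]; exact mem_vadd_finset.2 ⟨a, ha, rfl⟩
  -- (24′): for a partially filled fibre, `A₀ + B_c` misses `A₁ + B`
  have h24' : ∀ c ∈ Q, Disjoint (S c) (A₁ + B) := by
    intro c hc
    rw [disjoint_left]
    intro x hxS hxAB
    obtain ⟨b, hb, h, hh, hhb⟩ := hpartial c hc
    obtain ⟨a, ha, hab⟩ := isNonExtendible_iff.1 hB (h + b) hhb
    apply hab
    rw [← hdec.union_eq, mem_union] at ha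
    rcases ha with ha | ha
    · exact hA₁ext b (hfibB c hb) h hh a ha
    · -- `h + b + a` lies in the coset of `x ∈ A₁ + B`
      rw [add_comm B A]
      apply add_subset_add_right hA₁A
      apply hcoset_sub x hxAB
      rw [← hπeq, map_add, map_add, (hπH h).2 ((hmemH h).2 hh), zero_add,
        ((hmem_fib c b).1 hb).2, hπS c x hxS, (hπeq a a₀).2 (hdec.sub_mem a ha a₀ ha₀), add_comm]
  -- (24): for a partially filled fibre, `A₀ + B_c` is not the full coset; so its stabilizer is small
  have h24 : ∀ c ∈ Q, ∀ b ∈ fib c, ¬ ((a₀ + b) +ᵥ Hf ⊆ S c) := by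
    intro c hc b₁ hb₁ hfull
    obtain ⟨b, hb, h, hh, hhb⟩ := hpartial c hc
    obtain ⟨a, ha, hab⟩ := isNonExtendible_iff.1 hB (h + b) hhb
    apply hab
    rw [← hdec.union_eq, mem_union] at ha
    rcases ha with ha | ha
    · exact hA₁ext b (hfibB c hb) h hh a ha
    · rw [add_comm B A]
      apply add_subset_add hA₀A (hfibB c)
      apply hfull
      refine mem_vadd_finset.2 ⟨h + b + a - (a₀ + b₁), (hmemH _).1 ?_, by simp [vadd_eq_add]⟩
      rw [← hπeq, map_add, map_add, map_add, (hπH h).2 ((hmemH h).2 hh), zero_add,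
        ((hmem_fib c b).1 hb).2, ((hmem_fib c b₁).1 hb₁).2,
        (hπeq a a₀).2 (hdec.sub_mem a ha a₀ ha₀), add_comm]
  -- `B` is not `Hf`-periodic (else `A + B` would be periodic): some fibre is partially filled
  have hQne : Q.Nonempty := by
    by_contra hQ
    rw [not_nonempty_iff_eq_empty] at hQ
    have hall : ∀ c ∈ B.image π, ∀ h ∈ Hf, h +ᵥ fib c = fib c := by
      intro c hc h hh
      by_contra hne
      have : c ∈ Q := mem_filter.2 ⟨hc, fun hcon => hne (hcon h hh)⟩
      rw [hQ] at this; exact notMem_empty _ this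
    have hBper : ∀ h ∈ Hf, h +ᵥ B = B := by
      intro h hh
      apply eq_of_subset_of_card_le _ (by rw [card_vadd_finset])
      intro y hy
      obtain ⟨b, hb, rfl⟩ := mem_vadd_finset.1 hy
      have hbfib : b ∈ fib (π b) := (hmem_fib _ b).2 ⟨hb, rfl⟩
      have := hall (π b) (mem_image_of_mem _ hb) h hh
      exact hfibB _ (by rw [← this]; exact mem_vadd_finset.2 ⟨b, hbfib, rfl⟩)
    have hAne : A.Nonempty := ⟨a₀, hA₀A ha₀⟩
    have : Hf ⊆ (A + B).addStab := fun h hh =>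
      subset_addStab_add_right hAne ((mem_addStab hBne).2 (hBper h hh))
    rw [haper] at this
    exact hHf0 (eq_singleton_iff_unique_mem.2 ⟨h0Hf, fun x hx => mem_singleton.1 (this hx)⟩)
  -- the stabilizer of `A₁ + B` is exactly `Hf` (maximality of the period + non-extendibility of `A`)
  have hK : (A₁ + B).addStab = Hf := by
    refine Subset.antisymm ?_ (subset_addStab_add_left hBne)
    intro k hk
    by_contra hkH
    have hA₁B : (A₁ + B).Nonempty := hA₁.add hBne
    have hkper : k +ᵥ (A₁ + B) = A₁ + B := (mem_addStab hA₁B).1 hk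
    have hkA₁ : k +ᵥ A₁ ≠ A₁ := fun h => hkH ((mem_addStab hA₁).2 h)
    obtain ⟨a, ha, hka⟩ := exists_vadd_not_mem_of_vadd_ne hkA₁
    -- every `k + (h + a)`, `h ∈ Hf`, lies in `A` (non-extendibility) but not in `A₁`, so in `A₀`
    have hcos : (k + a) +ᵥ Hf ⊆ A₀ := by
      intro y hy
      obtain ⟨h, hh, rfl⟩ := mem_vadd_finset.1 hy
      have hha : h + a ∈ A₁ := by rw [← hper h hh]; exact mem_vadd_finset.2 ⟨a, ha, rfl⟩
      have hy1 : k + a + h ∉ A₁ := by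
        intro hcon
        apply hka
        have hneg : -h ∈ Hf := by
          have := (hmemH h).2 hh
          exact (hmemH _).1 (H.neg_mem this)
        rw [← hper (-h) hneg]
        exact mem_vadd_finset.2 ⟨k + a + h, hcon, by rw [vadd_eq_add]; abel⟩
      have hyA : k + a + h ∈ A := by
        by_contra hyA
        obtain ⟨b, hb, hyb⟩ := isNonExtendible_iff.1 hA _ hyA
        apply hyb
        have : k + a + h + b = k + ((h + a) + b) := by abel
        rw [this]
        have h1 : (h + a) + b ∈ A₁ + B := add_mem_add hha hb
        have h2 : k + ((h + a) + b) ∈ A₁ + B := by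
          rw [← hkper]; exact mem_vadd_finset.2 ⟨_, h1, rfl⟩
        exact add_subset_add_right hA₁A h2
      rw [← hdec.union_eq, mem_union] at hyA
      rcases hyA with hyA | hyA
      · exact absurd hyA hy1
      · simpa [vadd_eq_add] using hyA
    have := card_le_card hcos
    rw [card_vadd_finset] at this
    omega
  -- (25)/(27): Kneser for `(A₁, B)` and the excess count
  have hA₁Bne : (A₁ + B).Nonempty := hA₁.add hBne
  have h25 : #A₁ + #(B + Hf) ≤ #(A₁ + B) + #Hf := by
    have := add_kneser A₁ B
    rwa [hK, hA₁Hf] at this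
  have hdvdA₁ : #Hf ∣ #A₁ := card_addStab_dvd_card A₁
  have hdvdA₁B : #Hf ∣ #(A₁ + B) := by rw [← hK]; exact card_addStab_dvd_card (A₁ + B)
  have hdvdBH : #Hf ∣ #(B + Hf) := card_addStab_dvd_card_add_addStab B A₁
  -- `|B + Hf| > |B|`
  have hBHf : #B + 1 ≤ #(B + Hf) := by
    obtain ⟨c, hc⟩ := hQne
    obtain ⟨b, hb, h, hh, hhb⟩ := hpartial c hc
    have hsub : B ⊆ B + Hf := subset_add_left B h0Hf
    have hne : B ≠ B + Hf := by
      intro heq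
      apply hhb
      rw [heq, add_comm h b]
      exact add_mem_add (hfibB c hb) hh
    exact card_lt_card (ssubset_of_ne_of_subset hne hsub)
  -- (26): `|A + B| ≥ |A₁ + B| + |A₀|`
  have hSsub : ∀ c, S c ⊆ A + B := fun c => add_subset_add hA₀A (hfibB c)
  have hScard : ∀ c ∈ B.image π, #A₀ ≤ #(S c) := by
    intro c hc
    rw [mem_image] at hc
    obtain ⟨b, hb, rfl⟩ := hc
    exact card_le_card_add_right ⟨b, (hmem_fib _ b).2 ⟨hb, rfl⟩⟩
  have hQsub : Q ⊆ B.image π := filter_subset _ _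
  have hPsub : P ⊆ B.image π := filter_subset _ _
  have h26 : #(A₁ + B) + #A₀ ≤ #(A + B) := by
    obtain ⟨c, hc⟩ := hQne
    calc #(A₁ + B) + #A₀ ≤ #(A₁ + B) + #(S c) := by
          have := hScard c (hQsub hc); omega
      _ = #((A₁ + B) ∪ S c) := by rw [card_union_of_disjoint (h24' c hc).symm]
      _ ≤ #(A + B) := card_le_card (union_subset (add_subset_add_right hA₁A) (hSsub c))
  have h27 : #(A₁ + B) + #Hf = #A₁ + #(B + Hf) := by
    obtain ⟨u, hu⟩ := hdvdA₁B
    obtain ⟨p, hp⟩ := hdvdA₁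
    obtain ⟨q, hq⟩ := hdvdBH
    have hm : 0 < #Hf := card_pos.2 hHfne
    rw [hu, hp, hq] at h25 ⊢
    have h1 : p + q ≤ u + 1 := by
      have : (p + q) * #Hf ≤ (u + 1) * #Hf := by nlinarith
      exact Nat.le_of_mul_le_mul_right this hm
    rcases Nat.lt_or_ge (p + q) (u + 1) with hlt | hge
    · -- `p + q ≤ u` contradicts (26)
      exfalso
      have : (p + q) * #Hf ≤ u * #Hf := Nat.mul_le_mul_right _ (by omega)
      have h26' := h26
      rw [hu] at h26'
      nlinarith
    · have : p + q = u + 1 := le_antisymm h1 hge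
      calc #Hf * u + #Hf = #Hf * (u + 1) := by ring
        _ = #Hf * (p + q) := by rw [this]
        _ = #Hf * p + #Hf * q := by ring
  -- full fibres: `B_c ⊇ b + Hf`, so `|B_c| ≥ |Hf|` and `A₀ + B_c ⊇ (a₀ + b) + Hf`
  have hfull : ∀ c ∈ P, ∀ b ∈ fib c, b +ᵥ Hf ⊆ fib c := by
    intro c hc b hb y hy
    obtain ⟨k, hk, rfl⟩ := mem_vadd_finset.1 hy
    have := (mem_filter.1 hc).2 k hk
    rw [← this]; exact mem_vadd_finset.2 ⟨b, hb, by rw [vadd_eq_add, vadd_eq_add, add_comm]⟩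
  -- `A₀ + B′ ⊆ A₁ + B`: every full-fibre piece lies inside `A₁ + B`
  have hSP : ∀ c ∈ P, S c ⊆ A₁ + B := by
    intro c hc
    by_contra hnot
    -- then `S c` misses `A₁ + B` entirely
    have hdisj : Disjoint (S c) (A₁ + B) := by
      rw [disjoint_left]
      intro x hx hxAB
      apply hnot
      intro y hy
      apply hcoset_sub x hxAB
      rw [← hπeq, hπS c y hy, hπS c x hx]
    have hcP : c ∈ B.image π := hPsub hc
    obtain ⟨b, hb⟩ : (fib c).Nonempty := by
      rw [mem_image] at hcP; obtain ⟨b, hb, rfl⟩ := hcP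
      exact ⟨b, (hmem_fib _ b).2 ⟨hb, rfl⟩⟩
    have hSc : #Hf ≤ #(S c) := by
      have : (a₀ + b) +ᵥ Hf ⊆ S c := by
        intro y hy
        obtain ⟨k, hk, rfl⟩ := mem_vadd_finset.1 hy
        have : a₀ + b + k = a₀ + (k + b) := by abel
        rw [vadd_eq_add, this]
        exact add_mem_add ha₀ (hfull c hc b hb (mem_vadd_finset.2 ⟨k, hk, by rw [vadd_eq_add, add_comm]⟩))
      have := card_le_card this
      rwa [card_vadd_finset] at this
    obtain ⟨c', hc'⟩ := hQne
    have hcc' : c ≠ c' := by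
      intro h; rw [h] at hc
      exact (mem_filter.1 hc').2 (mem_filter.1 hc).2
    have hdisj2 : Disjoint (S c) (S c') := by
      rw [disjoint_left]; intro x hx hx'
      exact hcc' (add_left_cancel ((hπS c x hx).symm.trans (hπS c' x hx')))
    have hunion : (A₁ + B) ∪ S c ∪ S c' ⊆ A + B :=
      union_subset (union_subset (add_subset_add_right hA₁A) (hSsub c)) (hSsub c')
    have := card_le_card hunion
    rw [card_union_of_disjoint (disjoint_union_left.2 ⟨(h24' c' hc').symm, hdisj2⟩),
      card_union_of_disjoint hdisj.symm] at this
    have := hScard c' (hQsub hc')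
    omega
  -- the decomposition `A + B = (A₁ + B) ⊔ ⨆_{c ∈ Q} (A₀ + B_c)`
  have hABdecomp : A + B = (A₁ + B) ∪ Q.biUnion S := by
    apply Subset.antisymm
    · intro x hx
      obtain ⟨a, ha, b, hb, rfl⟩ := mem_add.1 hx
      rw [← hdec.union_eq, mem_union] at ha
      rw [mem_union, mem_biUnion]
      rcases ha with ha | ha
      · left; exact add_mem_add ha hb
      · have hbfib : b ∈ fib (π b) := (hmem_fib _ b).2 ⟨hb, rfl⟩
        have hS : a + b ∈ S (π b) := add_mem_add ha hbfib
        by_cases hP : π b ∈ P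
        · left; exact hSP _ hP hS
        · right; exact ⟨π b, mem_filter.2 ⟨mem_image_of_mem _ hb, fun h => hP
            (mem_filter.2 ⟨mem_image_of_mem _ hb, h⟩)⟩, hS⟩
    · exact union_subset (add_subset_add_right hA₁A)
        (biUnion_subset.2 fun c _ => hSsub c)
  have hdisjS : (Q : Set (G ⧸ H)).PairwiseDisjoint S := by
    intro c _ d _ hcd
    rw [Function.onFun, disjoint_left]
    intro x hxc hxd
    exact hcd (add_left_cancel ((hπS c x hxc).symm.trans (hπS d x hxd)))
  have hdisjU : Disjoint (A₁ + B) (Q.biUnion S) := by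
    rw [disjoint_biUnion_right]; exact fun c hc => (h24' c hc).symm
  have hcardAB : #(A + B) = #(A₁ + B) + ∑ c ∈ Q, #(S c) := by
    rw [hABdecomp, card_union_of_disjoint hdisjU, card_biUnion hdisjS]
  -- fibrewise counts of `B` and `B + Hf`
  have hdisjfib : ((B.image π) : Set (G ⧸ H)).PairwiseDisjoint fib := by
    intro c _ d _ hcd
    rw [Function.onFun, disjoint_left]
    intro x hxc hxd
    exact hcd (((hmem_fib c x).1 hxc).2.symm.trans ((hmem_fib d x).1 hxd).2)
  have hcardB : #B = ∑ c ∈ P, #(fib c) + ∑ c ∈ Q, #(fib c) := by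
    rw [← hPQ]
    conv_lhs => rw [hBdecomp]
    rw [card_biUnion hdisjfib]
  have hfibcard : ∀ c ∈ P, #(fib c) = #Hf := by
    intro c hc
    have hcP : c ∈ B.image π := hPsub hc
    obtain ⟨b, hb⟩ : (fib c).Nonempty := by
      rw [mem_image] at hcP; obtain ⟨b, hb, rfl⟩ := hcP
      exact ⟨b, (hmem_fib _ b).2 ⟨hb, rfl⟩⟩
    apply le_antisymm
    · -- `fib c ⊆ b + Hf`
      have : fib c ⊆ b +ᵥ Hf := fun y hy => mem_vadd_finset.2 ⟨y - b, (hmemH _).1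
        ((hπeq y b).1 (((hmem_fib c y).1 hy).2.trans ((hmem_fib c b).1 hb).2.symm)), by simp⟩
      simpa using card_le_card this
    · simpa using card_le_card (hfull c hc b hb)
  have hcardBH : #(B + Hf) = #B + #Q * #Hf - ∑ c ∈ Q, #(fib c) := by
    -- `B + Hf = ⋃_c (fib c + Hf)`, each a full coset
    have hBH : B + Hf = (B.image π).biUnion (fun c => fib c + Hf) := by
      apply Subset.antisymm
      · intro x hx
        obtain ⟨b, hb, k, hk, rfl⟩ := mem_add.1 hx
        exact mem_biUnion.2 ⟨π b, mem_image_of_mem _ hb,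
          add_mem_add ((hmem_fib _ b).2 ⟨hb, rfl⟩) hk⟩
      · exact biUnion_subset.2 fun c _ => add_subset_add_right (hfibB c)
    have hcos : ∀ c ∈ B.image π, #(fib c + Hf) = #Hf := by
      intro c hc
      obtain ⟨b, hb⟩ : (fib c).Nonempty := by
        rw [mem_image] at hc; obtain ⟨b, hb, rfl⟩ := hc
        exact ⟨b, (hmem_fib _ b).2 ⟨hb, rfl⟩⟩
      have hsub : fib c + Hf ⊆ b +ᵥ Hf := by
        intro y hy
        obtain ⟨x, hx, k, hk, rfl⟩ := mem_add.1 hy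
        refine mem_vadd_finset.2 ⟨x - b + k, (hmemH _).1 (H.add_mem ((hπeq x b).1
          (((hmem_fib c x).1 hx).2.trans ((hmem_fib c b).1 hb).2.symm)) ((hmemH k).2 hk)), ?_⟩
        simp [vadd_eq_add]; abel
      have hsup : b +ᵥ Hf ⊆ fib c + Hf := by
        intro y hy
        obtain ⟨k, hk, rfl⟩ := mem_vadd_finset.1 hy
        exact add_mem_add hb hk
      rw [Subset.antisymm hsub hsup, card_vadd_finset]
    have hπfib : ∀ c ∈ B.image π, ∀ x ∈ fib c + Hf, π x = c := by
      intro c _ x hx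
      obtain ⟨y, hy, k, hk, rfl⟩ := mem_add.1 hx
      rw [map_add, ((hmem_fib c y).1 hy).2, (hπH k).2 ((hmemH k).2 hk), add_zero]
    have hdisjBH : ((B.image π) : Set (G ⧸ H)).PairwiseDisjoint (fun c => fib c + Hf) := by
      intro c hc d hd hcd
      rw [Function.onFun, disjoint_left]
      intro x hxc hxd
      exact hcd ((hπfib c hc x hxc).symm.trans (hπfib d hd x hxd))
    rw [hBH, card_biUnion hdisjBH, sum_congr rfl hcos, hPQ, hcardB,
      sum_congr rfl hfibcard, sum_const, sum_const, smul_eq_mul, smul_eq_mul]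
    omega
  -- nonemptiness of fibres in the image
  have hfibne : ∀ c ∈ B.image π, (fib c).Nonempty := by
    intro c hc
    rw [mem_image] at hc; obtain ⟨b, hb, rfl⟩ := hc
    exact ⟨b, (hmem_fib _ b).2 ⟨hb, rfl⟩⟩
  -- (29)–(30): two partially filled fibres are impossible
  have hQ1 : #Q = 1 := by
    have hQpos : 0 < #Q := card_pos.2 hQne
    by_contra hQ1
    obtain ⟨c₁, hc₁, c₂, hc₂, hne⟩ := one_lt_card.1 (show 1 < #Q by omega)
    have hA₀pos : 0 < #A₀ := card_pos.2 ⟨a₀, ha₀⟩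
    -- Kneser (weak) on `A₀ + B_c` with a stabilizer of index ≥ 2 in `Hf`
    have h29 : ∀ c ∈ Q, 2 * (#A₀ + #(fib c)) ≤ 2 * #(S c) + #Hf := by
      intro c hc
      have hSne : (S c).Nonempty := Nonempty.add ⟨a₀, ha₀⟩ (hfibne c (hQsub hc))
      have hw := card_add_card_le_card_add_add_card_addStab
        A₀ (fib c) ⟨a₀, ha₀⟩ (hfibne c (hQsub hc))
      change #A₀ + #(fib c) ≤ #(S c) + #(S c).addStab at hw
      -- `H(S c) ⊆ Hf`, a proper subgroup-finset: `2 |H(S c)| ≤ |Hf|`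
      have hKsub : (S c).addStab ⊆ Hf := by
        intro k hk
        have := addStab_subset_sub hk
        obtain ⟨x, hx, y, hy, rfl⟩ := mem_sub.1 this
        exact (hmemH _).1 ((hπeq x y).1 ((hπS c x hx).trans (hπS c y hy).symm))
      have hKdvd : #(S c).addStab ∣ #Hf := card_addStab_dvd_card_addStab hSne hKsub
      have hKne : (S c).addStab ≠ Hf := by
        intro hKeq
        obtain ⟨b, hb⟩ := hfibne c (hQsub hc)
        apply h24 c hc b hb
        intro y hy
        obtain ⟨k, hk, rfl⟩ := mem_vadd_finset.1 hy
        have hk' : k ∈ (S c).addStab := by rw [hKeq]; exact hk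
        rw [← (mem_addStab hSne).1 hk']
        exact mem_vadd_finset.2 ⟨a₀ + b, add_mem_add ha₀ hb, by rw [vadd_eq_add, vadd_eq_add, add_comm]⟩
      obtain ⟨m, hm⟩ := hKdvd
      have hKpos : 0 < #(S c).addStab := card_pos.2 hSne.addStab
      have hm2 : 2 ≤ m := by
        by_contra hm2
        rcases Nat.eq_zero_or_pos m with hm0 | hm0
        · rw [hm0, mul_zero] at hm; exact absurd hm (card_pos.2 hHfne).ne'
        · have : m = 1 := by omega
          rw [this, mul_one] at hm
          exact hKne (eq_of_subset_of_card_le hKsub hm.le)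
      have : 2 * #(S c).addStab ≤ #Hf := by
        rw [hm]; exact Nat.mul_le_mul_right _ hm2 |>.trans_eq (mul_comm _ _)
      omega
    have h29a := h29 c₁ hc₁
    have h29b := h29 c₂ hc₂
    -- (30)
    have hsub : ({c₁, c₂} : Finset (G ⧸ H)) ⊆ Q := by
      intro c hc; simp only [mem_insert, mem_singleton] at hc
      rcases hc with rfl | rfl <;> assumption
    have eS := sum_sdiff hsub (f := fun c => #(S c))
    have eF := sum_sdiff hsub (f := fun c => #(fib c))
    rw [sum_pair hne] at eS eF
    have hrest : ∑ c ∈ Q \ {c₁, c₂}, #(fib c) ≤ ∑ c ∈ Q \ {c₁, c₂}, #(S c) :=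
      sum_le_sum fun c hc => card_le_card_add_left ⟨a₀, ha₀⟩
    have hQ2 : 2 * #Hf ≤ #Q * #Hf := Nat.mul_le_mul_right _ (by omega)
    have hsumQ : ∑ c ∈ Q, #(fib c) ≤ #B := by rw [hcardB]; omega
    omega
  -- so `Q = {c₀}`: define the decomposition of `B`
  obtain ⟨c₀, hQc₀⟩ := card_eq_one.1 hQ1
  have hc₀ : c₀ ∈ Q := by rw [hQc₀]; exact mem_singleton_self _
  set B₁ := B.filter (fun b => π b ∈ P) with hB₁
  have hB₀eq : B.filter (fun b => π b ∉ P) = fib c₀ := by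
    ext x
    rw [mem_filter, hmem_fib]
    constructor
    · rintro ⟨hx, hxP⟩
      have : π x ∈ Q := mem_filter.2 ⟨mem_image_of_mem _ hx, fun h => hxP
        (mem_filter.2 ⟨mem_image_of_mem _ hx, h⟩)⟩
      rw [hQc₀, mem_singleton] at this
      exact ⟨hx, this⟩
    · rintro ⟨hx, hxc⟩
      refine ⟨hx, fun hP => ?_⟩
      rw [hxc] at hP
      exact (mem_filter.1 hc₀).2 (mem_filter.1 hP).2
  have hBdec : IsQuasiPeriodicDecomp H B B₁ (fib c₀) := by
    refine ⟨hdec.ne_bot, ?_, ?_, ?_, ?_⟩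
    · rw [← hB₀eq]; exact disjoint_filter_filter_not B B _
    · rw [← hB₀eq]; exact filter_union_filter_not_eq _ B
    · intro h hh
      have hh' : h ∈ Hf := (hmemH h).1 hh
      apply eq_of_subset_of_card_le _ (by rw [card_vadd_finset])
      intro x hx
      obtain ⟨b, hb, rfl⟩ := mem_vadd_finset.1 hx
      rw [mem_filter] at hb ⊢
      obtain ⟨hbB, hbP⟩ := hb
      have hπ : π (h +ᵥ b) = π b := by rw [vadd_eq_add, map_add, (hπH h).2 hh, zero_add]
      refine ⟨?_, by rw [hπ]; exact hbP⟩
      exact hfibB _ (hfull _ hbP b ((hmem_fib _ b).2 ⟨hbB, rfl⟩)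
        (mem_vadd_finset.2 ⟨h, hh', by rw [vadd_eq_add, vadd_eq_add, add_comm]⟩))
    · intro x hx y hy
      exact (hπeq x y).1 (((hmem_fib _ x).1 hx).2.trans ((hmem_fib _ y).1 hy).2.symm)
  -- the counts with `Q = {c₀}`
  have hS₀ : #(A + B) = #(A₁ + B) + #(S c₀) := by rw [hcardAB, hQc₀, sum_singleton]
  have hB₁card : #B₁ = ∑ c ∈ P, #(fib c) := by
    have : B₁ = P.biUnion fib := by
      ext x
      simp only [hB₁, mem_filter, mem_biUnion, hmem_fib]
      constructor
      · rintro ⟨hx, hP⟩; exact ⟨π x, hP, hx, rfl⟩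
      · rintro ⟨c, hc, hx, rfl⟩; exact ⟨hx, hc⟩
    rw [this, card_biUnion fun c hc d hd hcd => hdisjfib (hPsub hc) (hPsub hd) hcd]
  have hBcard' : #B = #B₁ + #(fib c₀) := by
    rw [hcardB, hB₁card, hQc₀, sum_singleton]
  have hBH' : #(B + Hf) = #B₁ + #Hf := by
    rw [hcardBH, hQc₀, card_singleton, sum_singleton, one_mul, hBcard']
    omega
  refine ⟨B₁, fib c₀, hBdec, ⟨a₀, ha₀⟩, hfibne c₀ (hQsub hc₀), ?_, ?_, h24' c₀ hc₀ |>.symm, h27, ?_⟩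
  · -- (iii)
    show #(S c₀) = #A₀ + #(fib c₀)
    have := hS₀
    rw [hAB, hAcard, hBcard'] at this
    omega
  · rw [hABdecomp, hQc₀, singleton_biUnion]
  · -- (i): unique expression of the coset of `A₀ + B₀`
    intro a ha b hb a₀' ha₀' b₀ hb₀ hdiff
    have hπab : π (a + b) = π a₀ + c₀ := by
      rw [(hπeq _ _).2 hdiff, hπS c₀ _ (add_mem_add ha₀' hb₀)]
    rw [← hdec.union_eq, mem_union] at ha
    rcases ha with ha | ha
    · exfalso
      obtain ⟨x, hx⟩ : (S c₀).Nonempty := ⟨_, add_mem_add ha₀' hb₀⟩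
      have hxAB : x ∈ A₁ + B := hcoset_sub (a + b) (add_mem_add ha hb) x
        ((hπeq x (a + b)).1 ((hπS c₀ x hx).trans hπab.symm))
      exact disjoint_left.1 (h24' c₀ hc₀) hx hxAB
    · refine ⟨ha, (hmem_fib _ b).2 ⟨hb, ?_⟩⟩
      have : π a = π a₀ := (hπeq a a₀).2 (hdec.sub_mem a ha a₀ ha₀)
      rw [map_add, this] at hπab
      exact add_left_cancel hπab

end Literature.Combinatorics.Additive.Grynkiewicz2009

/-! ### §2 (continued).  Invariance of the notions under translation, negation and complement

(the bookkeeping used in the proof of Lemma 5.4: «since `A + B` is aperiodic, `B`, and thus `B̄`, is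
aperiodic»; passing from `(A, B)` to `(−A, \overline{A + B})` and translating so that `0` lies in
both sets). -/

namespace Literature.Combinatorics.Additive

open Finset
open scoped Pointwise

variable {G : Type*} [AddCommGroup G] [DecidableEq G]

/-- `−(g + s) = (−g) + (−s)`. [folklore] -/
private theorem neg_vadd_finset_eq_neg_vadd_neg (g : G) (s : Finset G) : -(g +ᵥ s) = (-g) +ᵥ (-s) := by
  ext x
  constructor
  · intro hx
    rw [mem_neg'] at hx
    obtain ⟨y, hy, hyx⟩ := mem_vadd_finset.1 hx
    refine mem_vadd_finset.2 ⟨-y, by simpa using hy, ?_⟩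
    rw [vadd_eq_add] at hyx ⊢
    rw [← neg_add, hyx, neg_neg]
  · intro hx
    obtain ⟨y, hy, rfl⟩ := mem_vadd_finset.1 hx
    rw [mem_neg'] at hy ⊢
    rw [vadd_eq_add, neg_add, neg_neg]
    exact mem_vadd_finset.2 ⟨-y, hy, rfl⟩

/-- `(g + s)ᶜ = g + sᶜ` in a finite group. [folklore] -/
private theorem compl_vadd_finset [Fintype G] (g : G) (s : Finset G) : (g +ᵥ s)ᶜ = g +ᵥ sᶜ := by
  ext x
  rw [mem_compl, ← neg_vadd_mem_iff, ← neg_vadd_mem_iff (a := g) (s := sᶜ), mem_compl]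

/-- The stabilizer of `−s` is that of `s` (`H(−A) = H(A)`; `H(g + A) = H(A)` is `addStab_vadd`). [cite: Grynkiewicz2009, §2] -/
theorem addStab_neg (s : Finset G) : (-s).addStab = s.addStab := by
  rcases s.eq_empty_or_nonempty with rfl | hs
  · simp
  have key : ∀ (t : Finset G) (g : G), t.Nonempty → g +ᵥ -t = -t → -g +ᵥ t = t := by
    intro t g _ h
    have := congrArg Neg.neg h
    simp only [neg_vadd_finset_eq_neg_vadd_neg, neg_neg] at this
    exact this
  ext g
  rw [mem_addStab hs.neg, mem_addStab hs]
  constructor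
  · intro h
    have h1 := key s g hs h
    have h2 := congrArg (fun t => g +ᵥ t) h1
    simp only [vadd_vadd, add_neg_cancel, zero_vadd] at h2
    exact h2.symm
  · intro h
    have h0 : -g +ᵥ - -s = - -s := by rw [neg_neg]; exact (by
      have h2 := congrArg (fun t => -g +ᵥ t) h
      simp only [vadd_vadd, neg_add_cancel, zero_vadd] at h2
      exact h2.symm)
    have h1 := key (-s) (-g) hs.neg h0
    rw [neg_neg] at h1
    exact h1

/-- In a finite group the stabilizer of `sᶜ` is that of `s`, for `s ≠ ∅, univ` («since `A + B` is aperiodic, `B`, and thus `B̄`, is aperiodic», proof of Lemma 5.4). [cite: Grynkiewicz2009, Lemma 5.4 (proof)] -/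
theorem addStab_compl [Fintype G] {s : Finset G} (hs : s.Nonempty) (hsc : sᶜ.Nonempty) :
    sᶜ.addStab = s.addStab := by
  ext g
  rw [mem_addStab hsc, mem_addStab hs, ← compl_vadd_finset, compl_inj_iff]

/-! #### Invariance of the §2 notions under translation, negation, complement -/

namespace IsPeriodicWith

/-- A translate of an `H`-periodic set is `H`-periodic. [cite: Grynkiewicz2009, §2] -/
theorem vadd {H : AddSubgroup G} {A : Finset G} (hA : IsPeriodicWith H A) (g : G) :
    IsPeriodicWith H (g +ᵥ A) := fun h hh => by
  rw [vadd_vadd, add_comm, ← vadd_vadd, hA h hh]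

/-- The negative of an `H`-periodic set is `H`-periodic. [cite: Grynkiewicz2009, §2] -/
theorem neg {H : AddSubgroup G} {A : Finset G} (hA : IsPeriodicWith H A) :
    IsPeriodicWith H (-A) := fun h hh => by
  have := hA (-h) (H.neg_mem hh)
  have h2 := congrArg Neg.neg this
  rw [neg_vadd_finset_eq_neg_vadd_neg, neg_neg] at h2
  exact h2

/-- The complement of an `H`-periodic set is `H`-periodic (finite group). [cite: Grynkiewicz2009, §2] -/
theorem compl [Fintype G] {H : AddSubgroup G} {A : Finset G} (hA : IsPeriodicWith H A) :
    IsPeriodicWith H Aᶜ := fun h hh => by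
  rw [← compl_vadd_finset, hA h hh]

/-- A union of `H`-periodic sets is `H`-periodic. [cite: Grynkiewicz2009, §2] -/
theorem union {H : AddSubgroup G} {A B : Finset G} (hA : IsPeriodicWith H A)
    (hB : IsPeriodicWith H B) : IsPeriodicWith H (A ∪ B) := fun h hh => by
  rw [vadd_finset_union, hA h hh, hB h hh]

end IsPeriodicWith

namespace IsQuasiPeriodicDecomp

/-- Translating a quasi-periodic decomposition. [cite: Grynkiewicz2009, §2] -/
theorem vadd {H : AddSubgroup G} {A A₁ A₀ : Finset G}
    (h : IsQuasiPeriodicDecomp H A A₁ A₀) (g : G) :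
    IsQuasiPeriodicDecomp H (g +ᵥ A) (g +ᵥ A₁) (g +ᵥ A₀) where
  ne_bot := h.ne_bot
  disjoint := by
    rw [disjoint_left]; intro x hx hx'
    obtain ⟨y, hy, rfl⟩ := mem_vadd_finset.1 hx
    have hy' : y ∈ A₀ := by
      obtain ⟨y', hy', hyy⟩ := mem_vadd_finset.1 hx'
      rw [vadd_eq_add, vadd_eq_add, add_right_inj] at hyy
      rw [← hyy]; exact hy'
    exact disjoint_left.1 h.disjoint hy hy'
  union_eq := by rw [← vadd_finset_union, h.union_eq]
  periodic := h.periodic.vadd g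
  sub_mem := by
    intro x hx y hy
    obtain ⟨x', hx', rfl⟩ := mem_vadd_finset.1 hx
    obtain ⟨y', hy', rfl⟩ := mem_vadd_finset.1 hy
    have : (g +ᵥ x') - (g +ᵥ y') = x' - y' := by simp [vadd_eq_add]
    rw [this]; exact h.sub_mem x' hx' y' hy'

/-- Negating a quasi-periodic decomposition. [cite: Grynkiewicz2009, §2] -/
theorem neg {H : AddSubgroup G} {A A₁ A₀ : Finset G}
    (h : IsQuasiPeriodicDecomp H A A₁ A₀) :
    IsQuasiPeriodicDecomp H (-A) (-A₁) (-A₀) where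
  ne_bot := h.ne_bot
  disjoint := by
    rw [disjoint_left]; intro x hx hx'
    rw [mem_neg'] at hx hx'
    exact disjoint_left.1 h.disjoint hx hx'
  union_eq := by
    ext x; rw [mem_union, mem_neg', mem_neg', mem_neg', ← mem_union, h.union_eq]
  periodic := h.periodic.neg
  sub_mem := by
    intro x hx y hy
    rw [mem_neg'] at hx hy
    have := h.sub_mem (-y) hy (-x) hx
    have e : -y - -x = x - y := by abel
    rwa [e] at this

/-- The complement of a set with a quasi-periodic decomposition has one with the same quasi-period
(finite ambient group): `Aᶜ = (A₁ ∪ (a₀ + H))ᶜ ∪ ((a₀ + H) ∖ A₀)` for `a₀ ∈ A₀` (and `Aᶜ = A₁ᶜ ∪ ∅`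
if `A₀ = ∅`) — the step «if `A + B` is quasi-periodic with quasi-period `H`, then … `⟨−γ + \overline{A+B}⟩ ≤ H`»
of the proof of Lemma 5.4. [cite: Grynkiewicz2009, Lemma 5.4 (proof)] -/
theorem exists_compl [Fintype G] {H : AddSubgroup G} {A A₁ A₀ : Finset G}
    (h : IsQuasiPeriodicDecomp H A A₁ A₀) :
    ∃ C₁ C₀ : Finset G, IsQuasiPeriodicDecomp H Aᶜ C₁ C₀ := by
  classical
  rcases A₀.eq_empty_or_nonempty with hA₀ | ⟨z, hz⟩
  · refine ⟨Aᶜ, ∅, h.ne_bot, disjoint_empty_right _, union_empty _, ?_, fun _ h => by simp at h⟩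
    have hA : A = A₁ := by rw [← h.union_eq, hA₀, union_empty]
    rw [hA]; exact h.periodic.compl
  · let Hf : Finset G := univ.filter (fun x => x ∈ H)
    have hmemHf : ∀ x, x ∈ Hf ↔ x ∈ H := fun x => by simp [Hf]
    let Z : Finset G := z +ᵥ Hf
    have hmemZ : ∀ x, x ∈ Z ↔ x - z ∈ H := by
      intro x
      rw [← neg_vadd_mem_iff, hmemHf, vadd_eq_add, neg_add_eq_sub]
    have hZper : IsPeriodicWith H Z := by
      intro k hk
      apply eq_of_subset_of_card_le _ (card_vadd_finset k Z).symm.le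
      intro y hy
      obtain ⟨x, hx, rfl⟩ := mem_vadd_finset.1 hy
      rw [hmemZ] at hx ⊢
      have e : (k +ᵥ x) - z = k + (x - z) := by rw [vadd_eq_add]; abel
      rw [e]; exact H.add_mem hk hx
    have hA₀Z : A₀ ⊆ Z := fun x hx => (hmemZ x).2 (h.sub_mem x hx z hz)
    have hA₁Z : Disjoint A₁ Z := by
      rw [disjoint_left]
      intro y hy hyZ
      have hzA₁ : z ∈ A₁ := by
        have hzy : z - y ∈ H := by
          have := H.neg_mem ((hmemZ y).1 hyZ); simpa using this
        have := h.periodic.add_mem hzy hy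
        simpa using this
      exact disjoint_left.1 h.disjoint hzA₁ hz
    refine ⟨(A₁ ∪ Z)ᶜ, Z \ A₀, h.ne_bot, ?_, ?_, (h.periodic.union hZper).compl, ?_⟩
    · rw [disjoint_left]
      intro x hx hx'
      rw [mem_compl, mem_union] at hx
      exact hx (Or.inr (mem_sdiff.1 hx').1)
    · ext x
      rw [mem_union, mem_compl, mem_union, mem_sdiff, mem_compl, ← h.union_eq, mem_union]
      constructor
      · rintro (hx | ⟨hxZ, hxA₀⟩)
        · push Not at hx
          exact fun hh => hh.elim hx.1 (fun h0 => hx.2 (hA₀Z h0))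
        · rintro (hx1 | hx0)
          · exact disjoint_left.1 hA₁Z hx1 hxZ
          · exact hxA₀ hx0
      · intro hx
        push Not at hx
        by_cases hxZ : x ∈ Z
        · exact Or.inr ⟨hxZ, hx.2⟩
        · exact Or.inl (fun hh => hh.elim hx.1 hxZ)
    · intro x hx y hy
      have hx' := (hmemZ x).1 (mem_sdiff.1 hx).1
      have hy' := (hmemZ y).1 (mem_sdiff.1 hy).1
      have := H.sub_mem hx' hy'
      have e : x - z - (y - z) = x - y := by abel
      rwa [e] at this

end IsQuasiPeriodicDecomp

/-- Quasi-periodicity is translation invariant. [cite: Grynkiewicz2009, §2] -/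
theorem isQuasiPeriodic_vadd_iff {A : Finset G} (g : G) :
    IsQuasiPeriodic (g +ᵥ A) ↔ IsQuasiPeriodic A := by
  constructor
  · rintro ⟨H, A₁, A₀, h, hne⟩
    refine ⟨H, -g +ᵥ A₁, -g +ᵥ A₀, ?_, hne.vadd_finset⟩
    have := h.vadd (-g)
    rwa [neg_vadd_vadd] at this
  · rintro ⟨H, A₁, A₀, h, hne⟩
    exact ⟨H, g +ᵥ A₁, g +ᵥ A₀, h.vadd g, hne.vadd_finset⟩

/-- Quasi-periodicity is invariant under negation. [cite: Grynkiewicz2009, §2] -/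
theorem isQuasiPeriodic_neg_iff {A : Finset G} : IsQuasiPeriodic (-A) ↔ IsQuasiPeriodic A := by
  constructor
  · rintro ⟨H, A₁, A₀, h, hne⟩
    refine ⟨H, -A₁, -A₀, ?_, hne.neg⟩
    have := h.neg
    rwa [neg_neg] at this
  · rintro ⟨H, A₁, A₀, h, hne⟩
    exact ⟨H, -A₁, -A₀, h.neg, hne.neg⟩

namespace IsNonExtendible

/-- Non-extendibility is invariant under translating the first set. [cite: Grynkiewicz2009, §2] -/
theorem vadd_left {A B : Finset G} (h : IsNonExtendible A B) (g : G) :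
    IsNonExtendible (g +ᵥ A) B := by
  rw [isNonExtendible_iff] at h ⊢
  intro a ha
  have ha' : -g +ᵥ a ∉ A := fun hcon => ha (neg_vadd_mem_iff.1 hcon)
  obtain ⟨b, hb, hab⟩ := h _ ha'
  refine ⟨b, hb, fun hcon => hab ?_⟩
  rw [vadd_add_assoc] at hcon
  have := neg_vadd_mem_iff.2 hcon
  have e : -g +ᵥ (a + b) = (-g +ᵥ a) + b := by simp only [vadd_eq_add]; abel
  rwa [e] at this

/-- Non-extendibility is invariant under translating the second set. [cite: Grynkiewicz2009, §2] -/
theorem vadd_right {A B : Finset G} (h : IsNonExtendible A B) (g : G) :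
    IsNonExtendible A (g +ᵥ B) := by
  rw [isNonExtendible_iff] at h ⊢
  intro a ha
  obtain ⟨b, hb, hab⟩ := h a ha
  refine ⟨g +ᵥ b, mem_vadd_finset.2 ⟨b, hb, rfl⟩, fun hcon => hab ?_⟩
  rw [add_comm A, vadd_add_assoc, add_comm B] at hcon
  have := neg_vadd_mem_iff.2 hcon
  have e : -g +ᵥ (a + (g +ᵥ b)) = a + b := by simp only [vadd_eq_add]; abel
  rwa [e] at this

/-- Non-extendibility is invariant under negating both sets. [cite: Grynkiewicz2009, §2] -/
theorem neg {A B : Finset G} (h : IsNonExtendible A B) : IsNonExtendible (-A) (-B) := by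
  rw [isNonExtendible_iff] at h ⊢
  intro a ha
  have ha' : -a ∉ A := fun hcon => ha (by simpa using hcon)
  obtain ⟨b, hb, hab⟩ := h _ ha'
  refine ⟨-b, by simpa using hb, fun hcon => hab ?_⟩
  rw [← neg_add] at hcon
  have := mem_neg'.1 hcon
  have e : -(a + -b) = -a + b := by abel
  rwa [e] at this

end IsNonExtendible

end Literature.Combinatorics.Additive

/-! ### §5.  Lemma 5.4: non-quasi-periodic generating sets transfer -/

namespace Literature.Combinatorics.Additive.Grynkiewicz2009
open Finset Literature.Combinatorics.Additive
open scoped Pointwise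

variable {G : Type*} [AddCommGroup G] [DecidableEq G]

/-- **Lemma 5.4 (Grynkiewicz 2009), first part.**  «Let `A` and `B` be finite, nonempty subsets of an
abelian group `G` with `|A + B| = |A| + |B|`, `0 ∈ A ∩ B`, `|A|, |B|, |\overline{A + B}| ≥ 3`, `A + B`
aperiodic and `(A, B)` non-extendible.  If `⟨A⟩ = G` and `A` is not quasi-periodic, then `B` is not
quasi-periodic and `⟨B⟩ = G`.»  (The hypothesis `|\overline{A + B}| ≥ 3` is only used in the second
part.)  Proof as printed: a quasi-periodic `B` has, after enlarging the quasi-period to the maximal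
period of its periodic part, a decomposition to which Lemma 5.3 applies with the roles of `A` and `B`
exchanged; `A` not quasi-periodic then lies in one coset, so `G = ⟨A⟩ ≤ H`, `B = G`, and `A + B` is
periodic — a contradiction; then Lemma 5.2. (arXiv v2: Lemma 4.8.) [cite: Grynkiewicz2009, Lemma 5.4] -/
theorem not_isQuasiPeriodic_and_closure_eq_top {A B : Finset G} (hA3 : 3 ≤ #A) (hB3 : 3 ≤ #B)
    (h0A : (0 : G) ∈ A) (h0B : (0 : G) ∈ B) (hAB : #(A + B) = #A + #B)
    (haper : (A + B).addStab = {0}) (hA : IsNonExtendible A B) (hB : IsNonExtendible B A)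
    (hgen : AddSubgroup.closure (A : Set G) = ⊤) (hAqp : ¬ IsQuasiPeriodic A) :
    ¬ IsQuasiPeriodic B ∧ AddSubgroup.closure (B : Set G) = ⊤ := by
  classical
  have hBqp : ¬ IsQuasiPeriodic B := by
    rintro ⟨K, B₁, B₀, hdecK, hB₁ne⟩
    -- pass to the maximal period `H = H(B₁)` of the periodic part
    let H : AddSubgroup G := AddAction.stabilizer G B₁
    have hmemH : ∀ g, g ∈ H ↔ g +ᵥ B₁ = B₁ := fun g => AddAction.mem_stabilizer_iff
    have hHset : (H : Set G) = (B₁.addStab : Set G) := by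
      ext g; rw [SetLike.mem_coe, hmemH, mem_coe, mem_addStab hB₁ne]
    have hKH : K ≤ H := fun k hk => (hmemH k).2 (hdecK.periodic k hk)
    have hdecH : IsQuasiPeriodicDecomp H B B₁ B₀ :=
      ⟨fun h => hdecK.ne_bot (le_bot_iff.1 (h ▸ hKH)), hdecK.disjoint, hdecK.union_eq,
        fun h hh => (hmemH h).1 hh, fun x hx y hy => hKH (hdecK.sub_mem x hx y hy)⟩
    -- Lemma 5.3 with the roles of `A` and `B` exchanged
    have hBA : #(B + A) = #B + #A := by rw [add_comm, hAB, add_comm]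
    have haper' : (B + A).addStab = {0} := by rwa [add_comm]
    obtain ⟨A₁, A₀, hdecA, -⟩ := exists_isQuasiPeriodicDecomp_of_isQuasiPeriodicDecomp hdecH hB₁ne
      hHset ⟨0, h0A⟩ hBA haper' hB hA
    obtain ⟨-, hA₀⟩ := hdecA.left_eq_empty_of_not_isQuasiPeriodic hAqp
    -- `A ⊆ H`, so `H = G`
    have hAH : (A : Set G) ⊆ H := fun a ha => by
      have := hdecA.sub_mem a (by rw [hA₀]; exact mem_coe.1 ha) 0 (by rw [hA₀]; exact h0A)
      simpa using this
    have hHtop : H = ⊤ := by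
      rw [← top_le_iff, ← hgen]; exact (AddSubgroup.closure_le H).2 hAH
    -- every `g` stabilises `B₁`, so `B₁ = B = G` and `A + B` is periodic
    have hall : ∀ g : G, g +ᵥ B₁ = B₁ := fun g => (hmemH g).1 (hHtop ▸ AddSubgroup.mem_top g)
    obtain ⟨b, hb⟩ := hB₁ne
    have hBall : ∀ x : G, x ∈ B := fun x => by
      apply hdecK.left_subset
      rw [← hall (x - b)]; exact mem_vadd_finset.2 ⟨b, hb, by simp⟩
    have hABne : (A + B).Nonempty := Nonempty.add ⟨0, h0A⟩ ⟨0, h0B⟩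
    have hstab : ∀ g : G, g ∈ (A + B).addStab := by
      intro g
      rw [mem_addStab hABne]
      apply eq_of_subset_of_card_le _ (card_vadd_finset g (A + B)).symm.le
      intro x _
      exact mem_add.2 ⟨0, h0A, x, hBall x, zero_add x⟩
    have hzero : ∀ g : G, g = 0 := fun g => by
      have := hstab g; rw [haper, mem_singleton] at this; exact this
    have : A ⊆ {0} := fun a _ => mem_singleton.2 (hzero a)
    have := card_le_card this
    rw [card_singleton] at this
    omega
  refine ⟨hBqp, ?_⟩
  rw [← closure_eq_closure_of_not_isQuasiPeriodic hA3 hB3 h0A h0B hAB haper hA hB hAqp hBqp]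
  exact hgen

/-- **Lemma 5.4 (Grynkiewicz 2009), second part.**  «Furthermore, if `G` is finite, then neither
`A + B` nor `\overline{A + B}` is quasi-periodic, and `⟨−γ + \overline{A + B}⟩ = G`, where
`γ ∈ \overline{A + B}`.»  Proof as printed: Proposition 2.4 gives the non-extendible pair
`(−A, \overline{A + B})` with sum `B̄`, aperiodic because `B` is (`addStab_compl`); the first part applied
to it (after translating `\overline{A + B}` to contain `0`) gives the claims on `\overline{A + B}`; a
quasi-periodic `A + B` would make `\overline{A + B}` lie in one coset of the quasi-period
(`IsQuasiPeriodicDecomp.exists_compl`), forcing the quasi-period to be `G` and `A + B = G`.  (The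
printed hypothesis `|B| ≥ 3` is not needed for this part and is omitted.) (arXiv v2: Lemma 4.8.)
[cite: Grynkiewicz2009, Lemma 5.4] -/
theorem not_isQuasiPeriodic_add_and_compl [Fintype G] {A B : Finset G} (hA3 : 3 ≤ #A)
    (hC3 : 3 ≤ #(A + B)ᶜ) (h0A : (0 : G) ∈ A) (h0B : (0 : G) ∈ B)
    (hAB : #(A + B) = #A + #B) (haper : (A + B).addStab = {0})
    (hA : IsNonExtendible A B) (hB : IsNonExtendible B A)
    (hgen : AddSubgroup.closure (A : Set G) = ⊤) (hAqp : ¬ IsQuasiPeriodic A) :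
    ¬ IsQuasiPeriodic (A + B) ∧ ¬ IsQuasiPeriodic (A + B)ᶜ ∧
      ∀ γ ∈ (A + B)ᶜ, AddSubgroup.closure (((-γ) +ᵥ (A + B)ᶜ : Finset G) : Set G) = ⊤ := by
  classical
  set C := (A + B)ᶜ with hC
  obtain ⟨h5, hnA, hnC⟩ := isNonExtendible_pair_neg_compl hA hB
  have hAne : A.Nonempty := ⟨0, h0A⟩
  have hBne : B.Nonempty := ⟨0, h0B⟩
  -- `B` is aperiodic, hence so is `Bᶜ`
  have hBstab : B.addStab = {0} := by
    apply Subset.antisymm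
    · rw [← haper]; exact subset_addStab_add_right hAne
    · rw [singleton_subset_iff]; exact hBne.zero_mem_addStab
  have hcardC : #C + #(A + B) = Fintype.card G := by
    have := card_le_univ (A + B)
    rw [hC, card_compl]; omega
  have hCne : C.Nonempty := card_pos.1 (by omega)
  have hBcne : Bᶜ.Nonempty := by
    rw [← h5]; exact Nonempty.add hAne.neg hCne
  have hBcstab : Bᶜ.addStab = {0} := by rw [addStab_compl hBne hBcne, hBstab]
  -- the first part applied to the non-extendible pair `(−A, −γ + C)`
  have key : ∀ γ ∈ C, ¬ IsQuasiPeriodic ((-γ) +ᵥ C) ∧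
      AddSubgroup.closure (((-γ) +ᵥ C : Finset G) : Set G) = ⊤ := by
    intro γ hγ
    refine not_isQuasiPeriodic_and_closure_eq_top (A := -A) (B := (-γ) +ᵥ C)
      (by rwa [card_neg]) (by rw [card_vadd_finset]; omega) (by simpa using h0A)
      (mem_vadd_finset.2 ⟨γ, hγ, by simp⟩) ?_ ?_ (hnA.vadd_right _) (hnC.vadd_left _) ?_ ?_
    · -- `|−A + (−γ + C)| = |−A| + |−γ + C|`
      rw [add_comm (-A), vadd_add_assoc, add_comm C, h5, card_vadd_finset, card_neg, card_vadd_finset,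
        card_compl]
      omega
    · rw [add_comm (-A), vadd_add_assoc, add_comm C, h5, addStab_vadd, hBcstab]
    · rw [coe_neg, AddSubgroup.closure_neg, hgen]
    · rwa [isQuasiPeriodic_neg_iff]
  obtain ⟨γ₀, hγ₀⟩ := hCne
  have hCqp : ¬ IsQuasiPeriodic C := by
    have := (key γ₀ hγ₀).1; rwa [isQuasiPeriodic_vadd_iff] at this
  refine ⟨?_, hCqp, fun γ hγ => (key γ hγ).2⟩
  -- `A + B` is not quasi-periodic
  rintro ⟨H, S₁, S₀, hdec, hS₁ne⟩
  obtain ⟨C₁, C₀, hdecC⟩ := hdec.exists_compl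
  obtain ⟨-, hC₀⟩ := hdecC.left_eq_empty_of_not_isQuasiPeriodic hCqp
  -- `C` lies in one `H`-coset, so `−γ₀ + C ⊆ H` and `H = G`
  have hsub : (((-γ₀) +ᵥ C : Finset G) : Set G) ⊆ H := by
    intro x hx
    obtain ⟨c, hc, rfl⟩ := mem_vadd_finset.1 (mem_coe.1 hx)
    have := hdecC.sub_mem c (by rw [hC₀]; exact hc) γ₀ (by rw [hC₀]; exact hγ₀)
    simpa [vadd_eq_add, neg_add_eq_sub] using this
  have hHtop : H = ⊤ := by
    rw [← top_le_iff, ← (key γ₀ hγ₀).2]; exact (AddSubgroup.closure_le H).2 hsub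
  obtain ⟨s, hs⟩ := hS₁ne
  have hS₁all : ∀ x : G, x ∈ S₁ := fun x => by
    rw [← hdec.periodic (x - s) (hHtop ▸ AddSubgroup.mem_top _)]
    exact mem_vadd_finset.2 ⟨s, hs, by simp⟩
  have : γ₀ ∈ A + B := hdec.left_subset (hS₁all γ₀)
  rw [hC, mem_compl] at hγ₀
  exact hγ₀ this

/-! ### Proposition 5.5 (the matching proposition) -/

section Prop55
variable {A B C : Finset G}

/-- Conclusion (a) of Proposition 5.5 — «two disjoint edges with distinct colours» of the bipartite
graph on `A ⊔ B` whose edges `{a, b}` are coloured `a + b ∈ C` (proof-structuring abbreviation, private).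
[cite: Grynkiewicz2009, Prop 5.5] -/
private def TwoEdges (A B C : Finset G) : Prop :=
  ∃ a ∈ A, ∃ a' ∈ A, ∃ b ∈ B, ∃ b' ∈ B, a ≠ a' ∧ b ≠ b' ∧ a + b ∈ C ∧ a' + b' ∈ C ∧ a + b ≠ a' + b'

omit [DecidableEq G] in
/-- Conclusion (a) is symmetric in `A ↔ B`. [cite: Grynkiewicz2009, Prop 5.5] -/
private theorem twoEdges_comm (h : TwoEdges B A C) : TwoEdges A B C := by
  obtain ⟨b, hb, b', hb', a, ha, a', ha', hbb, haa, h1, h2, h3⟩ := h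
  refine ⟨a, ha, a', ha', b, hb, b', hb', haa, hbb, by rwa [add_comm], by rwa [add_comm], ?_⟩
  rwa [add_comm a, add_comm a']

omit [DecidableEq G] in
/-- Constructor for conclusion (a). [cite: Grynkiewicz2009, Prop 5.5] -/
private theorem twoEdges_mk {a a' b b' : G} (ha : a ∈ A) (ha' : a' ∈ A) (hb : b ∈ B) (hb' : b' ∈ B)
    (haa : a ≠ a') (hbb : b ≠ b') (h1 : a + b ∈ C) (h2 : a' + b' ∈ C) (h3 : a + b ≠ a' + b') :
    TwoEdges A B C := ⟨a, ha, a', ha', b, hb, b', hb', haa, hbb, h1, h2, h3⟩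

/-- In the configuration `a₁ + b₁ = c₁`, `a₂ + b₁ = a₁ + b₂ = c₂` (`a₁ ≠ a₂`, `b₁ ≠ b₂`, both colours in
`C`): either (a), or `A ⊆ {a₁, a₂}` («Suppose there exists `a ∈ A ∖ {a₁, a₂}` …» in the arXiv proof of
Prop 4.9 = print Prop 5.5). [cite: Grynkiewicz2009, Prop 5.5] -/
private theorem configY_subset (hrow : ∀ a ∈ A, ∃ b ∈ B, a + b ∈ C) {a₁ a₂ b₁ b₂ : G}
    (ha₁ : a₁ ∈ A) (ha₂ : a₂ ∈ A) (hb₁ : b₁ ∈ B) (hb₂ : b₂ ∈ B) (haa : a₁ ≠ a₂) (hbb : b₁ ≠ b₂)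
    (hc₁ : a₁ + b₁ ∈ C) (hc₂ : a₂ + b₁ ∈ C) (hsq : a₁ + b₂ = a₂ + b₁) :
    TwoEdges A B C ∨ A ⊆ {a₁, a₂} := by
  by_cases hA : A ⊆ {a₁, a₂}
  · exact Or.inr hA
  left
  obtain ⟨a, ha, hane⟩ := not_subset.1 hA
  simp only [mem_insert, mem_singleton, not_or] at hane
  obtain ⟨hne1, hne2⟩ := hane
  have hc₂' : a₁ + b₂ ∈ C := by rw [hsq]; exact hc₂
  have hcc : a₁ + b₁ ≠ a₂ + b₁ := fun h => haa (add_right_cancel h)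
  obtain ⟨b, hb, hc⟩ := hrow a ha
  by_cases h1 : a + b = a₁ + b₁
  · -- colour c₁: then `b ≠ b₁` (else `a = a₁`), and `b ≠ b₂`? if `b = b₂`: pair with `(a₂, b₁, c₂)`
    have hbb₁ : b ≠ b₁ := fun h => hne1 (add_right_cancel (h ▸ h1))
    by_cases h2 : b = b₂
    · subst h2
      exact twoEdges_mk ha ha₂ hb hb₁ hne2 hbb₁ hc hc₂ (by rw [h1]; exact hcc)
    · -- `b ∉ {b₁, b₂}`: pair `(a, b, c₁)` with `(a₁, b₂, c₂)`
      exact twoEdges_mk ha ha₁ hb hb₂ hne1 h2 hc hc₂' (by rw [h1, hsq]; exact hcc)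
  by_cases h2 : a + b = a₂ + b₁
  · -- colour c₂: `b ≠ b₁` (else `a = a₂`); `b = b₂` impossible (`a = a₁`); so pair with `(a₁, b₁, c₁)`
    have hbb₁ : b ≠ b₁ := fun h => hne2 (add_right_cancel (h ▸ h2))
    exact twoEdges_mk ha ha₁ hb hb₁ hne1 hbb₁ hc hc₁ (by rw [h2]; exact hcc.symm)
  -- a third colour
  by_cases h3 : b = b₁
  · subst h3
    exact twoEdges_mk ha ha₁ hb hb₂ hne1 hbb hc hc₂' (by rw [hsq]; exact h2)
  · exact twoEdges_mk ha ha₁ hb hb₁ hne1 h3 hc hc₁ h1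

/-- The same configuration yields (a) or (b) (apply the previous step to `A` and, by the symmetry
`(A, a₁, a₂) ↔ (B, b₁, b₂)` of the configuration, to `B`; then every colour is `c₁` or `c₂`).
[cite: Grynkiewicz2009, Prop 5.5] -/
private theorem configY (hCsub : C ⊆ A + B) (hrow : ∀ a ∈ A, ∃ b ∈ B, a + b ∈ C)
    (hcol : ∀ b ∈ B, ∃ a ∈ A, a + b ∈ C) {a₁ a₂ b₁ b₂ : G}
    (ha₁ : a₁ ∈ A) (ha₂ : a₂ ∈ A) (hb₁ : b₁ ∈ B) (hb₂ : b₂ ∈ B) (haa : a₁ ≠ a₂) (hbb : b₁ ≠ b₂)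
    (hc₁ : a₁ + b₁ ∈ C) (hc₂ : a₂ + b₁ ∈ C) (hsq : a₁ + b₂ = a₂ + b₁) :
    TwoEdges A B C ∨ (#A = 2 ∧ #B = 2 ∧ #C = 2 ∧ ∃ a ∈ A, ∃ b ∈ B, a +ᵥ B = C ∧ b +ᵥ A = C) := by
  rcases configY_subset hrow ha₁ ha₂ hb₁ hb₂ haa hbb hc₁ hc₂ hsq with h | hA
  · exact Or.inl h
  -- the symmetric statement for `B`
  have hcol' : ∀ b ∈ B, ∃ a ∈ A, b + a ∈ C := fun b hb => by
    obtain ⟨a, ha, h⟩ := hcol b hb; exact ⟨a, ha, by rwa [add_comm]⟩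
  rcases configY_subset (A := B) (B := A) (C := C) hcol' hb₁ hb₂ ha₁ ha₂ hbb haa
    (by rwa [add_comm]) (by rw [add_comm, hsq]; exact hc₂) (by rw [add_comm, ← hsq, add_comm]) with h | hB
  · exact Or.inl (twoEdges_comm h)
  -- now `A = {a₁, a₂}`, `B = {b₁, b₂}`
  have hAeq : A = {a₁, a₂} := Subset.antisymm hA (by
    intro x hx; simp only [mem_insert, mem_singleton] at hx; rcases hx with rfl | rfl <;> assumption)
  have hBeq : B = {b₁, b₂} := Subset.antisymm hB (by
    intro x hx; simp only [mem_insert, mem_singleton] at hx; rcases hx with rfl | rfl <;> assumption)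
  have hcc : a₁ + b₁ ≠ a₂ + b₁ := fun h => haa (add_right_cancel h)
  by_cases h4 : a₂ + b₂ ∈ C ∧ a₂ + b₂ ≠ a₁ + b₁
  · exact Or.inl (twoEdges_mk ha₂ ha₁ hb₂ hb₁ haa.symm hbb.symm h4.1 hc₁ h4.2)
  right
  -- every colour is one of `c₁, c₂`
  have hCeq : C = {a₁ + b₁, a₂ + b₁} := by
    apply Subset.antisymm
    · intro c hc
      obtain ⟨a, ha, b, hb, rfl⟩ := mem_add.1 (hCsub hc)
      rw [hAeq, mem_insert, mem_singleton] at ha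
      rw [hBeq, mem_insert, mem_singleton] at hb
      simp only [mem_insert, mem_singleton]
      rcases ha with rfl | rfl <;> rcases hb with rfl | rfl
      · exact Or.inl rfl
      · exact Or.inr hsq
      · exact Or.inr rfl
      · by_contra hne
        push Not at hne
        exact h4 ⟨hc, hne.1⟩
    · intro c hc
      simp only [mem_insert, mem_singleton] at hc
      rcases hc with rfl | rfl
      · exact hc₁
      · exact hc₂
  refine ⟨by rw [hAeq, card_pair haa], by rw [hBeq, card_pair hbb], by rw [hCeq, card_pair hcc],
    a₁, ha₁, b₁, hb₁, ?_, ?_⟩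
  · rw [hBeq, hCeq, vadd_finset_insert, vadd_finset_singleton, vadd_eq_add, vadd_eq_add, hsq]
  · rw [hAeq, hCeq, vadd_finset_insert, vadd_finset_singleton, vadd_eq_add, vadd_eq_add, add_comm b₁,
      add_comm b₁]

/-- Two edges of distinct colours through the same vertex `b₁ ∈ B`: (a) or (b) («we may w.l.o.g. by
symmetry assume `c₂ = a₂ + b₁` …»). [cite: Grynkiewicz2009, Prop 5.5] -/
private theorem shared_right (hCsub : C ⊆ A + B) (hB : 2 ≤ #B)
    (hrow : ∀ a ∈ A, ∃ b ∈ B, a + b ∈ C) (hcol : ∀ b ∈ B, ∃ a ∈ A, a + b ∈ C) {a₁ a₂ b₁ : G}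
    (ha₁ : a₁ ∈ A) (ha₂ : a₂ ∈ A) (hb₁ : b₁ ∈ B) (haa : a₁ ≠ a₂)
    (hc₁ : a₁ + b₁ ∈ C) (hc₂ : a₂ + b₁ ∈ C) :
    TwoEdges A B C ∨ (#A = 2 ∧ #B = 2 ∧ #C = 2 ∧ ∃ a ∈ A, ∃ b ∈ B, a +ᵥ B = C ∧ b +ᵥ A = C) := by
  have hcc : a₁ + b₁ ≠ a₂ + b₁ := fun h => haa (add_right_cancel h)
  obtain ⟨b₂, hb₂, hbb⟩ : ∃ b₂ ∈ B, b₂ ≠ b₁ := exists_mem_ne hB b₁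
  obtain ⟨a, ha, hc⟩ := hcol b₂ hb₂
  by_cases h1 : a + b₂ = a₁ + b₁
  · -- colour c₁: `a ≠ a₁`; if `a ≠ a₂` we are done, else configuration X = Y with `a₁ ↔ a₂`
    have hne1 : a ≠ a₁ := fun h => hbb (add_left_cancel (h ▸ h1))
    by_cases hne2 : a = a₂
    · subst hne2
      exact configY hCsub hrow hcol ha₂ ha₁ hb₁ hb₂ haa.symm hbb.symm hc₂ hc₁ h1
    · exact Or.inl (twoEdges_mk ha ha₂ hb₂ hb₁ hne2 hbb hc hc₂ (by rw [h1]; exact hcc))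
  by_cases h2 : a + b₂ = a₂ + b₁
  · have hne2 : a ≠ a₂ := fun h => hbb (add_left_cancel (h ▸ h2))
    by_cases hne1 : a = a₁
    · subst hne1
      exact configY hCsub hrow hcol ha₁ ha₂ hb₁ hb₂ haa hbb.symm hc₁ hc₂ h2
    · exact Or.inl (twoEdges_mk ha ha₁ hb₂ hb₁ hne1 hbb hc hc₁ (by rw [h2]; exact hcc.symm))
  -- a third colour at `b₂`
  by_cases hne1 : a = a₁
  · subst hne1
    exact Or.inl (twoEdges_mk ha ha₂ hb₂ hb₁ haa hbb hc hc₂ h2)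
  · exact Or.inl (twoEdges_mk ha ha₁ hb₂ hb₁ hne1 hbb hc hc₁ h1)

/-- **Proposition 5.5 (Grynkiewicz 2009; the matching proposition).**  «Let `A` and `B` be finite subsets
of an abelian group, and let `C ⊆ A + B`.  Suppose `|A|, |B|, |C| ≥ 2`.  If `(a + B) ∩ C` and `(b + A) ∩ C`
are both nonempty for every `a ∈ A` and `b ∈ B`, then either (a) there exist distinct `a, a' ∈ A`,
distinct `b, b' ∈ B` and distinct `c, c' ∈ C` such that `a + b = c` and `a' + b' = c'`, or else (b)
`|A| = |B| = |C| = 2`, and there exists `a ∈ A` and `b ∈ B` such that `a + B = b + A = C`.»  Proof: the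
case analysis of the arXiv version (Prop 4.9), organised as «shared vertex ⇒ configuration
`a₁ + b₁ = c₁, a₂ + b₁ = a₁ + b₂ = c₂` ⇒ `A = {a₁, a₂}`, `B = {b₁, b₂}`, `C = {c₁, c₂}`» with the `A ↔ B`
symmetry used twice (print gives a bipartite-graph rendering of the same argument).
(arXiv v2: Proposition 4.9.) [cite: Grynkiewicz2009, Prop 5.5] -/
theorem exists_two_edges_or_card_eq_two {A B C : Finset G} (hCsub : C ⊆ A + B) (hA : 2 ≤ #A)
    (hB : 2 ≤ #B) (hC : 2 ≤ #C) (hrow : ∀ a ∈ A, ∃ b ∈ B, a + b ∈ C)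
    (hcol : ∀ b ∈ B, ∃ a ∈ A, a + b ∈ C) :
    (∃ a ∈ A, ∃ a' ∈ A, ∃ b ∈ B, ∃ b' ∈ B,
        a ≠ a' ∧ b ≠ b' ∧ a + b ∈ C ∧ a' + b' ∈ C ∧ a + b ≠ a' + b') ∨
      (#A = 2 ∧ #B = 2 ∧ #C = 2 ∧ ∃ a ∈ A, ∃ b ∈ B, a +ᵥ B = C ∧ b +ᵥ A = C) := by
  change TwoEdges A B C ∨ _
  -- an edge, and an edge of another colour
  obtain ⟨c₁, hc₁C⟩ : C.Nonempty := card_pos.1 (by omega)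
  obtain ⟨a₁, ha₁, b₁, hb₁, rfl⟩ := mem_add.1 (hCsub hc₁C)
  obtain ⟨c₂, hc₂C, hcc⟩ : ∃ c₂ ∈ C, c₂ ≠ a₁ + b₁ := exists_mem_ne hC _
  obtain ⟨a₂, ha₂, b₂, hb₂, rfl⟩ := mem_add.1 (hCsub hc₂C)
  by_cases haa : a₂ = a₁
  · subst haa
    -- shared left vertex: apply the shared-vertex lemma to the swapped data
    have hbb : b₁ ≠ b₂ := fun h => hcc (by rw [h])
    have hCsub' : C ⊆ B + A := by rwa [add_comm]
    have hrow' : ∀ b ∈ B, ∃ a ∈ A, b + a ∈ C := fun b hb => by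
      obtain ⟨a, ha, h⟩ := hcol b hb; exact ⟨a, ha, by rwa [add_comm]⟩
    have hcol' : ∀ a ∈ A, ∃ b ∈ B, b + a ∈ C := fun a ha => by
      obtain ⟨b, hb, h⟩ := hrow a ha; exact ⟨b, hb, by rwa [add_comm]⟩
    rcases shared_right (A := B) (B := A) hCsub' hA hrow' hcol' hb₁ hb₂ ha₂ hbb
      (by rw [add_comm]; exact hc₁C) (by rw [add_comm]; exact hc₂C) with h | ⟨h1, h2, h3, b, hb, a, ha, h4, h5⟩
    · exact Or.inl (twoEdges_comm h)
    · exact Or.inr ⟨h2, h1, h3, a, ha, b, hb, h5, h4⟩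
  by_cases hbb : b₂ = b₁
  · subst hbb
    exact shared_right hCsub hB hrow hcol ha₁ ha₂ hb₂ (Ne.symm haa) hc₁C hc₂C
  · exact Or.inl (twoEdges_mk ha₂ ha₁ hb₂ hb₁ haa hbb hc₂C hc₁C hcc)

end Prop55

/-! ### Lemma 5.11 (a special case of the Fainting Lemma) -/

section Lemma511
variable {A B : Finset G}

/-- `r_{A,B} = r_{B,A}`: the representation count is symmetric in a commutative group
(`Finset.addConvolution` of Mathlib is stated for general groups). [cite: Grynkiewicz2009, §2
(r_{A,B}(x) = r_{B,A}(x) is the number of representations)] -/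
theorem addConvolution_comm (A B : Finset G) (x : G) :
    A.addConvolution B x = B.addConvolution A x := by
  unfold addConvolution
  refine card_equiv (Equiv.prodComm G G) (fun p => ?_)
  simp only [mem_filter, mem_product, Equiv.prodComm_apply, Prod.fst_swap, Prod.snd_swap]
  constructor
  · rintro ⟨⟨h1, h2⟩, h3⟩
    exact ⟨⟨h2, h1⟩, by rw [add_comm, h3]⟩
  · rintro ⟨⟨h1, h2⟩, h3⟩
    exact ⟨⟨h2, h1⟩, by rw [add_comm, h3]⟩

/-- If `x ∉ S` has at least two representations `x = s + a` (`s ∈ S`, `a ∈ A`) and `A` has at most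
two non-zero elements, then every non-zero `a ∈ A` is used: `x − a ∈ S` ("since `|A| = 3`, it
follows that `N_i^{A*} = N_i^{≤ A*} = N_i`"). [cite: Grynkiewicz2009, Lemma 5.11 (proof)] -/
theorem sub_mem_of_two_le_addConvolution {S A : Finset G} {x : G} (hA2 : #(A.erase 0) ≤ 2)
    (hx : x ∉ S) (h2 : 2 ≤ S.addConvolution A x) : ∀ a ∈ A.erase 0, x - a ∈ S := by
  set F := (S ×ˢ A).filter (fun p : G × G => p.1 + p.2 = x) with hF
  have hFc : #F = S.addConvolution A x := rfl
  have himg : F.image Prod.snd ⊆ A.erase 0 := by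
    intro a ha
    rw [mem_image] at ha
    obtain ⟨p, hp, rfl⟩ := ha
    rw [hF, mem_filter, mem_product] at hp
    refine mem_erase.2 ⟨fun h0 => hx ?_, hp.1.2⟩
    rw [← hp.2, h0, add_zero]
    exact hp.1.1
  have hinj : Set.InjOn Prod.snd (F : Set (G × G)) := by
    intro p hp q hq hpq
    rw [mem_coe, hF, mem_filter] at hp hq
    refine Prod.ext ?_ hpq
    have := hp.2.trans hq.2.symm
    rw [hpq] at this
    exact add_right_cancel this
  have hcard : #(F.image Prod.snd) = #F := card_image_of_injOn hinj
  have heq : F.image Prod.snd = A.erase 0 := eq_of_subset_of_card_le himg (by omega)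
  intro a ha
  rw [← heq, mem_image] at ha
  obtain ⟨p, hp, rfl⟩ := ha
  rw [hF, mem_filter, mem_product] at hp
  rw [← hp.2, add_sub_cancel_right]
  exact hp.1.1

/-- If `x` has at least two representations `x = s + a` (`s ∈ S`, `a ∈ A`), one of them uses a
non-zero `a` ("`B + iA = B + (i−1)A + A*`"). [cite: Grynkiewicz2009, Lemma 5.11 (proof)] -/
theorem exists_ne_zero_sub_mem_of_two_le_addConvolution {S A : Finset G} {x : G}
    (h2 : 2 ≤ S.addConvolution A x) : ∃ a ∈ A, a ≠ 0 ∧ x - a ∈ S := by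
  by_contra hne
  push Not at hne
  have hsub : (S ×ˢ A).filter (fun p : G × G => p.1 + p.2 = x) ⊆ {(x, 0)} := by
    intro p hp
    rw [mem_filter, mem_product] at hp
    rw [mem_singleton]
    have hp2 : p.2 = 0 := by
      by_contra h
      exact hne p.2 hp.1.2 h (by rw [← hp.2, add_sub_cancel_right]; exact hp.1.1)
    refine Prod.ext ?_ hp2
    have := hp.2
    rw [hp2, add_zero] at this
    exact this
  have := card_le_card hsub
  rw [card_singleton] at this
  unfold addConvolution at h2
  omega

/-- **The layer step of Lemma 5.11.**  For three consecutive sumsets `S₀ = B + (i−2)A`,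
`S₁ = S₀ + A = B + (i−1)A`, `S₂ = S₁ + A = B + iA` with `0 ∈ A`, `|A| = 3` and
`r_{S₁, A}(c) ≥ 2` on `S₂`: if the layer `N_{i−1} = S₁ ∖ S₀` is nonempty, then
`|N_i| < |N_{i−1}|` (`N_i = S₂ ∖ S₁`).  Proof as printed: (39) `N_i − A* ⊆ N_{i−1}`; if
`|N_i| ≥ |N_{i−1}| > 0` then equality, and Kneser's theorem (`add_kneser`) applied to `N_i + (−A*)`
makes `N_i` periodic with a period group `H ∋ a₁ − a₂` containing `A* − a₁`; but
`B + iA = B + (i−1)A + A*` gives `S₂ + H = S₁ + H`, so the `H`-periodic `N_i ⊆ S₁ + H` would meet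
`S₁`. [cite: Grynkiewicz2009, Lemma 5.11 (proof)] -/
theorem card_layer_lt {S₀ S₁ S₂ A : Finset G} (h0A : (0 : G) ∈ A) (hA3 : #A = 3)
    (hS₁ : S₀ + A = S₁) (hS₂ : S₁ + A = S₂)
    (hrep : ∀ z ∈ S₂, 2 ≤ S₁.addConvolution A z) (hne : (S₁ \ S₀).Nonempty) :
    #(S₂ \ S₁) < #(S₁ \ S₀) := by
  have hA2 : #(A.erase 0) = 2 := by rw [card_erase_of_mem h0A, hA3]
  obtain ⟨a₁, a₂, hne12, hAst⟩ := card_eq_two.1 hA2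
  have ha₁ : a₁ ∈ A.erase 0 := by rw [hAst]; exact mem_insert_self _ _
  have ha₂ : a₂ ∈ A.erase 0 := by rw [hAst]; exact mem_insert_of_mem (mem_singleton_self _)
  have h12 : S₁ ⊆ S₂ := by rw [← hS₂]; exact subset_add_left S₁ h0A
  set N₁ := S₁ \ S₀ with hN₁
  set N₂ := S₂ \ S₁ with hN₂
  by_contra hle
  push Not at hle
  -- display (39): `N_i − A* ⊆ N_{i−1}`
  have hF4 : ∀ x ∈ N₂, ∀ a ∈ A.erase 0, x - a ∈ N₁ := by
    intro x hx a ha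
    rw [hN₂, mem_sdiff] at hx
    have h1 : x - a ∈ S₁ := sub_mem_of_two_le_addConvolution hA2.le hx.2 (hrep x hx.1) a ha
    refine mem_sdiff.2 ⟨h1, fun h0 => hx.2 ?_⟩
    rw [← hS₁]
    exact mem_add.2 ⟨x - a, h0, a, (mem_erase.1 ha).2, sub_add_cancel x a⟩
  set T := N₂ + -(A.erase 0) with hT
  have hTsub : T ⊆ N₁ := by
    intro y hy
    obtain ⟨x, hx, b, hb, rfl⟩ := mem_add.1 hy
    rw [mem_neg'] at hb
    have := hF4 x hx (-b) hb
    rwa [sub_neg_eq_add] at this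
  have hAne : (-(A.erase 0)).Nonempty := ⟨-a₁, by rw [mem_neg', neg_neg]; exact ha₁⟩
  have hN₂T : #N₂ ≤ #T := card_le_card_add_right hAne
  have hTN₁ : T = N₁ := eq_of_subset_of_card_le hTsub (by omega)
  have hTne : T.Nonempty := by rw [hTN₁]; exact hne
  have hTc : #T = #N₁ := by rw [hTN₁]
  have hN₂ne : N₂.Nonempty := by rw [← card_pos]; have := hne.card_pos; omega
  -- Kneser's theorem for `N_i + (−A*)`
  set H := T.addStab with hH
  have hHne : H.Nonempty := hTne.addStab
  have h0H : (0 : G) ∈ H := hTne.zero_mem_addStab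
  have kn := add_kneser (s := N₂) (t := -(A.erase 0))
  rw [← hT, ← hH] at kn
  have h1 : #N₂ ≤ #(N₂ + H) := card_le_card_add_right hHne
  have h2 : #H ≤ #(-(A.erase 0) + H) := card_le_card_add_left hAne
  have hper : N₂ + H = N₂ := by
    symm
    exact eq_of_subset_of_card_le (subset_add_left N₂ h0H) (by omega)
  have hAH : -(A.erase 0) + H = (-a₁) +ᵥ H := by
    symm
    refine eq_of_subset_of_card_le ?_ (by rw [card_vadd_finset]; omega)
    intro y hy
    obtain ⟨h, hh, rfl⟩ := mem_vadd_finset.1 hy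
    exact mem_add.2 ⟨-a₁, by rw [mem_neg', neg_neg]; exact ha₁, h, hh, rfl⟩
  have hgH : a₁ - a₂ ∈ H := by
    have : -a₂ ∈ (-a₁) +ᵥ H := by
      rw [← hAH]
      exact mem_add.2 ⟨-a₂, by rw [mem_neg', neg_neg]; exact ha₂, 0, h0H, add_zero _⟩
    obtain ⟨h, hh, hh'⟩ := mem_vadd_finset.1 this
    have : h = a₁ - a₂ := by
      rw [vadd_eq_add] at hh'
      have := congrArg (fun z => a₁ + z) hh'
      simp only [add_neg_cancel_left] at this
      rw [this, sub_eq_add_neg]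
    rw [← this]; exact hh
  have hnegH : ∀ h ∈ H, -h ∈ H := by
    intro h hh
    rw [← mem_coe, hH, coe_addStab hTne] at hh ⊢
    exact neg_mem hh
  have hN₂per : ∀ x ∈ N₂, ∀ h ∈ H, x - h ∈ N₂ := by
    intro x hx h hh
    rw [← hper, sub_eq_add_neg]
    exact add_mem_add hx (hnegH h hh)
  -- `A* ⊆ a₁ + H`
  have hAstH : A.erase 0 ⊆ a₁ +ᵥ H := by
    rw [hAst]
    intro a ha
    rw [mem_insert, mem_singleton] at ha
    rcases ha with rfl | rfl
    · exact mem_vadd_finset.2 ⟨0, h0H, by rw [vadd_eq_add, add_zero]⟩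
    · exact mem_vadd_finset.2 ⟨-(a₁ - a), hnegH _ hgH, by rw [vadd_eq_add]; abel⟩
  -- `B + iA = B + (i−1)A + A*`
  have hS₂sub : S₂ ⊆ S₁ + A.erase 0 := by
    intro c hc
    obtain ⟨a, ha, ha0, hca⟩ := exists_ne_zero_sub_mem_of_two_le_addConvolution (hrep c hc)
    exact mem_add.2 ⟨c - a, hca, a, mem_erase.2 ⟨ha0, ha⟩, sub_add_cancel c a⟩
  have hHH : H + H = H := addStab_add_addStab T
  have hS₂H : S₂ + H ⊆ a₁ +ᵥ (S₁ + H) := by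
    intro z hz
    obtain ⟨c, hc, h, hh, rfl⟩ := mem_add.1 hz
    obtain ⟨y, hy, a, ha, rfl⟩ := mem_add.1 (hS₂sub hc)
    obtain ⟨h', hh', rfl⟩ := mem_vadd_finset.1 (hAstH ha)
    have hsum : h' + h ∈ H := by rw [← hHH]; exact add_mem_add hh' hh
    refine mem_vadd_finset.2 ⟨y + (h' + h), add_mem_add hy hsum, ?_⟩
    rw [vadd_eq_add, vadd_eq_add]
    abel
  have hcardle : #(S₂ + H) ≤ #(S₁ + H) := by
    have := card_le_card hS₂H; rwa [card_vadd_finset] at this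
  have hSHeq : S₁ + H = S₂ + H :=
    eq_of_subset_of_card_le (add_subset_add_right h12) hcardle
  obtain ⟨x, hx⟩ := hN₂ne
  have hx' := hx
  rw [hN₂, mem_sdiff] at hx'
  have : x ∈ S₁ + H := by
    rw [hSHeq]; exact mem_add.2 ⟨x, hx'.1, 0, h0H, add_zero x⟩
  obtain ⟨y, hy, h, hh, rfl⟩ := mem_add.1 this
  have := hN₂per (y + h) hx h hh
  rw [add_sub_cancel_right, hN₂, mem_sdiff] at this
  exact this.2 hy

/-- `Σ_{i<n} (n − i) = C(n+1, 2)` (the final count "`|G| − Σ (m + 3 − i) = |G| − C(m+4, 2)`").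
[cite: Grynkiewicz2009, Lemma 5.11 (proof)] -/
theorem sum_range_sub_eq_choose (n : ℕ) : ∑ i ∈ range n, (n - i) = (n + 1).choose 2 := by
  induction n with
  | zero => simp
  | succ n ih =>
    have h1 : ∑ i ∈ range (n + 1), (n + 1 - i) = (∑ i ∈ range n, (n + 1 - i)) + 1 := by
      rw [sum_range_succ, Nat.add_sub_cancel_left]
    have h2 : ∑ i ∈ range n, (n + 1 - i) = ∑ i ∈ range n, (n - i) + n := by
      have : ∀ i ∈ range n, n + 1 - i = (n - i) + 1 := fun i hi => by
        rw [mem_range] at hi; omega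
      rw [sum_congr rfl this, sum_add_distrib, sum_const, card_range, smul_eq_mul, mul_one]
    rw [h1, h2, ih, Nat.choose_succ_succ (n + 1) 1, Nat.choose_one_right]
    ring

/-- **Grynkiewicz 2009, Lemma 5.11** (arXiv:0710.1041v2 Lemma 4.15; "a short proof of a special
case of the Fainting Lemma from [HamidouneSerraZemor2008]", whose case `|Y| = 3` the tree holds, for
FINITE `G` and under the layer hypotheses of that paper, as `fainting_three` in
`TwoAtomsOfSmallSumsets.lean`).  "Let `A` and `B` be finite, nonempty subsets of an abelian group `G`
with `0 ∈ A ∩ B`, `|A| = 3`, `|A + B| = |A| + |B| + m`, and `⟨A⟩ = G`.  If `r_{A,B}(c) ≥ 2` for all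
`c ∈ A + B`, then `G` is finite and `|B| ≥ |G| − C(m+4, 2)`."  Here `m + 4 = |A + B| − |B| + 1`, so
the conclusion reads `Nat.card G ≤ |B| + C(|A + B| − |B| + 1, 2)` with no sign condition on `m`;
`r_{A,B} = Finset.addConvolution A B`; finiteness of the TYPE `G` is part of the conclusion.  Proof as
printed: Proposition 2.2 (`le_addConvolution_add_nsmul`) gives `r_{B+(i−1)A, A} ≥ 2` on `B + iA`,
the layers `N_i = (B + iA) ∖ (B + (i−1)A)` strictly decrease while nonempty (`card_layer_lt`, via
(39) and Kneser), so `B + nA` (`n = |N_1| = |A + B| − |B|`) is `A`-, hence `⟨A⟩ = G`-invariant,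
i.e. all of `G`; and `|G| = |B| + Σ |N_i| ≤ |B| + Σ_{i<n} (n − i) = |B| + C(n+1, 2)`.
[cite: Grynkiewicz2009, Lemma 5.11] -/
theorem finite_and_card_le_of_two_le_addConvolution (h0A : (0 : G) ∈ A) (h0B : (0 : G) ∈ B)
    (hA3 : #A = 3) (hgen : AddSubgroup.closure (A : Set G) = ⊤)
    (hrep : ∀ c ∈ A + B, 2 ≤ A.addConvolution B c) :
    Finite G ∧ Nat.card G ≤ #B + Nat.choose (#(A + B) - #B + 1) 2 := by
  set S : ℕ → Finset G := fun i => B + i • A with hS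
  have hS0 : S 0 = B := by
    show B + 0 • A = B
    rw [zero_nsmul, add_zero]
  have hSsucc : ∀ i, S (i + 1) = S i + A := fun i => by
    show B + (i + 1) • A = B + i • A + A
    rw [succ_nsmul, add_assoc]
  have hS1 : S 1 = A + B := by
    show B + 1 • A = A + B
    rw [one_nsmul, add_comm]
  have hmono : ∀ i, S i ⊆ S (i + 1) := fun i => by
    rw [hSsucc]; exact subset_add_left _ h0A
  have hmono0 : ∀ i, S 0 ⊆ S i := fun i => by
    induction i with
    | zero => exact Subset.rfl
    | succ i ih => exact ih.trans (hmono i)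
  have hrepB : ∀ z ∈ B + A, 2 ≤ B.addConvolution A z := fun z hz => by
    rw [addConvolution_comm]; exact hrep z (by rwa [add_comm])
  have hrep' : ∀ j, ∀ z ∈ S (j + 1), 2 ≤ (S j).addConvolution A z := fun j z hz => by
    have := le_addConvolution_add_nsmul B A 2 hrepB (j + 1) (by omega) z hz
    rwa [Nat.add_sub_cancel] at this
  have hdec : ∀ j, (S (j + 1) \ S j).Nonempty →
      #(S (j + 1 + 1) \ S (j + 1)) < #(S (j + 1) \ S j) := fun j hne =>
    card_layer_lt h0A hA3 (hSsucc j).symm (hSsucc (j + 1)).symm (hrep' (j + 1)) hne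
  set n := #(S 1 \ S 0) with hn
  have hbound : ∀ j, #(S (j + 1) \ S j) ≤ n - j := by
    intro j
    induction j with
    | zero => show #(S 1 \ S 0) ≤ n - 0; omega
    | succ j ih =>
      by_cases hne : (S (j + 1) \ S j).Nonempty
      · have := hdec j hne; omega
      · rw [not_nonempty_iff_eq_empty, sdiff_eq_empty_iff_subset] at hne
        have heq : S (j + 1) = S j := Subset.antisymm hne (hmono j)
        have : S (j + 1 + 1) = S (j + 1) :=
          calc S (j + 1 + 1) = S (j + 1) + A := hSsucc (j + 1)
            _ = S j + A := by rw [heq]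
            _ = S (j + 1) := (hSsucc j).symm
        rw [this, Finset.sdiff_self, card_empty]
        exact Nat.zero_le _
  have hfix : S n + A = S n := by
    have h := hbound n
    rw [Nat.sub_self, Nat.le_zero, card_eq_zero, sdiff_eq_empty_iff_subset] at h
    rw [← hSsucc]
    exact Subset.antisymm h (hmono n)
  have h0Sn : (0 : G) ∈ S n := hmono0 n (by rw [hS0]; exact h0B)
  have hA : ∀ a ∈ A, a +ᵥ S n = S n := fun a ha => by
    have hsub : a +ᵥ S n ⊆ S n := by
      intro x hx
      obtain ⟨y, hy, rfl⟩ := mem_vadd_finset.1 hx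
      rw [← hfix, vadd_eq_add, add_comm a y]
      exact add_mem_add hy ha
    exact eq_of_subset_of_card_le hsub (by rw [card_vadd_finset])
  have hstab : ∀ g : G, g +ᵥ S n = S n := by
    intro g
    have hg : g ∈ AddSubgroup.closure (A : Set G) := by rw [hgen]; exact AddSubgroup.mem_top g
    refine AddSubgroup.closure_induction (p := fun x _ => x +ᵥ S n = S n) ?_ ?_ ?_ ?_ hg
    · intro y hy
      exact hA y (mem_coe.1 hy)
    · exact zero_vadd G (S n)
    · intro y z _ _ hy hz
      rw [add_vadd, hz, hy]
    · intro y _ hy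
      calc -y +ᵥ S n = -y +ᵥ (y +ᵥ S n) := by rw [hy]
        _ = S n := neg_vadd_vadd y (S n)
  have huniv : ∀ x : G, x ∈ S n := fun x => by
    rw [← hstab x]
    exact mem_vadd_finset.2 ⟨0, h0Sn, by rw [vadd_eq_add, add_zero]⟩
  have hfin : Finite G := by
    have : (Set.univ : Set G).Finite := by
      have : (Set.univ : Set G) = ↑(S n) := by
        ext x; exact ⟨fun _ => mem_coe.2 (huniv x), fun _ => Set.mem_univ x⟩
      rw [this]; exact finite_toSet (S n)
    exact Set.finite_univ_iff.1 this
  refine ⟨hfin, ?_⟩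
  haveI := Fintype.ofFinite G
  have hcardG : Nat.card G = #(S n) := by
    rw [Nat.card_eq_fintype_card, eq_univ_iff_forall.2 huniv, card_univ]
  have htel : ∀ j, #(S j) = #B + ∑ i ∈ range j, #(S (i + 1) \ S i) := by
    intro j
    induction j with
    | zero => rw [hS0, sum_range_zero, add_zero]
    | succ j ih =>
      rw [← card_sdiff_add_card_eq_card (hmono j), ih, sum_range_succ]
      ring
  have hsum : ∑ i ∈ range n, #(S (i + 1) \ S i) ≤ (n + 1).choose 2 :=
    calc ∑ i ∈ range n, #(S (i + 1) \ S i) ≤ ∑ i ∈ range n, (n - i) :=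
          sum_le_sum fun i _ => hbound i
      _ = (n + 1).choose 2 := sum_range_sub_eq_choose n
  have hnval : n = #(A + B) - #B := by
    have := card_sdiff_add_card_eq_card (hmono 0)
    rw [← hn] at this
    have h1 : S (0 + 1) = A + B := hS1
    rw [h1, hS0] at this
    omega
  rw [hcardG, htel n, ← hnval]
  omega

end Lemma511

end Literature.Combinatorics.Additive.Grynkiewicz2009


/-! ## §2: the layers `N_i(A, B)`, `N_i^U(A, B)`, `N_i^{≤U}(A, B)` and Proposition 2.3

Print pp. 3–4: "Assuming `0 ∈ A ∩ B`, for `i ≥ 0` we define the set `N_i(A, B)` by `N_0(A, B) = A`,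
`N_i(A, B) = (A + iB) ∖ (A + (i − 1)B)` for `i ≥ 1`, where `0B = {0}` … For `U ⊆ B`, `i ≥ 1` … we use
`N_i^U` to denote the set of all elements `x ∈ A + iB` such that `(x − (A + (i − 1)B)) ∩ B = U`, and we
define `N_i^{≤U} = ⋃_{V ⊆ U} N_i^V`.  Hence `A + (i − 1)B + (B ∖ U) = (A + iB) ∖ N_i^{≤U}`.  In
particular, `|N_1^b(A, B)|` is the number of `a ∈ A` with `a + b` a unique expression element in
`A + B`."  (The tree's `IsoperimetricMethod.lean` / `TwoAtomsOfSmallSumsets.lean` handle the plain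
layers `N_i` inline as `(X + iY) ∖ (X + (i−1)Y)`, cf. `Isoperimetric.layer_step`; no `N_i^U` there.)
-/

namespace Literature.Combinatorics.Additive

open Finset
open scoped Pointwise

variable {G : Type*} [AddCommGroup G] [DecidableEq G]

/-- **`N_i(A, B)`**: `N_0 = A`, `N_i = (A + iB) ∖ (A + (i−1)B)` for `i ≥ 1` (`iB` the `i`-fold sumset,
`0B = {0}`). [cite: Grynkiewicz2009, §2] -/
def layer (A B : Finset G) : ℕ → Finset G
  | 0 => A
  | i + 1 => (A + (i + 1) • B) \ (A + i • B)

/-- `N_0(A, B) = A`. [cite: Grynkiewicz2009, §2] -/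
theorem layer_zero (A B : Finset G) : layer A B 0 = A := rfl

/-- `N_{i+1}(A, B) = (A + (i+1)B) ∖ (A + iB)`. [cite: Grynkiewicz2009, §2] -/
theorem layer_succ (A B : Finset G) (i : ℕ) :
    layer A B (i + 1) = (A + (i + 1) • B) \ (A + i • B) := rfl

/-- `N_i(A, B) = (A + iB) ∖ (A + (i−1)B)` for `i ≥ 1`. [cite: Grynkiewicz2009, §2] -/
theorem layer_of_one_le (A B : Finset G) {i : ℕ} (hi : 1 ≤ i) :
    layer A B i = (A + i • B) \ (A + (i - 1) • B) := by
  obtain ⟨j, rfl⟩ : ∃ j, i = j + 1 := ⟨i - 1, by omega⟩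
  rw [layer_succ, Nat.add_sub_cancel]

/-- The trace `(x − (A + (i−1)B)) ∩ B = {b ∈ B : x − b ∈ A + (i−1)B}` of the representations of `x`
with last summand in `B`. [cite: Grynkiewicz2009, §2 (definition of N_i^U)] -/
def repTrace (A B : Finset G) (i : ℕ) (x : G) : Finset G :=
  B.filter fun b => x - b ∈ A + (i - 1) • B

/-- Membership in the representation trace. [cite: Grynkiewicz2009, §2] -/
theorem mem_repTrace {A B : Finset G} {i : ℕ} {x b : G} :
    b ∈ repTrace A B i x ↔ b ∈ B ∧ x - b ∈ A + (i - 1) • B := by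
  rw [repTrace, mem_filter]

/-- **`N_i^U(A, B)`**: "the set of all elements `x ∈ A + iB` such that `(x − (A + (i − 1)B)) ∩ B = U`".
[cite: Grynkiewicz2009, §2] -/
def layerWith (A B : Finset G) (i : ℕ) (U : Finset G) : Finset G :=
  (A + i • B).filter fun x => repTrace A B i x = U

/-- **`N_i^{≤U}(A, B) = ⋃_{V ⊆ U} N_i^V(A, B)`**, i.e. the `x ∈ A + iB` whose trace is contained in `U`
(`mem_layerWithin_iff_exists`). [cite: Grynkiewicz2009, §2] -/
def layerWithin (A B : Finset G) (i : ℕ) (U : Finset G) : Finset G :=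
  (A + i • B).filter fun x => repTrace A B i x ⊆ U

/-- Membership in `N_i^U`. [cite: Grynkiewicz2009, §2] -/
theorem mem_layerWith {A B U : Finset G} {i : ℕ} {x : G} :
    x ∈ layerWith A B i U ↔ x ∈ A + i • B ∧ repTrace A B i x = U := by
  rw [layerWith, mem_filter]

/-- Membership in `N_i^{≤U}`. [cite: Grynkiewicz2009, §2] -/
theorem mem_layerWithin {A B U : Finset G} {i : ℕ} {x : G} :
    x ∈ layerWithin A B i U ↔ x ∈ A + i • B ∧ repTrace A B i x ⊆ U := by
  rw [layerWithin, mem_filter]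

/-- `N_i^{≤U} = ⋃_{V ⊆ U} N_i^V` (the printed definition). [cite: Grynkiewicz2009, §2] -/
theorem mem_layerWithin_iff_exists {A B U : Finset G} {i : ℕ} {x : G} :
    x ∈ layerWithin A B i U ↔ ∃ V ⊆ U, x ∈ layerWith A B i V := by
  rw [mem_layerWithin]
  constructor
  · rintro ⟨hx, hsub⟩
    exact ⟨repTrace A B i x, hsub, mem_layerWith.2 ⟨hx, rfl⟩⟩
  · rintro ⟨V, hVU, hxV⟩
    rw [mem_layerWith] at hxV
    exact ⟨hxV.1, hxV.2 ▸ hVU⟩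

/-- `N_i^U = ∅` unless `U ⊆ B` (print takes `U ⊆ B`). [cite: Grynkiewicz2009, §2] -/
theorem layerWith_eq_empty_of_not_subset {A B U : Finset G} {i : ℕ} (hU : ¬ U ⊆ B) :
    layerWith A B i U = ∅ := by
  rw [eq_empty_iff_forall_notMem]
  intro x hx
  rw [mem_layerWith] at hx
  apply hU
  rw [← hx.2]
  exact filter_subset _ _

/-- "Hence `A + (i − 1)B + (B ∖ U) = (A + iB) ∖ N_i^{≤U}`" (`i ≥ 1`). [cite: Grynkiewicz2009, §2] -/
theorem add_nsmul_add_sdiff_eq {A B U : Finset G} {i : ℕ} (hi : 1 ≤ i) :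
    A + (i - 1) • B + (B \ U) = (A + i • B) \ layerWithin A B i U := by
  obtain ⟨j, rfl⟩ : ∃ j, i = j + 1 := ⟨i - 1, by omega⟩
  simp only [Nat.add_sub_cancel]
  ext x
  rw [mem_sdiff, mem_layerWithin, mem_add]
  constructor
  · rintro ⟨z, hz, b, hb, rfl⟩
    rw [mem_sdiff] at hb
    have hzb : z + b ∈ A + (j + 1) • B := by
      rw [succ_nsmul, ← add_assoc]; exact add_mem_add hz hb.1
    refine ⟨hzb, fun h => hb.2 (h.2 ?_)⟩
    rw [mem_repTrace, Nat.add_sub_cancel, add_sub_cancel_right]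
    exact ⟨hb.1, hz⟩
  · rintro ⟨hx, h⟩
    have : ¬ repTrace A B (j + 1) x ⊆ U := fun hsub => h ⟨hx, hsub⟩
    rw [not_subset] at this
    obtain ⟨b, hb, hbU⟩ := this
    rw [mem_repTrace, Nat.add_sub_cancel] at hb
    exact ⟨x - b, hb.2, b, mem_sdiff.2 ⟨hb.1, hbU⟩, sub_add_cancel x b⟩

/-- For `0 ∈ B` and `0 ∉ U`, `N_i^U ⊆ N_i` ("our definitions of `N_i^U` and `N_i^{≤U}` differ slightly
from those in [36], though they coincide when `0 ∉ U`"). [cite: Grynkiewicz2009, §2] -/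
theorem layerWith_subset_layer {A B U : Finset G} {i : ℕ} (hi : 1 ≤ i) (h0B : (0 : G) ∈ B)
    (h0 : (0 : G) ∉ U) : layerWith A B i U ⊆ layer A B i := by
  intro x hx
  rw [mem_layerWith] at hx
  rw [layer_of_one_le A B hi, mem_sdiff]
  refine ⟨hx.1, fun hx' => h0 ?_⟩
  rw [← hx.2, mem_repTrace, sub_zero]
  exact ⟨h0B, hx'⟩

/-- `r_{A,B}(x) = |(x − A) ∩ B| = |{b ∈ B : x − b ∈ A}|` (print p. 3). [cite: Grynkiewicz2009, §2] -/
theorem addConvolution_eq_card_filter (A B : Finset G) (x : G) :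
    A.addConvolution B x = #(B.filter fun b => x - b ∈ A) := by
  unfold addConvolution
  refine card_nbij' (fun p => p.2) (fun b => (x - b, b)) ?_ ?_ ?_ ?_
  · intro p hp
    rw [mem_coe, mem_filter, mem_product] at hp
    rw [mem_coe, mem_filter]
    refine ⟨hp.1.2, ?_⟩
    rw [← hp.2, add_sub_cancel_right]; exact hp.1.1
  · intro b hb
    rw [mem_coe, mem_filter] at hb
    rw [mem_coe, mem_filter, mem_product]
    exact ⟨⟨hb.2, hb.1⟩, sub_add_cancel x b⟩
  · intro p hp
    rw [mem_coe, mem_filter] at hp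
    simp only
    refine Prod.ext ?_ rfl
    simp only
    rw [← hp.2, add_sub_cancel_right]
  · intro b _
    rfl

/-- `|repTrace A B 1 x| = r_{A,B}(x)`. [cite: Grynkiewicz2009, §2] -/
theorem card_repTrace_one (A B : Finset G) (x : G) : #(repTrace A B 1 x) = A.addConvolution B x := by
  rw [addConvolution_eq_card_filter, repTrace]
  simp only [Nat.sub_self, zero_nsmul, add_zero]

/-- "In particular, `|N_1^b(A, B)|` is the number of `a ∈ A` with `a + b` a unique expression element
in `A + B`" (`b ∈ B`). [cite: Grynkiewicz2009, §2] -/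
theorem card_layerWith_one_singleton {A B : Finset G} {b : G} (hb : b ∈ B) :
    #(layerWith A B 1 {b}) = #(A.filter fun a => A.addConvolution B (a + b) = 1) := by
  symm
  refine card_nbij' (fun a => a + b) (fun x => x - b) ?_ ?_ ?_ ?_
  · intro a ha
    rw [mem_coe, mem_filter] at ha
    rw [mem_coe, mem_layerWith, one_nsmul]
    refine ⟨add_mem_add ha.1 hb, ?_⟩
    have hbmem : b ∈ repTrace A B 1 (a + b) := by
      rw [mem_repTrace, Nat.sub_self, zero_nsmul, add_zero, add_sub_cancel_right]; exact ⟨hb, ha.1⟩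
    have hcard : #(repTrace A B 1 (a + b)) = 1 := by rw [card_repTrace_one]; exact ha.2
    obtain ⟨c, hc⟩ := card_eq_one.1 hcard
    rw [hc] at hbmem ⊢
    rw [mem_singleton] at hbmem
    rw [hbmem]
  · intro x hx
    rw [mem_coe, mem_layerWith, one_nsmul] at hx
    rw [mem_coe, mem_filter, sub_add_cancel]
    have hbmem : b ∈ repTrace A B 1 x := by rw [hx.2]; exact mem_singleton_self b
    rw [mem_repTrace, Nat.sub_self, zero_nsmul, add_zero] at hbmem
    refine ⟨hbmem.2, ?_⟩
    rw [← card_repTrace_one, hx.2, card_singleton]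
  · intro a _
    simp only [add_sub_cancel_right]
  · intro x _
    simp only [sub_add_cancel]

end Literature.Combinatorics.Additive

namespace Literature.Combinatorics.Additive.Grynkiewicz2009

open Finset
open scoped Pointwise

variable {G : Type*} [AddCommGroup G] [DecidableEq G]

/-- **Proposition 2.3** ("Let `G` be an abelian group, let `X, Y ⊆ G` be finite and nonempty with
`0 ∈ X ∩ Y`, and let `i ≥ 1`.  If `U ⊆ Y`, then `N_{i+1}^U(X, Y) − U ⊆ N_i^{≤U}(X, Y)`"), elementwise.
Proof as printed: `x ∈ N_{i+1}^U`, `u ∈ U` ⇒ `x − u ∈ X + iY`; if `(x − u) − y' ∈ X + (i−1)Y` with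
`y' ∈ Y`, then `x − y' = u + ((x − u) − y') ∈ X + iY`, so `y' ∈ U` by the definition of the trace.
The printed side conditions `0 ∈ X ∩ Y`, nonemptiness and `U ⊆ Y` are not used (for `U ⊄ Y`,
`N_{i+1}^U = ∅`). [cite: Grynkiewicz2009, Prop 2.3] -/
theorem sub_mem_layerWithin_of_mem_layerWith {X Y U : Finset G} {i : ℕ} (hi : 1 ≤ i) {x : G}
    (hx : x ∈ layerWith X Y (i + 1) U) {u : G} (hu : u ∈ U) : x - u ∈ layerWithin X Y i U := by
  rw [mem_layerWith] at hx
  obtain ⟨hx, hU⟩ := hx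
  have huT : u ∈ repTrace X Y (i + 1) x := by rw [hU]; exact hu
  rw [mem_repTrace, Nat.add_sub_cancel] at huT
  rw [mem_layerWithin]
  refine ⟨huT.2, fun y hy => ?_⟩
  rw [mem_repTrace] at hy
  rw [← hU, mem_repTrace, Nat.add_sub_cancel]
  refine ⟨hy.1, ?_⟩
  have : x - y = u + (x - u - y) := by abel
  rw [this, show X + i • Y = Y + (X + (i - 1) • Y) by
    rw [add_comm Y, add_assoc, ← succ_nsmul, Nat.sub_add_cancel hi]]
  exact add_mem_add huT.1 hy.2

/-- **Proposition 2.3**, finset form: `N_{i+1}^U(X, Y) − U ⊆ N_i^{≤U}(X, Y)` for `i ≥ 1` (pointwise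
difference of finsets). [cite: Grynkiewicz2009, Prop 2.3] -/
theorem layerWith_sub_subset_layerWithin {X Y U : Finset G} {i : ℕ} (hi : 1 ≤ i) :
    layerWith X Y (i + 1) U - U ⊆ layerWithin X Y i U := by
  intro z hz
  obtain ⟨x, hx, u, hu, rfl⟩ := mem_sub.1 hz
  exact sub_mem_layerWithin_of_mem_layerWith hi hx hu

end Literature.Combinatorics.Additive.Grynkiewicz2009


/-! ## §2: `H`-coset traces `A_{a,H}`, `H`-coset decompositions, and the maximal `H`-periodic subset

Print p. 3: "Given `a_i ∈ A` and a subgroup `H`, we use `A_{a_i,H}` to denote `(a_i + H) ∩ A`, with the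
`H` dropped from the notation when clear.  If `A_{a_i} ≠ a_i + H`, then `A_{a_i}` is a *partially filled*
`H`-coset.  An `H`-decomposition of `A` is a partition `A_{a_1} ∪ … ∪ A_{a_l}` of `A` with `a_i ∈ A`."
Print p. 17 (proof of Lemma 5.6, likewise Lemma 5.7): "Let `B′` be the maximal subset of `B` that is
`H`-periodic, and let `B ∖ B′ = B_{b_1} ∪ … ∪ B_{b_l}` be an `H`-coset decomposition of `B ∖ B′`.  From
the maximality of `B′` it follows that no `B_{b_i}` is `H`-periodic."  The two (noncomputable, classical)
definitions below and their API are this bookkeeping, for the successor ports of Lemmas 5.6/5.7/§6.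
-/

namespace Literature.Combinatorics.Additive

open Finset
open scoped Pointwise

variable {G : Type*} [AddCommGroup G] [DecidableEq G]

/-- **`A_{a,H} = (a + H) ∩ A`**, the trace of `A` on the `H`-coset of `a` ("Given `a_i ∈ A` and a
subgroup `H`, we use `A_{a_i,H}` to denote `(a_i + H) ∩ A`"). [cite: Grynkiewicz2009, §2] -/
noncomputable def cosetTrace (H : AddSubgroup G) (A : Finset G) (a : G) : Finset G :=
  open scoped Classical in A.filter fun x => x - a ∈ H

omit [DecidableEq G] in
/-- Membership in `A_{a,H}`. [cite: Grynkiewicz2009, §2] -/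
theorem mem_cosetTrace {H : AddSubgroup G} {A : Finset G} {a x : G} :
    x ∈ cosetTrace H A a ↔ x ∈ A ∧ x - a ∈ H := by
  classical
  unfold cosetTrace
  rw [mem_filter]

omit [DecidableEq G] in
/-- `A_{a,H} ⊆ A`. [cite: Grynkiewicz2009, §2] -/
theorem cosetTrace_subset (H : AddSubgroup G) (A : Finset G) (a : G) : cosetTrace H A a ⊆ A := by
  intro x hx; exact (mem_cosetTrace.1 hx).1

omit [DecidableEq G] in
/-- `a ∈ A_{a,H}` for `a ∈ A`. [cite: Grynkiewicz2009, §2] -/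
theorem mem_cosetTrace_self {H : AddSubgroup G} {A : Finset G} {a : G} (ha : a ∈ A) :
    a ∈ cosetTrace H A a :=
  mem_cosetTrace.2 ⟨ha, by rw [sub_self]; exact H.zero_mem⟩

omit [DecidableEq G] in
/-- `A_{a,H}` depends only on the coset `a + H`. [cite: Grynkiewicz2009, §2] -/
theorem cosetTrace_eq_of_sub_mem {H : AddSubgroup G} {A : Finset G} {a b : G} (h : a - b ∈ H) :
    cosetTrace H A a = cosetTrace H A b := by
  ext x
  rw [mem_cosetTrace, mem_cosetTrace]
  constructor
  · rintro ⟨hx, hxa⟩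
    exact ⟨hx, by have := H.add_mem hxa h; rwa [sub_add_sub_cancel] at this⟩
  · rintro ⟨hx, hxb⟩
    refine ⟨hx, ?_⟩
    have := H.sub_mem hxb h
    rwa [sub_sub_sub_cancel_right] at this

omit [DecidableEq G] in
/-- Two elements of one trace differ by an element of `H` ("`A_0` is a subset of an `H`-coset").
[cite: Grynkiewicz2009, §2] -/
theorem sub_mem_of_mem_cosetTrace {H : AddSubgroup G} {A : Finset G} {a x y : G}
    (hx : x ∈ cosetTrace H A a) (hy : y ∈ cosetTrace H A a) : x - y ∈ H := by
  have := H.sub_mem (mem_cosetTrace.1 hx).2 (mem_cosetTrace.1 hy).2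
  rwa [sub_sub_sub_cancel_right] at this

omit [DecidableEq G] in
/-- Two traces are disjoint or equal (an `H`-decomposition is a partition). [cite: Grynkiewicz2009, §2] -/
theorem cosetTrace_disjoint_or_eq (H : AddSubgroup G) (A : Finset G) (a b : G) :
    Disjoint (cosetTrace H A a) (cosetTrace H A b) ∨ cosetTrace H A a = cosetTrace H A b := by
  by_cases h : a - b ∈ H
  · exact Or.inr (cosetTrace_eq_of_sub_mem h)
  · left
    rw [disjoint_left]
    intro x hxa hxb
    apply h
    have := H.sub_mem (mem_cosetTrace.1 hxb).2 (mem_cosetTrace.1 hxa).2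
    rwa [sub_sub_sub_cancel_left] at this

/-- `A = ⋃_{a ∈ A} A_{a,H}` ("an `H`-decomposition of `A` is a partition `A_{a_1} ∪ … ∪ A_{a_l}` of `A`
with `a_i ∈ A`"). [cite: Grynkiewicz2009, §2] -/
theorem biUnion_cosetTrace (H : AddSubgroup G) (A : Finset G) :
    A.biUnion (cosetTrace H A) = A := by
  ext x
  rw [mem_biUnion]
  constructor
  · rintro ⟨a, -, hx⟩; exact cosetTrace_subset H A a hx
  · intro hx; exact ⟨x, hx, mem_cosetTrace_self hx⟩

/-- `A_{a,H} ⊆ a + H` (with `H` carried as a finset `Hf`). [cite: Grynkiewicz2009, §2] -/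
theorem cosetTrace_subset_vadd {H : AddSubgroup G} {Hf : Finset G} (hHf : ∀ g, g ∈ Hf ↔ g ∈ H)
    (A : Finset G) (a : G) : cosetTrace H A a ⊆ a +ᵥ Hf := by
  intro x hx
  refine mem_vadd_finset.2 ⟨x - a, (hHf _).2 (mem_cosetTrace.1 hx).2, ?_⟩
  rw [vadd_eq_add, add_sub_cancel]

/-- `A_{a,H} = A ∩ (a + H)` (with `H` carried as a finset `Hf`). [cite: Grynkiewicz2009, §2] -/
theorem cosetTrace_eq_inter_vadd {H : AddSubgroup G} {Hf : Finset G} (hHf : ∀ g, g ∈ Hf ↔ g ∈ H)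
    (A : Finset G) (a : G) : cosetTrace H A a = A ∩ (a +ᵥ Hf) := by
  ext x
  rw [mem_cosetTrace, mem_inter, mem_vadd_finset]
  constructor
  · rintro ⟨hx, hxa⟩
    exact ⟨hx, x - a, (hHf _).2 hxa, by rw [vadd_eq_add, add_sub_cancel]⟩
  · rintro ⟨hx, h, hh, rfl⟩
    exact ⟨hx, by rw [vadd_eq_add, add_sub_cancel_left]; exact (hHf h).1 hh⟩

/-- **The maximal `H`-periodic subset `B′` of `B`**: the elements of `B` whose whole `H`-coset lies in `B`
("Let `B′` be the maximal subset of `B` that is `H`-periodic", proofs of Lemmas 5.6 and 5.7; maximality is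
`subset_periodicPart_of_isPeriodicWith`). [cite: Grynkiewicz2009, Lemma 5.6 (proof)] -/
noncomputable def periodicPart (H : AddSubgroup G) (B : Finset G) : Finset G :=
  open scoped Classical in B.filter fun x => ∀ h ∈ H, h + x ∈ B

omit [DecidableEq G] in
/-- Membership in `B′`. [cite: Grynkiewicz2009, Lemma 5.6 (proof)] -/
theorem mem_periodicPart {H : AddSubgroup G} {B : Finset G} {x : G} :
    x ∈ periodicPart H B ↔ x ∈ B ∧ ∀ h ∈ H, h + x ∈ B := by
  classical
  unfold periodicPart
  rw [mem_filter]

omit [DecidableEq G] in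
/-- `B′ ⊆ B`. [cite: Grynkiewicz2009, Lemma 5.6 (proof)] -/
theorem periodicPart_subset (H : AddSubgroup G) (B : Finset G) : periodicPart H B ⊆ B :=
  fun _ hx => (mem_periodicPart.1 hx).1

/-- `B′` is `H`-periodic. [cite: Grynkiewicz2009, Lemma 5.6 (proof)] -/
theorem isPeriodicWith_periodicPart (H : AddSubgroup G) (B : Finset G) :
    IsPeriodicWith H (periodicPart H B) := by
  have key : ∀ h ∈ H, ∀ x ∈ periodicPart H B, h + x ∈ periodicPart H B := by
    intro h hh x hx
    rw [mem_periodicPart] at hx ⊢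
    refine ⟨hx.2 h hh, fun h' hh' => ?_⟩
    rw [← add_assoc]
    exact hx.2 (h' + h) (H.add_mem hh' hh)
  intro h hh
  refine Subset.antisymm (fun x hx => ?_) (fun x hx => ?_)
  · obtain ⟨y, hy, rfl⟩ := mem_vadd_finset.1 hx
    exact key h hh y hy
  · refine mem_vadd_finset.2 ⟨-h + x, key (-h) (H.neg_mem hh) x hx, ?_⟩
    rw [vadd_eq_add, add_neg_cancel_left]

/-- **Maximality of `B′`**: every `H`-periodic subset of `B` lies in `B′`.
[cite: Grynkiewicz2009, Lemma 5.6 (proof)] -/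
theorem subset_periodicPart_of_isPeriodicWith {H : AddSubgroup G} {B P : Finset G}
    (hP : IsPeriodicWith H P) (hPB : P ⊆ B) : P ⊆ periodicPart H B := by
  intro x hx
  rw [mem_periodicPart]
  refine ⟨hPB hx, fun h hh => hPB ?_⟩
  rw [← hP h hh]
  exact mem_vadd_finset.2 ⟨x, hx, rfl⟩

/-- `B′ = B` iff `B` is `H`-periodic. [cite: Grynkiewicz2009, Lemma 5.6 (proof)] -/
theorem periodicPart_eq_self_iff {H : AddSubgroup G} {B : Finset G} :
    periodicPart H B = B ↔ IsPeriodicWith H B := by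
  constructor
  · intro h; rw [← h]; exact isPeriodicWith_periodicPart H B
  · intro h
    exact Subset.antisymm (periodicPart_subset H B) (subset_periodicPart_of_isPeriodicWith h Subset.rfl)

/-- A coset trace of `B` is inside `B′` or disjoint from it (so `B ∖ B′` is a union of whole traces).
[cite: Grynkiewicz2009, Lemma 5.6 (proof)] -/
theorem cosetTrace_subset_periodicPart_or_disjoint (H : AddSubgroup G) (B : Finset G) (b : G) :
    cosetTrace H B b ⊆ periodicPart H B ∨ Disjoint (cosetTrace H B b) (periodicPart H B) := by
  by_cases h : ∃ x ∈ cosetTrace H B b, x ∈ periodicPart H B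
  · left
    obtain ⟨x, hx, hxP⟩ := h
    intro y hy
    have hyx : y - x ∈ H := sub_mem_of_mem_cosetTrace hy hx
    have := (isPeriodicWith_periodicPart H B) (y - x) hyx
    rw [← this]
    exact mem_vadd_finset.2 ⟨x, hxP, by rw [vadd_eq_add, sub_add_cancel]⟩
  · right
    push Not at h
    exact disjoint_left.2 fun x hx hxP => h x hx hxP

/-- An element of `B ∖ B′` has an `H`-translate outside `B` ("From the maximality of `B′` it follows
that no `B_{b_i}` is `H`-periodic"). [cite: Grynkiewicz2009, Lemma 5.6 (proof)] -/
theorem exists_add_notMem_of_mem_sdiff_periodicPart {H : AddSubgroup G} {B : Finset G} {x : G}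
    (hx : x ∈ B \ periodicPart H B) : ∃ h ∈ H, h + x ∉ B := by
  rw [mem_sdiff, mem_periodicPart] at hx
  by_contra hne
  push Not at hne
  exact hx.2 ⟨hx.1, hne⟩

/-- The traces of the elements of `B ∖ B′` lie in `B ∖ B′` (the `H`-coset decomposition
`B ∖ B′ = B_{b_1} ∪ … ∪ B_{b_l}`). [cite: Grynkiewicz2009, Lemma 5.6 (proof)] -/
theorem cosetTrace_subset_sdiff_periodicPart {H : AddSubgroup G} {B : Finset G} {b : G}
    (hb : b ∈ B \ periodicPart H B) : cosetTrace H B b ⊆ B \ periodicPart H B := by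
  rcases cosetTrace_subset_periodicPart_or_disjoint H B b with h | h
  · exact absurd (h (mem_cosetTrace_self (mem_sdiff.1 hb).1)) (mem_sdiff.1 hb).2
  · intro x hx
    exact mem_sdiff.2 ⟨cosetTrace_subset H B b hx, disjoint_left.1 h hx⟩

/-- A trace inside `B′` is a full coset `b + H` (with `H` as a finset). [cite: Grynkiewicz2009, Lemma 5.6
(proof)] -/
theorem cosetTrace_eq_vadd_of_mem_periodicPart {H : AddSubgroup G} {Hf : Finset G}
    (hHf : ∀ g, g ∈ Hf ↔ g ∈ H) {B : Finset G} {b : G} (hb : b ∈ periodicPart H B) :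
    cosetTrace H B b = b +ᵥ Hf := by
  refine Subset.antisymm (cosetTrace_subset_vadd hHf B b) fun x hx => ?_
  obtain ⟨h, hh, rfl⟩ := mem_vadd_finset.1 hx
  rw [mem_cosetTrace, vadd_eq_add, add_sub_cancel_left]
  refine ⟨?_, (hHf h).1 hh⟩
  have := (mem_periodicPart.1 hb).2 h ((hHf h).1 hh)
  rwa [add_comm] at this

/-- The traces `B_{b_i}` of `B ∖ B′` are partially filled: `|B_{b_i}| < |H|` (with `H` as a finset;
"since `|H| > |B_{b_i}|` for all `i`", proof of Lemma 5.6, display (33)). [cite: Grynkiewicz2009, Lemma 5.6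
(proof)] -/
theorem card_cosetTrace_lt_of_mem_sdiff_periodicPart {H : AddSubgroup G} {Hf : Finset G}
    (hHf : ∀ g, g ∈ Hf ↔ g ∈ H) {B : Finset G} {b : G} (hb : b ∈ B \ periodicPart H B) :
    #(cosetTrace H B b) < #Hf := by
  obtain ⟨h, hh, hnot⟩ := exists_add_notMem_of_mem_sdiff_periodicPart hb
  have hsub := cosetTrace_subset_vadd hHf B b
  have hne : cosetTrace H B b ≠ b +ᵥ Hf := by
    intro heq
    have : h + b ∈ b +ᵥ Hf := mem_vadd_finset.2 ⟨h, (hHf h).2 hh, by rw [vadd_eq_add, add_comm]⟩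
    rw [← heq] at this
    exact hnot (cosetTrace_subset H B b this)
  have := card_lt_card (lt_of_le_of_ne hsub hne)
  rwa [card_vadd_finset] at this

/-- `B = B′ ∪ (B ∖ B′)`. [cite: Grynkiewicz2009, Lemma 5.6 (proof)] -/
theorem periodicPart_union_sdiff (H : AddSubgroup G) (B : Finset G) :
    periodicPart H B ∪ (B \ periodicPart H B) = B :=
  union_sdiff_of_subset (periodicPart_subset H B)

end Literature.Combinatorics.Additive

/-! ## Lemma 5.6: the first two displays, (31) and (32) -/

namespace Literature.Combinatorics.Additive

open Finset
open scoped Pointwise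

variable {G : Type*} [AddCommGroup G] [DecidableEq G]

/-- A nonempty `H`-periodic set (`H ≠ 0`) together with points of a single `H`-coset is quasi-periodic
(the decomposition `P ⊔ (S ∖ P)`; print p. 3, definition of quasi-periodic).
[cite: Grynkiewicz2009, §2] -/
theorem isQuasiPeriodic_union_of_isPeriodicWith {H : AddSubgroup G} {P S : Finset G} (hH : H ≠ ⊥)
    (hP : IsPeriodicWith H P) (hPne : P.Nonempty) (hS : ∀ x ∈ S, ∀ y ∈ S, x - y ∈ H) :
    IsQuasiPeriodic (P ∪ S) :=
  ⟨H, P, S \ P, ⟨hH, disjoint_sdiff, union_sdiff_self_eq_union, hP,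
    fun x hx y hy => hS x (mem_sdiff.1 hx).1 y (mem_sdiff.1 hy).1⟩, hPne⟩

namespace Grynkiewicz2009

/-- The inner step of display (31): with `A = A′ ∪ A₁ ∪ A₂` as in Lemma 5.6 (`H(A′) = H ≠ 0`,
`A_i ⊆ a_i + H`), if some `α ∈ A₁` has its whole coset `α + H` inside `A₁ ∪ A₂`, then `A` is
quasi-periodic (either `A₁ ∪ A₂` lies in one `H`-coset, or `A₁ = α + H` is a full coset and
`A′ ∪ A₁` is a nonempty `H`-periodic part) — "Since `A` is not quasi-periodic, it follows that `A₁` and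
`A₂` are both nonempty partially filled `H`-cosets that are disjoint modulo `H`".
[cite: Grynkiewicz2009, Lemma 5.6 (proof)] -/
theorem isQuasiPeriodic_of_coset_subset {A A' A₁ A₂ : Finset G} {H : AddSubgroup G} {a₁ a₂ α : G}
    (hA : A = A' ∪ A₁ ∪ A₂) (hA'ne : A'.Nonempty) (hH : H ≠ ⊥)
    (hA'H : ∀ g, g ∈ A'.addStab ↔ g ∈ H)
    (hA₁ : ∀ x ∈ A₁, x - a₁ ∈ H) (hA₂ : ∀ x ∈ A₂, x - a₂ ∈ H)
    (hα : α ∈ A₁) (hT : α +ᵥ A'.addStab ⊆ A₁ ∪ A₂) : IsQuasiPeriodic A := by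
  have hper : IsPeriodicWith H A' := fun h hh => (mem_addStab hA'ne).1 ((hA'H h).2 hh)
  by_cases h12 : a₁ - a₂ ∈ H
  · have hx1 : ∀ x ∈ A₁ ∪ A₂, x - a₁ ∈ H := by
      intro x hx
      rw [mem_union] at hx
      rcases hx with hx | hx
      · exact hA₁ x hx
      · have := H.sub_mem (hA₂ x hx) h12
        rwa [sub_sub_sub_cancel_right] at this
    have hS : ∀ x ∈ A₁ ∪ A₂, ∀ y ∈ A₁ ∪ A₂, x - y ∈ H := by
      intro x hx y hy
      have := H.sub_mem (hx1 x hx) (hx1 y hy)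
      rwa [sub_sub_sub_cancel_right] at this
    rw [hA, union_assoc]
    exact isQuasiPeriodic_union_of_isPeriodicWith hH hper hA'ne hS
  · -- the coset of `α` lies in `A₁`, so `A₁` is a full coset
    have hTA₁ : α +ᵥ A'.addStab ⊆ A₁ := by
      intro t ht
      have ht' := hT ht
      rw [mem_union] at ht'
      rcases ht' with h1 | h2
      · exact h1
      · exfalso
        obtain ⟨g, hg, rfl⟩ := mem_vadd_finset.1 ht
        apply h12
        have e : a₁ - a₂ = (α +ᵥ g) - a₂ - g - (α - a₁) := by rw [vadd_eq_add]; abel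
        rw [e]
        exact H.sub_mem (H.sub_mem (hA₂ _ h2) ((hA'H g).1 hg)) (hA₁ α hα)
    have hA₁T : A₁ = α +ᵥ A'.addStab := by
      refine Subset.antisymm (fun x hx => ?_) hTA₁
      refine mem_vadd_finset.2 ⟨x - α, (hA'H _).2 ?_, by rw [vadd_eq_add, add_sub_cancel]⟩
      have := H.sub_mem (hA₁ x hx) (hA₁ α hα)
      rwa [sub_sub_sub_cancel_right] at this
    have hA₁per : IsPeriodicWith H A₁ := by
      intro h hh
      rw [hA₁T, vadd_vadd, add_comm, ← vadd_vadd, vadd_addStab ((hA'H h).2 hh)]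
    have hS : ∀ x ∈ A₂, ∀ y ∈ A₂, x - y ∈ H := by
      intro x hx y hy
      have := H.sub_mem (hA₂ x hx) (hA₂ y hy)
      rwa [sub_sub_sub_cancel_right] at this
    rw [hA]
    exact isQuasiPeriodic_union_of_isPeriodicWith hH (hper.union hA₁per)
      (hA'ne.mono subset_union_left) hS

/-- **Lemma 5.6, display (31) — strengthened, and without the quotient group.**  Let
`A = A′ ∪ A₁ ∪ A₂` with `A′ ≠ ∅` `H`-periodic of maximal period `H ≠ 0` (`H(A′) = H`), `A₁ ⊆ a₁ + H`,
`A₂ ⊆ a₂ + H`, `A` not quasi-periodic and `A` non-extendible with respect to `B ≠ ∅`.  Then the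
stabilizer of `A′ + B` is exactly `H`, and hence (Kneser, `add_kneser`)
`|A′ + B| ≥ |A′| + |B + H| − |H|`, which is the printed
"(31) `|φ_H(A′) + φ_H(B)| ≥ |φ_H(A′)| + |φ_H(B)| − 1`" multiplied by `|H|`.  Print argues in `G/H`
("If `|φ_H(A′) + φ_H(B)| < |φ_H(A′)| + |φ_H(B)| − 1`, then from Kneser's Theorem it follows that
`φ_H(A′) + φ_H(B)` is periodic, contradicting either the maximality of `H` for `A′` or the fact that `A`
is non-extendible"); here: a period `k` of `A′ + B` moves `A′` into `A` (non-extendibility), and a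
translate `k + x ∉ A′` would drag a whole `H`-coset into `A₁ ∪ A₂`, making `A` quasi-periodic
(`isQuasiPeriodic_of_coset_subset`); so `k + A′ = A′`, `k ∈ H`.  The other hypotheses of Lemma 5.6
(`0 ∈ A ∩ B`, `|A|, |B|, d⊆(A + B, P) ≥ 3`, `⟨A⟩ = G`, finiteness of `G`) are not needed for this step.
[cite: Grynkiewicz2009, Lemma 5.6 (proof, display (31))] -/
theorem addStab_add_eq_and_display31 {A A' A₁ A₂ B : Finset G} {H : AddSubgroup G} {a₁ a₂ : G}
    (hA : A = A' ∪ A₁ ∪ A₂) (hA'ne : A'.Nonempty) (hH : H ≠ ⊥)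
    (hA'H : ∀ g, g ∈ A'.addStab ↔ g ∈ H)
    (hA₁ : ∀ x ∈ A₁, x - a₁ ∈ H) (hA₂ : ∀ x ∈ A₂, x - a₂ ∈ H)
    (hAqp : ¬ IsQuasiPeriodic A) (hne : IsNonExtendible A B) (hBne : B.Nonempty) :
    (A' + B).addStab = A'.addStab ∧ #A' + #(B + A'.addStab) ≤ #(A' + B) + #A'.addStab := by
  have hper : IsPeriodicWith H A' := fun h hh => (mem_addStab hA'ne).1 ((hA'H h).2 hh)
  have hABne : (A' + B).Nonempty := hA'ne.add hBne
  have hA'A : A' ⊆ A := by rw [hA, union_assoc]; exact subset_union_left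
  -- `H ⊆ H(A' + B)`
  have hHK : A'.addStab ⊆ (A' + B).addStab := by
    intro g hg
    rw [mem_addStab hABne, ← vadd_add_assoc, (mem_addStab hA'ne).1 hg]
  -- `H(A' + B) ⊆ H`
  have hKH : (A' + B).addStab ⊆ A'.addStab := by
    intro k hk
    have hkAB : k +ᵥ (A' + B) = A' + B := (mem_addStab hABne).1 hk
    -- every `k + x`, `x ∈ A'`, lies in `A`
    have hkA : ∀ x ∈ A', k + x ∈ A := by
      intro x hx
      by_contra hα
      obtain ⟨b, hb, hαb⟩ := (isNonExtendible_iff.1 hne) (k + x) hα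
      apply hαb
      have : k + x + b ∈ k +ᵥ (A' + B) :=
        mem_vadd_finset.2 ⟨x + b, add_mem_add hx hb, by rw [vadd_eq_add, add_assoc]⟩
      rw [hkAB] at this
      exact add_subset_add_right hA'A this
    -- in fact in `A'`
    have hkA' : ∀ x ∈ A', k + x ∈ A' := by
      intro x hx
      by_contra hα
      set α := k + x with hαdef
      -- the whole coset `α + H` lies in `A ∖ A' ⊆ A₁ ∪ A₂`
      have hT : α +ᵥ A'.addStab ⊆ A₁ ∪ A₂ := by
        intro t ht
        obtain ⟨g, hg, rfl⟩ := mem_vadd_finset.1 ht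
        have hgH : g ∈ H := (hA'H g).1 hg
        have hgx : g + x ∈ A' := by
          rw [← hper g hgH]; exact mem_vadd_finset.2 ⟨x, hx, rfl⟩
        have h1 : α +ᵥ g ∈ A := by
          have := hkA (g + x) hgx
          have e : α +ᵥ g = k + (g + x) := by rw [hαdef, vadd_eq_add]; abel
          rw [e]; exact this
        have h2 : α +ᵥ g ∉ A' := by
          intro h
          apply hα
          have hneg : -g ∈ H := H.neg_mem hgH
          have : -g +ᵥ (α +ᵥ g) ∈ A' := by
            rw [← hper (-g) hneg]; exact mem_vadd_finset.2 ⟨_, h, rfl⟩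
          have e2 : -g +ᵥ (α +ᵥ g) = α := by rw [vadd_eq_add, vadd_eq_add]; abel
          rw [e2] at this; exact this
        rw [hA, union_assoc, mem_union] at h1
        rcases h1 with h1 | h1
        · exact absurd h1 h2
        · exact h1
      have hαA : α ∈ A₁ ∪ A₂ := by
        have := hT (mem_vadd_finset.2 ⟨0, hA'ne.zero_mem_addStab, by rw [vadd_eq_add, add_zero]⟩)
        exact this
      rw [mem_union] at hαA
      rcases hαA with hα1 | hα2
      · exact hAqp (isQuasiPeriodic_of_coset_subset hA hA'ne hH hA'H hA₁ hA₂ hα1 hT)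
      · refine hAqp (isQuasiPeriodic_of_coset_subset (A₁ := A₂) (A₂ := A₁) ?_ hA'ne hH hA'H hA₂ hA₁ hα2 ?_)
        · rw [hA, union_right_comm]
        · rwa [union_comm]
    have hsub : k +ᵥ A' ⊆ A' := by
      intro y hy
      obtain ⟨x, hx, rfl⟩ := mem_vadd_finset.1 hy
      exact hkA' x hx
    exact (mem_addStab hA'ne).2 (eq_of_subset_of_card_le hsub (by rw [card_vadd_finset]))
  have hK : (A' + B).addStab = A'.addStab := Subset.antisymm hKH hHK
  refine ⟨hK, ?_⟩
  have kn := add_kneser (s := A') (t := B)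
  rw [hK, add_comm A' A'.addStab, addStab_add] at kn
  exact kn

/-- **Lemma 5.6, display (32), first inequality.**  With `C′` the maximal `H`-periodic subset of
`A + B` (`periodicPart H (A + B)`): "Note that `A′ + B ⊆ C′`.  Hence from (31) it follows that
(32) `|A + B| ≥ (|φ_H(A′)| + |φ_H(B′)| + l − 1)|H| + Σ_{i=1}^{r} |C_{c_i}|`", here in the form
`|A′| + |B + H| + |(A + B) ∖ C′| ≤ |A + B| + |H|` (print's `(|φ_H(B′)| + l)|H|` is `|B + H|`, and
`Σ |C_{c_i}| = |(A + B) ∖ C′|`), under the hypotheses of `addStab_add_eq_and_display31`.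
[cite: Grynkiewicz2009, Lemma 5.6 (proof, display (32))] -/
theorem display32 {A A' A₁ A₂ B : Finset G} {H : AddSubgroup G} {a₁ a₂ : G}
    (hA : A = A' ∪ A₁ ∪ A₂) (hA'ne : A'.Nonempty) (hH : H ≠ ⊥)
    (hA'H : ∀ g, g ∈ A'.addStab ↔ g ∈ H)
    (hA₁ : ∀ x ∈ A₁, x - a₁ ∈ H) (hA₂ : ∀ x ∈ A₂, x - a₂ ∈ H)
    (hAqp : ¬ IsQuasiPeriodic A) (hne : IsNonExtendible A B) (hBne : B.Nonempty) :
    A' + B ⊆ periodicPart H (A + B) ∧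
      #A' + #(B + A'.addStab) + #((A + B) \ periodicPart H (A + B)) ≤ #(A + B) + #A'.addStab := by
  have hper : IsPeriodicWith H A' := fun h hh => (mem_addStab hA'ne).1 ((hA'H h).2 hh)
  have hA'A : A' ⊆ A := by rw [hA, union_assoc]; exact subset_union_left
  have hsub : A' + B ⊆ periodicPart H (A + B) :=
    subset_periodicPart_of_isPeriodicWith (hper.add_right B) (add_subset_add_right hA'A)
  refine ⟨hsub, ?_⟩
  obtain ⟨-, h31⟩ := addStab_add_eq_and_display31 hA hA'ne hH hA'H hA₁ hA₂ hAqp hne hBne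
  have h1 := card_le_card hsub
  have h2 := card_sdiff_add_card_eq_card (periodicPart_subset H (A + B))
  omega

/-- **Lemma 5.6, set-up: the shape of `A₁`, `A₂`.**  With `A = A′ ∪ A₁ ∪ A₂` (`A′ ≠ ∅`, `H(A′) = H ≠ 0`,
`A_i ⊆ a_i + H`) and `A` not quasi-periodic: `A₁, A₂ ≠ ∅`, both disjoint from `A′` and from each other,
`a₁ − a₂ ∉ H` (distinct cosets), and each coset `a_i + H` has a hole of `A` ("Since `A` is not
quasi-periodic, it follows that `A₁` and `A₂` are both nonempty partially filled `H`-cosets that are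
disjoint modulo `H`"). [cite: Grynkiewicz2009, Lemma 5.6 (proof)] -/
theorem parts_of_not_isQuasiPeriodic {A A' A₁ A₂ : Finset G} {H : AddSubgroup G} {a₁ a₂ : G}
    (hA : A = A' ∪ A₁ ∪ A₂) (hA'ne : A'.Nonempty) (hH : H ≠ ⊥)
    (hA'H : ∀ g, g ∈ A'.addStab ↔ g ∈ H)
    (hA₁ : ∀ x ∈ A₁, x - a₁ ∈ H) (hA₂ : ∀ x ∈ A₂, x - a₂ ∈ H) (hAqp : ¬ IsQuasiPeriodic A) :
    A₁.Nonempty ∧ A₂.Nonempty ∧ Disjoint A' A₁ ∧ Disjoint A' A₂ ∧ a₁ - a₂ ∉ H ∧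
      Disjoint A₁ A₂ ∧ (∃ α ∈ a₁ +ᵥ A'.addStab, α ∉ A) ∧ (∃ α ∈ a₂ +ᵥ A'.addStab, α ∉ A) := by
  have hper : IsPeriodicWith H A' := fun h hh => (mem_addStab hA'ne).1 ((hA'H h).2 hh)
  have hS₁ : ∀ x ∈ A₁, ∀ y ∈ A₁, x - y ∈ H := fun x hx y hy => by
    have := H.sub_mem (hA₁ x hx) (hA₁ y hy); rwa [sub_sub_sub_cancel_right] at this
  have hS₂ : ∀ x ∈ A₂, ∀ y ∈ A₂, x - y ∈ H := fun x hx y hy => by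
    have := H.sub_mem (hA₂ x hx) (hA₂ y hy); rwa [sub_sub_sub_cancel_right] at this
  -- symmetric form of `hA`
  have hA' : A = A' ∪ A₂ ∪ A₁ := by rw [hA, union_right_comm]
  -- nonemptiness
  have hne₁ : A₁.Nonempty := by
    rw [nonempty_iff_ne_empty]; rintro rfl
    apply hAqp; rw [hA, union_empty]
    exact isQuasiPeriodic_union_of_isPeriodicWith hH hper hA'ne hS₂
  have hne₂ : A₂.Nonempty := by
    rw [nonempty_iff_ne_empty]; rintro rfl
    apply hAqp; rw [hA, union_empty, ]
    exact isQuasiPeriodic_union_of_isPeriodicWith hH hper hA'ne hS₁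
  -- disjointness from `A'`: if `A_i` meets `A'`, then `A_i ⊆ A'`
  have hsub_of_meet : ∀ {S : Finset G} {a : G}, (∀ x ∈ S, x - a ∈ H) → ¬ Disjoint A' S → S ⊆ A' := by
    intro S a hS hdis x hx
    rw [not_disjoint_iff] at hdis
    obtain ⟨y, hyA', hyS⟩ := hdis
    have hxy : x - y ∈ H := by
      have := H.sub_mem (hS x hx) (hS y hyS); rwa [sub_sub_sub_cancel_right] at this
    rw [← hper (x - y) hxy]
    exact mem_vadd_finset.2 ⟨y, hyA', by rw [vadd_eq_add, sub_add_cancel]⟩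
  have hd₁ : Disjoint A' A₁ := by
    by_contra h
    have h1 : A₁ ⊆ A' := hsub_of_meet hA₁ h
    apply hAqp
    rw [hA, union_eq_left.2 h1]
    exact isQuasiPeriodic_union_of_isPeriodicWith hH hper hA'ne hS₂
  have hd₂ : Disjoint A' A₂ := by
    by_contra h
    have h2 : A₂ ⊆ A' := hsub_of_meet hA₂ h
    apply hAqp
    rw [hA', union_eq_left.2 h2]
    exact isQuasiPeriodic_union_of_isPeriodicWith hH hper hA'ne hS₁
  -- distinct cosets
  have h12 : a₁ - a₂ ∉ H := by
    intro h12
    apply hAqp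
    rw [hA, union_assoc]
    refine isQuasiPeriodic_union_of_isPeriodicWith hH hper hA'ne fun x hx y hy => ?_
    have hx1 : ∀ z ∈ A₁ ∪ A₂, z - a₁ ∈ H := by
      intro z hz
      rw [mem_union] at hz
      rcases hz with hz | hz
      · exact hA₁ z hz
      · have := H.sub_mem (hA₂ z hz) h12; rwa [sub_sub_sub_cancel_right] at this
    have := H.sub_mem (hx1 x hx) (hx1 y hy); rwa [sub_sub_sub_cancel_right] at this
  have hd₁₂ : Disjoint A₁ A₂ := by
    rw [disjoint_left]
    intro x hx1 hx2
    apply h12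
    have := H.sub_mem (hA₂ x hx2) (hA₁ x hx1)
    rw [sub_sub_sub_cancel_left] at this
    exact this
  -- holes
  have hole : ∀ {S T : Finset G} {a b : G}, A = A' ∪ S ∪ T → (∀ x ∈ S, x - a ∈ H) →
      (∀ x ∈ T, x - b ∈ H) → S.Nonempty → ∃ α ∈ a +ᵥ A'.addStab, α ∉ A := by
    intro S T a b hAST hS hT hSne
    by_contra hno
    push Not at hno
    obtain ⟨s, hs⟩ := hSne
    apply hAqp
    refine isQuasiPeriodic_of_coset_subset hAST hA'ne hH hA'H hS hT hs fun t ht => ?_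
    obtain ⟨g, hg, rfl⟩ := mem_vadd_finset.1 ht
    have hgH : g ∈ H := (hA'H g).1 hg
    have htA : s +ᵥ g ∈ A := by
      apply hno
      refine mem_vadd_finset.2 ⟨s - a + g, (hA'H _).2 (H.add_mem (hS s hs) hgH), ?_⟩
      rw [vadd_eq_add, vadd_eq_add]; abel
    rw [hAST, union_assoc, mem_union] at htA
    rcases htA with htA | htA
    · -- `s + g ∈ A'` forces `s ∈ A'`, contradicting disjointness
      exfalso
      have hsA' : s ∈ A' := by
        rw [← hper (-g) (H.neg_mem hgH)]
        refine mem_vadd_finset.2 ⟨s +ᵥ g, htA, ?_⟩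
        rw [vadd_eq_add, vadd_eq_add]; abel
      have hdS : Disjoint A' S := by
        by_contra h
        have : S ⊆ A' := hsub_of_meet hS h
        apply hAqp
        rw [hAST, union_eq_left.2 this]
        exact isQuasiPeriodic_union_of_isPeriodicWith hH hper hA'ne fun x hx y hy => by
          have := H.sub_mem (hT x hx) (hT y hy); rwa [sub_sub_sub_cancel_right] at this
      exact disjoint_left.1 hdS hsA' hs
    · exact htA
  exact ⟨hne₁, hne₂, hd₁, hd₂, h12, hd₁₂, hole hA hA₁ hA₂ hne₁, hole hA' hA₂ hA₁ hne₂⟩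

/-- **Lemma 5.6, set-up: `l ≥ 2`** (finite `G`, all hypotheses of the lemma).  With `B′` the maximal
`H`-periodic subset of `B`, the set `B ∖ B′` meets at least two `H`-cosets ("From Lemma 5.4 it follows
that `⟨B⟩ = G` and that `B` is not quasi-periodic.  Hence `l ≥ 2`, as otherwise `H = G` implying `A = G`,
which contradicts `A + B` aperiodic").  The coset hypotheses on `A₁, A₂` are not needed here.
[cite: Grynkiewicz2009, Lemma 5.6 (proof)] -/
theorem exists_two_cosets_sdiff_periodicPart [Fintype G] {A A' A₁ A₂ B : Finset G} {H : AddSubgroup G}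
    (hA : A = A' ∪ A₁ ∪ A₂) (hA'ne : A'.Nonempty) (hH : H ≠ ⊥)
    (hA'H : ∀ g, g ∈ A'.addStab ↔ g ∈ H)
    (hA3 : 3 ≤ #A) (hB3 : 3 ≤ #B) (h0A : (0 : G) ∈ A) (h0B : (0 : G) ∈ B)
    (hAB : #(A + B) = #A + #B) (haper : (A + B).addStab = {0})
    (hneA : IsNonExtendible A B) (hneB : IsNonExtendible B A)
    (hgen : AddSubgroup.closure (A : Set G) = ⊤) (hAqp : ¬ IsQuasiPeriodic A) :
    ∃ b₁ ∈ B \ periodicPart H B, ∃ b₂ ∈ B \ periodicPart H B, b₁ - b₂ ∉ H := by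
  have hper : IsPeriodicWith H A' := fun h hh => (mem_addStab hA'ne).1 ((hA'H h).2 hh)
  obtain ⟨hBqp, hBgen⟩ :=
    not_isQuasiPeriodic_and_closure_eq_top hA3 hB3 h0A h0B hAB haper hneA hneB hgen hAqp
  have hBne : B.Nonempty := ⟨0, h0B⟩
  have hABne : (A + B).Nonempty := (hA'ne.mono (by rw [hA, union_assoc]; exact subset_union_left)).add hBne
  by_contra hno
  push Not at hno
  set B' := periodicPart H B with hB'
  rcases B'.eq_empty_or_nonempty with hB'e | hB'ne
  · -- `B` lies in one `H`-coset through `0`, so `H = G`, `A = G`, `A + B = G` is periodic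
    have hBH : ∀ b ∈ B, b ∈ H := by
      intro b hb
      have := hno b (by rw [mem_sdiff, hB'e]; exact ⟨hb, notMem_empty b⟩) 0
        (by rw [mem_sdiff, hB'e]; exact ⟨h0B, notMem_empty 0⟩)
      rwa [sub_zero] at this
    have hHtop : H = ⊤ := by
      rw [eq_top_iff, ← hBgen, AddSubgroup.closure_le]
      exact fun b hb => hBH b (mem_coe.1 hb)
    obtain ⟨a, ha⟩ := hA'ne
    have hA'univ : A' = univ := by
      refine eq_univ_of_forall fun x => ?_
      have hx : x - a ∈ H := by rw [hHtop]; exact AddSubgroup.mem_top _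
      rw [← hper (x - a) hx]
      exact mem_vadd_finset.2 ⟨a, ha, by rw [vadd_eq_add, sub_add_cancel]⟩
    have hAuniv : A = univ := by
      refine eq_univ_of_forall fun x => ?_
      rw [hA, union_assoc]; exact mem_union_left _ (by rw [hA'univ]; exact mem_univ x)
    have hABuniv : A + B = univ := by
      refine eq_univ_of_forall fun x => ?_
      exact mem_add.2 ⟨x, by rw [hAuniv]; exact mem_univ x, 0, h0B, add_zero x⟩
    obtain ⟨h, hhH, hh0⟩ : ∃ h ∈ H, h ≠ (0 : G) := by
      by_contra hne
      push Not at hne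
      exact hH ((AddSubgroup.eq_bot_iff_forall _).2 hne)
    have : h ∈ (A + B).addStab := by
      rw [mem_addStab hABne, hABuniv]
      exact eq_univ_of_forall fun x => mem_vadd_finset.2 ⟨-h + x, mem_univ _, by
        rw [vadd_eq_add, add_neg_cancel_left]⟩
    rw [haper, mem_singleton] at this
    exact hh0 this
  · -- `B = B' ⊔ (B ∖ B')` with `B ∖ B'` inside one coset: quasi-periodic
    apply hBqp
    rw [← periodicPart_union_sdiff H B]
    exact isQuasiPeriodic_union_of_isPeriodicWith hH (isPeriodicWith_periodicPart H B) hB'ne hno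

/-- **Lemma 5.6, the row condition for Proposition 5.5.**  Some hole `α` of `A` in the coset `a₁ + H`
and some `b ∈ B ∖ B′` have `α + b ∉ A + B` — so the coset ("colour") of `a₁ + b` is one of the partially
filled cosets `C_{c_j}` of `A + B` ("From the non-extendibility of `A`, and since each `A_i` is a partially
filled `H`-coset, it follows that each `a_i` has at least one `b_j` such that
`φ_H(a_i) + φ_H(b_j) ∈ φ_H(C ∖ C′)`"); for `a₂` apply it with `A₁`, `A₂` interchanged
(`A = A′ ∪ A₂ ∪ A₁` by `Finset.union_right_comm`). [cite: Grynkiewicz2009, Lemma 5.6 (proof)] -/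
theorem exists_row_colour {A A' A₁ A₂ B : Finset G} {H : AddSubgroup G} {a₁ a₂ : G}
    (hA : A = A' ∪ A₁ ∪ A₂) (hA'ne : A'.Nonempty) (hH : H ≠ ⊥)
    (hA'H : ∀ g, g ∈ A'.addStab ↔ g ∈ H)
    (hA₁ : ∀ x ∈ A₁, x - a₁ ∈ H) (hA₂ : ∀ x ∈ A₂, x - a₂ ∈ H) (hAqp : ¬ IsQuasiPeriodic A)
    (hneA : IsNonExtendible A B) :
    ∃ b ∈ B \ periodicPart H B, ∃ α ∈ a₁ +ᵥ A'.addStab, α ∉ A ∧ α + b ∉ A + B := by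
  obtain ⟨hne₁, -, -, -, -, -, ⟨α, hα, hαA⟩, -⟩ := parts_of_not_isQuasiPeriodic hA hA'ne hH hA'H hA₁ hA₂ hAqp
  obtain ⟨b, hb, hαb⟩ := (isNonExtendible_iff.1 hneA) α hαA
  refine ⟨b, mem_sdiff.2 ⟨hb, fun hbB' => hαb ?_⟩, α, hα, hαA, hαb⟩
  -- `b ∈ B'`: then `α + b ∈ A + B`
  obtain ⟨a, ha⟩ := hne₁
  obtain ⟨g, hg, rfl⟩ := mem_vadd_finset.1 hα
  have hgH : g ∈ H := (hA'H g).1 hg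
  have hga : a₁ + g - a ∈ H := by
    have := H.sub_mem hgH (hA₁ a ha)
    have e : a₁ + g - a = g - (a - a₁) := by abel
    rwa [e]
  have hb' : (a₁ + g - a) + b ∈ B := (mem_periodicPart.1 hbB').2 _ hga
  have haA : a ∈ A := by rw [hA, union_assoc, union_comm A₁]; simp [ha]
  have e : (a₁ +ᵥ g) + b = a + ((a₁ + g - a) + b) := by rw [vadd_eq_add]; abel
  rw [e]
  exact add_mem_add haA hb'

/-- **Lemma 5.6, the column condition for Proposition 5.5.**  Every `b ∈ B ∖ B′` has a hole `h + b ∉ B`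
of its coset and an `a ∈ A₁ ∪ A₂` with `h + b + a ∉ A + B` ("In view of the non-extendibility of `B`,
and since each `B_{b_i}` is a partially filled `H`-coset, it follows that the same holds true for each
`b_i`"). [cite: Grynkiewicz2009, Lemma 5.6 (proof)] -/
theorem exists_col_colour {A A' A₁ A₂ B : Finset G} {H : AddSubgroup G}
    (hA : A = A' ∪ A₁ ∪ A₂) (hA'ne : A'.Nonempty)
    (hA'H : ∀ g, g ∈ A'.addStab ↔ g ∈ H) (hneB : IsNonExtendible B A)
    {b : G} (hb : b ∈ B \ periodicPart H B) :
    ∃ a ∈ A₁ ∪ A₂, ∃ h ∈ H, h + b ∉ B ∧ h + b + a ∉ A + B := by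
  have hper : IsPeriodicWith H A' := fun h hh => (mem_addStab hA'ne).1 ((hA'H h).2 hh)
  obtain ⟨h, hhH, hβ⟩ := exists_add_notMem_of_mem_sdiff_periodicPart hb
  obtain ⟨a, ha, hβa⟩ := (isNonExtendible_iff.1 hneB) (h + b) hβ
  have haA : a ∈ A₁ ∪ A₂ := by
    rw [hA, union_assoc, mem_union] at ha
    rcases ha with ha | ha
    · exfalso
      apply hβa
      have hha : h + a ∈ A' := by
        rw [← hper h hhH]; exact mem_vadd_finset.2 ⟨a, ha, rfl⟩
      have haA : h + a ∈ A := by rw [hA, union_assoc]; exact mem_union_left _ hha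
      have e : h + b + a = b + (h + a) := by abel
      rw [e]
      exact add_mem_add (mem_sdiff.1 hb).1 haA
    · exact ha
  refine ⟨a, haA, h, hhH, hβ, ?_⟩
  rwa [add_comm B A] at hβa

/-- **Lemma 5.6: where the partially filled cosets of `A + B` come from.**  Every element of
`(A + B) ∖ C′` (`C′` the maximal `H`-periodic subset of `A + B`) is `a + b` with `a ∈ A₁ ∪ A₂` and
`b ∈ B ∖ B′` ("Since the `C_{c_i}` are partially filled `H`-cosets, it follows that
`φ_H(C ∖ C′) ⊆ φ_H(A₁ ∪ A₂) + φ_H(B ∖ B′)`"). [cite: Grynkiewicz2009, Lemma 5.6 (proof)] -/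
theorem exists_eq_add_of_mem_sdiff_periodicPart {A A' A₁ A₂ B : Finset G} {H : AddSubgroup G}
    (hA : A = A' ∪ A₁ ∪ A₂) (hA'ne : A'.Nonempty)
    (hA'H : ∀ g, g ∈ A'.addStab ↔ g ∈ H) {c : G}
    (hc : c ∈ (A + B) \ periodicPart H (A + B)) :
    ∃ a ∈ A₁ ∪ A₂, ∃ b ∈ B \ periodicPart H B, c = a + b := by
  have hper : IsPeriodicWith H A' := fun h hh => (mem_addStab hA'ne).1 ((hA'H h).2 hh)
  have hA'A : A' ⊆ A := by rw [hA, union_assoc]; exact subset_union_left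
  rw [mem_sdiff] at hc
  obtain ⟨hcAB, hcC⟩ := hc
  obtain ⟨a, ha, b, hb, rfl⟩ := mem_add.1 hcAB
  have haA := ha
  rw [hA, union_assoc, mem_union] at ha
  rcases ha with ha' | ha12
  · exfalso
    apply hcC
    exact subset_periodicPart_of_isPeriodicWith (hper.add_right B) (add_subset_add_right hA'A)
      (add_mem_add ha' hb)
  refine ⟨a, ha12, b, mem_sdiff.2 ⟨hb, fun hbB' => hcC ?_⟩, rfl⟩
  rw [mem_periodicPart]
  refine ⟨hcAB, fun h hh => ?_⟩
  rw [← add_assoc, add_comm h a, add_assoc]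
  exact add_mem_add haA ((mem_periodicPart.1 hbB').2 h hh)

/-- **Lemma 5.6, the reduction to two cases via Proposition 5.5 modulo `H`** (finite `G`).  Under the
hypotheses of Lemma 5.6 — here `d⊆(A + B, P) ≥ 3` enters only through its two consequences used at this
point, `A + B` aperiodic and `|overline{A + B}| ≥ 3` (for Lemma 5.4) — put, in `G/H`,
`𝒜 = {φ_H(a₁), φ_H(a₂)}`, `ℬ = φ_H(B ∖ B′)`, `𝒞 = φ_H((A + B) ∖ C′)` (`B′`, `C′` the maximal `H`-periodic
subsets).  Then `𝒞 ⊆ 𝒜 + ℬ`, `|𝒜| = 2`, `|ℬ|, |𝒞| ≥ 2`, every row and column carries a colour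
(`exists_row_colour`, `exists_col_colour`), and Proposition 5.5 (`exists_two_edges_or_card_eq_two`) yields:
"either there exist distinct `b_{i₁}` and `b_{i₂}`, and distinct `c_{i′₁}` and `c_{i′₂}`, such that
`φ_H(a₁ + b_{i₁}) = φ_H(c_{i′₁})` and `φ_H(a₂ + b_{i₂}) = φ_H(c_{i′₂})`, or else `l = r = 2` and w.l.o.g.
`φ_H(a₁ + {b₁, b₂}) = {φ_H(c₁), φ_H(c₂)}` and `φ_H(b₁ + {a₁, a₂}) = {φ_H(c₁), φ_H(c₂)}`" — stated as the
disjunction of Proposition 5.5 for `(𝒜, ℬ, 𝒞)`.  Cases 1 and 2 of the printed proof (displays (33), (34))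
start from here and are successor work.  `[DecidableEq (G ⧸ H)]` is a hypothesis binder (supply it
classically). [cite: Grynkiewicz2009, Lemma 5.6 (proof)] -/
theorem prop55_cases_mod [Fintype G] {A A' A₁ A₂ B : Finset G} {H : AddSubgroup G}
    [DecidableEq (G ⧸ H)] {a₁ a₂ : G}
    (hA : A = A' ∪ A₁ ∪ A₂) (hA'ne : A'.Nonempty) (hH : H ≠ ⊥)
    (hA'H : ∀ g, g ∈ A'.addStab ↔ g ∈ H)
    (hA₁ : ∀ x ∈ A₁, x - a₁ ∈ H) (hA₂ : ∀ x ∈ A₂, x - a₂ ∈ H)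
    (hA3 : 3 ≤ #A) (hB3 : 3 ≤ #B) (hC3 : 3 ≤ #(A + B)ᶜ) (h0A : (0 : G) ∈ A) (h0B : (0 : G) ∈ B)
    (hAB : #(A + B) = #A + #B) (haper : (A + B).addStab = {0})
    (hneA : IsNonExtendible A B) (hneB : IsNonExtendible B A)
    (hgen : AddSubgroup.closure (A : Set G) = ⊤) (hAqp : ¬ IsQuasiPeriodic A) :
    let 𝒜 : Finset (G ⧸ H) := {(a₁ : G ⧸ H), (a₂ : G ⧸ H)}
    let ℬ : Finset (G ⧸ H) := (B \ periodicPart H B).image ((↑) : G → G ⧸ H)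
    let 𝒞 : Finset (G ⧸ H) := ((A + B) \ periodicPart H (A + B)).image ((↑) : G → G ⧸ H)
    (∃ a ∈ 𝒜, ∃ a' ∈ 𝒜, ∃ b ∈ ℬ, ∃ b' ∈ ℬ,
        a ≠ a' ∧ b ≠ b' ∧ a + b ∈ 𝒞 ∧ a' + b' ∈ 𝒞 ∧ a + b ≠ a' + b') ∨
      (#𝒜 = 2 ∧ #ℬ = 2 ∧ #𝒞 = 2 ∧ ∃ a ∈ 𝒜, ∃ b ∈ ℬ, a +ᵥ ℬ = 𝒞 ∧ b +ᵥ 𝒜 = 𝒞) := by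
  intro 𝒜 ℬ 𝒞
  have hper : IsPeriodicWith H A' := fun h hh => (mem_addStab hA'ne).1 ((hA'H h).2 hh)
  have hA'A : A' ⊆ A := by rw [hA, union_assoc]; exact subset_union_left
  have hBne : B.Nonempty := ⟨0, h0B⟩
  obtain ⟨hne₁, hne₂, -, -, h12, -, -, -⟩ :=
    parts_of_not_isQuasiPeriodic hA hA'ne hH hA'H hA₁ hA₂ hAqp
  have hqe : ∀ x y : G, (x : G ⧸ H) = (y : G ⧸ H) ↔ x - y ∈ H := fun x y =>
    QuotientAddGroup.eq_iff_sub_mem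
  -- `|𝒜| = 2`
  have h𝒜 : #𝒜 = 2 := by
    refine card_pair fun h => h12 ((hqe a₁ a₂).1 h)
  -- `|ℬ| ≥ 2`
  have hℬ : 2 ≤ #ℬ := by
    obtain ⟨b₁, hb₁, b₂, hb₂, hb12⟩ := exists_two_cosets_sdiff_periodicPart hA hA'ne hH hA'H
      hA3 hB3 h0A h0B hAB haper hneA hneB hgen hAqp
    have hsub : ({(b₁ : G ⧸ H), (b₂ : G ⧸ H)} : Finset (G ⧸ H)) ⊆ ℬ := by
      intro q hq
      rw [mem_insert, mem_singleton] at hq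
      rcases hq with rfl | rfl
      · exact mem_image_of_mem _ hb₁
      · exact mem_image_of_mem _ hb₂
    have := card_le_card hsub
    rwa [card_pair (fun h => hb12 ((hqe b₁ b₂).1 h))] at this
  -- `|𝒞| ≥ 2`: otherwise `A + B` is quasi-periodic
  have hC'per : IsPeriodicWith H (periodicPart H (A + B)) := isPeriodicWith_periodicPart H (A + B)
  have hC'ne : (periodicPart H (A + B)).Nonempty :=
    (hA'ne.add hBne).mono (subset_periodicPart_of_isPeriodicWith (hper.add_right B)
      (add_subset_add_right hA'A))
  have h𝒞 : 2 ≤ #𝒞 := by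
    by_contra hlt
    push Not at hlt
    have hABqp : ¬ IsQuasiPeriodic (A + B) :=
      (not_isQuasiPeriodic_add_and_compl hA3 hC3 h0A h0B hAB haper hneA hneB hgen hAqp).1
    apply hABqp
    rw [← periodicPart_union_sdiff H (A + B)]
    refine isQuasiPeriodic_union_of_isPeriodicWith hH hC'per hC'ne fun x hx y hy => ?_
    have : ((x : G ⧸ H)) = (y : G ⧸ H) := by
      have hx' : (x : G ⧸ H) ∈ 𝒞 := mem_image_of_mem _ hx
      have hy' : (y : G ⧸ H) ∈ 𝒞 := mem_image_of_mem _ hy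
      exact card_le_one.1 (by omega) _ hx' _ hy'
    exact (hqe x y).1 this
  -- `𝒞 ⊆ 𝒜 + ℬ`
  have h𝒞sub : 𝒞 ⊆ 𝒜 + ℬ := by
    intro q hq
    obtain ⟨c, hc, rfl⟩ := mem_image.1 hq
    obtain ⟨a, ha, b, hb, rfl⟩ := exists_eq_add_of_mem_sdiff_periodicPart hA hA'ne hA'H hc
    rw [QuotientAddGroup.mk_add]
    refine add_mem_add ?_ (mem_image_of_mem _ hb)
    rw [mem_union] at ha
    rcases ha with ha | ha
    · have : (a : G ⧸ H) = a₁ := (hqe a a₁).2 (hA₁ a ha)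
      rw [this]; exact mem_insert_self _ _
    · have : (a : G ⧸ H) = a₂ := (hqe a a₂).2 (hA₂ a ha)
      rw [this]; exact mem_insert_of_mem (mem_singleton_self _)
  -- membership in `𝒞` from a witness outside `A + B` in the coset
  have mem𝒞 : ∀ {x b w : G}, x ∈ A → b ∈ B → w ∉ A + B → w - (x + b) ∈ H →
      ((x + b : G) : G ⧸ H) ∈ 𝒞 := by
    intro x b w hx hb hw hwx
    refine mem_image_of_mem _ (mem_sdiff.2 ⟨add_mem_add hx hb, fun hC => hw ?_⟩)
    have := (mem_periodicPart.1 hC).2 (w - (x + b)) hwx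
    rwa [sub_add_cancel] at this
  -- rows
  have hrow : ∀ q ∈ 𝒜, ∃ r ∈ ℬ, q + r ∈ 𝒞 := by
    intro q hq
    rw [mem_insert, mem_singleton] at hq
    rcases hq with rfl | rfl
    · obtain ⟨b, hb, α, hα, -, hαb⟩ := exists_row_colour hA hA'ne hH hA'H hA₁ hA₂ hAqp hneA
      obtain ⟨x, hx⟩ := hne₁
      refine ⟨(b : G ⧸ H), mem_image_of_mem _ hb, ?_⟩
      have hxA : x ∈ A := by rw [hA, union_assoc, union_comm A₁]; simp [hx]
      have e : ((a₁ : G ⧸ H)) + (b : G ⧸ H) = ((x + b : G) : G ⧸ H) := by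
        rw [← QuotientAddGroup.mk_add, hqe]; have := hA₁ x hx
        have e' : a₁ + b - (x + b) = -(x - a₁) := by abel
        rw [e']; exact H.neg_mem this
      rw [e]
      refine mem𝒞 hxA (mem_sdiff.1 hb).1 hαb ?_
      obtain ⟨g, hg, rfl⟩ := mem_vadd_finset.1 hα
      have e2 : (a₁ +ᵥ g) + b - (x + b) = g - (x - a₁) := by rw [vadd_eq_add]; abel
      rw [e2]; exact H.sub_mem ((hA'H g).1 hg) (hA₁ x hx)
    · have hA' : A = A' ∪ A₂ ∪ A₁ := by rw [hA, union_right_comm]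
      obtain ⟨b, hb, α, hα, -, hαb⟩ := exists_row_colour hA' hA'ne hH hA'H hA₂ hA₁ hAqp hneA
      obtain ⟨x, hx⟩ := hne₂
      refine ⟨(b : G ⧸ H), mem_image_of_mem _ hb, ?_⟩
      have hxA : x ∈ A := by rw [hA]; simp [hx]
      have e : ((a₂ : G ⧸ H)) + (b : G ⧸ H) = ((x + b : G) : G ⧸ H) := by
        rw [← QuotientAddGroup.mk_add, hqe]; have := hA₂ x hx
        have e' : a₂ + b - (x + b) = -(x - a₂) := by abel
        rw [e']; exact H.neg_mem this
      rw [e]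
      refine mem𝒞 hxA (mem_sdiff.1 hb).1 hαb ?_
      obtain ⟨g, hg, rfl⟩ := mem_vadd_finset.1 hα
      have e2 : (a₂ +ᵥ g) + b - (x + b) = g - (x - a₂) := by rw [vadd_eq_add]; abel
      rw [e2]; exact H.sub_mem ((hA'H g).1 hg) (hA₂ x hx)
  -- columns
  have hcol : ∀ r ∈ ℬ, ∃ q ∈ 𝒜, q + r ∈ 𝒞 := by
    intro r hr
    obtain ⟨b, hb, rfl⟩ := mem_image.1 hr
    obtain ⟨a, ha, h, hhH, -, hba⟩ := exists_col_colour hA hA'ne hA'H hneB hb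
    have haA : a ∈ A := by
      rw [hA, union_assoc]; exact mem_union_right _ ha
    have key : ((a + b : G) : G ⧸ H) ∈ 𝒞 := by
      refine mem𝒞 haA (mem_sdiff.1 hb).1 hba ?_
      have e : h + b + a - (a + b) = h := by abel
      rw [e]; exact hhH
    rw [mem_union] at ha
    rcases ha with ha | ha
    · refine ⟨(a₁ : G ⧸ H), mem_insert_self _ _, ?_⟩
      have e : ((a₁ : G ⧸ H)) + (b : G ⧸ H) = ((a + b : G) : G ⧸ H) := by
        rw [← QuotientAddGroup.mk_add, hqe]
        have e' : a₁ + b - (a + b) = -(a - a₁) := by abel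
        rw [e']; exact H.neg_mem (hA₁ a ha)
      rw [e]; exact key
    · refine ⟨(a₂ : G ⧸ H), mem_insert_of_mem (mem_singleton_self _), ?_⟩
      have e : ((a₂ : G ⧸ H)) + (b : G ⧸ H) = ((a + b : G) : G ⧸ H) := by
        rw [← QuotientAddGroup.mk_add, hqe]
        have e' : a₂ + b - (a + b) = -(a - a₂) := by abel
        rw [e']; exact H.neg_mem (hA₂ a ha)
      rw [e]; exact key
  have h55 := exists_two_edges_or_card_eq_two h𝒞sub (by omega) hℬ h𝒞 hrow hcol
  rcases h55 with h | ⟨-, hB2, hC2, hrest⟩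
  · exact Or.inl h
  · exact Or.inr ⟨h𝒜, hB2, hC2, hrest⟩

/-! ### Lemma 5.6, Case 1 (display (33)): impossible -/

/-- The stabilizer of a nonempty subset of one `H`-coset lies in `H` ("for some proper subgroup
`H₁ < H`", Case 1 of Lemma 5.6; `H` carried as a finset). [cite: Grynkiewicz2009, Lemma 5.6 (proof, Case 1)] -/
theorem addStab_subset_of_subset_vadd {S Hf : Finset G} {H : AddSubgroup G}
    (hHf : ∀ g, g ∈ Hf ↔ g ∈ H) {x : G} (hS : S.Nonempty) (hSx : S ⊆ x +ᵥ Hf) :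
    S.addStab ⊆ Hf := by
  intro g hg
  obtain ⟨s, hs⟩ := hS
  have hgs : g + s ∈ S := by
    rw [← (mem_addStab ⟨s, hs⟩).1 hg]; exact mem_vadd_finset.2 ⟨s, hs, rfl⟩
  obtain ⟨h₁, hh₁, h1⟩ := mem_vadd_finset.1 (hSx hs)
  obtain ⟨h₂, hh₂, h2⟩ := mem_vadd_finset.1 (hSx hgs)
  rw [hHf] at hh₁ hh₂ ⊢
  have e : g = (x +ᵥ h₂) - (x +ᵥ h₁) := by rw [h1, h2]; abel
  rw [e, vadd_eq_add, vadd_eq_add, add_sub_add_left_eq_sub]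
  exact H.sub_mem hh₂ hh₁

/-- A stabilizer properly inside another has at most half its size (Lagrange; "since `|H_i| ≤ ½|H|`",
Case 1 of Lemma 5.6). [cite: Grynkiewicz2009, Lemma 5.6 (proof, Case 1)] -/
theorem two_mul_card_addStab_le {S T : Finset G} (hS : S.Nonempty) (hsub : S.addStab ⊆ T.addStab)
    (hne : S.addStab ≠ T.addStab) : 2 * #S.addStab ≤ #T.addStab := by
  have hdvd := card_addStab_dvd_card_addStab hS hsub
  have hlt : #S.addStab < #T.addStab := card_lt_card (lt_of_le_of_ne hsub hne)
  obtain ⟨m, hm⟩ := hdvd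
  have hpos : 0 < #S.addStab := hS.addStab.card_pos
  rcases Nat.lt_or_ge m 2 with hm2 | hm2
  · have : m = 0 ∨ m = 1 := by omega
    rcases this with rfl | rfl
    · rw [mul_zero] at hm; omega
    · rw [mul_one] at hm; omega
  · calc 2 * #S.addStab ≤ m * #S.addStab := Nat.mul_le_mul_right _ hm2
      _ = #T.addStab := by rw [hm, mul_comm]

/-- Stabilizer finsets are closed under subtraction (the same statement is proved, for the STPP census,
as `Summit.MatrixMultiplication.….STPPThreeRoomEnergy.sub_mem_addStab` under `Summits/`, which a
`Literature/` file cannot import). [cite: Grynkiewicz2009, §2 (H(A) is a subgroup)] -/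
theorem sub_mem_addStab_of_mem {S : Finset G} (hS : S.Nonempty) {u v : G} (hu : u ∈ S.addStab)
    (hv : v ∈ S.addStab) : u - v ∈ S.addStab := by
  rw [← mem_coe, coe_addStab hS] at hu hv ⊢
  exact sub_mem hu hv

/-- Two stabilizers inside a third one and meeting only in `0` have `|H₁| |H₂| ≤ |H|` ("Thus it follows
that `|H| ≥ |H₁||H₂| = ¼|H|²`", Case 1 of Lemma 5.6). [cite: Grynkiewicz2009, Lemma 5.6 (proof, Case 1)] -/
theorem card_mul_card_le_of_addStab_inter {S₁ S₂ T : Finset G} (h₁ : S₁.Nonempty) (h₂ : S₂.Nonempty)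
    (hT : T.Nonempty) (hsub₁ : S₁.addStab ⊆ T.addStab) (hsub₂ : S₂.addStab ⊆ T.addStab)
    (hint : ∀ g ∈ S₁.addStab, g ∈ S₂.addStab → g = 0) :
    #S₁.addStab * #S₂.addStab ≤ #T.addStab := by
  rw [← card_product]
  refine card_le_card_of_injOn (fun p => p.1 + p.2) (fun p hp => ?_) (fun p hp q hq hpq => ?_)
  · rw [mem_coe, mem_product] at hp
    have hT' : IsPeriodicWith (AddAction.stabilizer G T) T := fun g hg => AddAction.mem_stabilizer_iff.1 hg
    have h1 : p.1 +ᵥ T = T := (mem_addStab hT).1 (hsub₁ hp.1)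
    have h2 : p.2 +ᵥ T = T := (mem_addStab hT).1 (hsub₂ hp.2)
    rw [mem_coe, mem_addStab hT, add_vadd, h2, h1]
  · rw [mem_coe, mem_product] at hp hq
    simp only at hpq
    -- p.1 - q.1 = q.2 - p.2 lies in both stabilizers
    have hd₁ : p.1 - q.1 ∈ S₁.addStab := sub_mem_addStab_of_mem h₁ hp.1 hq.1
    have hd₂ : q.2 - p.2 ∈ S₂.addStab := sub_mem_addStab_of_mem h₂ hq.2 hp.2
    have e : p.1 - q.1 = q.2 - p.2 := by
      have := hpq; linear_combination (norm := abel_nf) this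
    have h0 := hint _ hd₁ (by rw [e]; exact hd₂)
    have e1 : p.1 = q.1 := sub_eq_zero.1 h0
    have e2 : p.2 = q.2 := by rw [e1] at hpq; exact add_left_cancel hpq
    exact Prod.ext e1 e2

/-- **Lemma 5.6, Case 1 leads to a contradiction.**  In the situation of Lemma 5.6 (`A = A′ ∪ A₁ ∪ A₂`
with `H(A′) = H ≠ 0`, `A_i ⊆ a_i + H`, `|A + B| = |A| + |B|`, `A + B` aperiodic, every periodic superset of
`A + B` has at least three more elements — the printed `d⊆(A + B, P) ≥ 3` —, `A` non-extendible w.r.t.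
`B ≠ ∅`, `A` not quasi-periodic), the first alternative of Proposition 5.5 cannot occur: there are no
`b₁, b₂ ∈ B ∖ B′` in distinct `H`-cosets such that the cosets of `a₁ + b₁` and `a₂ + b₂` are distinct
partially filled cosets of `A + B` (witnessed by `w_i ∉ A + B` in those cosets).  Proof as printed: display
(33) from (32) and Kneser's theorem inside the two cosets (`card_add_card_le_card_add_add_card_addStab`)
with `|H_i| ≤ ½|H|` forces `r = l = 2`, `ρ₁ = ρ₂ = 0`, `|H₁| = |H₂| = ½|H|`; `H₁ ∩ H₂ ≠ 0` would make `A`,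
hence `A + B`, periodic, so `|H| ≥ |H₁||H₂|` gives `|H| = 4` (or `|H| = 2`), and then `A + B + H₁` (resp.
`A + B + H`) is a periodic superset with at most two new elements, "contradicting that `d⊆(A + B, P) ≥ 3`".
The hypotheses `0 ∈ A ∩ B`, `|A|, |B| ≥ 3`, `⟨A⟩ = G` and the non-extendibility of `B` are not used in
this case. [cite: Grynkiewicz2009, Lemma 5.6 (proof, Case 1, display (33))] -/
theorem case_one_false {A A' A₁ A₂ B : Finset G} {H : AddSubgroup G} {a₁ a₂ b₁ b₂ w₁ w₂ : G}
    (hA : A = A' ∪ A₁ ∪ A₂) (hA'ne : A'.Nonempty) (hH : H ≠ ⊥)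
    (hA'H : ∀ g, g ∈ A'.addStab ↔ g ∈ H)
    (hA₁ : ∀ x ∈ A₁, x - a₁ ∈ H) (hA₂ : ∀ x ∈ A₂, x - a₂ ∈ H)
    (hAB : #(A + B) = #A + #B) (haper : (A + B).addStab = {0})
    (hP3 : ∀ P : Finset G, A + B ⊆ P → P.addStab ≠ {0} → 3 ≤ #(P \ (A + B)))
    (hneA : IsNonExtendible A B) (hBne : B.Nonempty) (hAqp : ¬ IsQuasiPeriodic A)
    (hb₁ : b₁ ∈ B \ periodicPart H B) (hb₂ : b₂ ∈ B \ periodicPart H B) (hb12 : b₁ - b₂ ∉ H)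
    (hw₁ : w₁ ∉ A + B) (hw₁c : w₁ - (a₁ + b₁) ∈ H)
    (hw₂ : w₂ ∉ A + B) (hw₂c : w₂ - (a₂ + b₂) ∈ H)
    (hc12 : (a₁ + b₁) - (a₂ + b₂) ∉ H) : False := by
  set Hf := A'.addStab with hHfdef
  have hper : IsPeriodicWith H A' := fun h hh => (mem_addStab hA'ne).1 ((hA'H h).2 hh)
  have h0Hf : (0 : G) ∈ Hf := hA'ne.zero_mem_addStab
  obtain ⟨hne₁, hne₂, hd₁, hd₂, h12, hd₁₂, -, -⟩ :=
    parts_of_not_isQuasiPeriodic hA hA'ne hH hA'H hA₁ hA₂ hAqp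
  obtain ⟨hsubC, h32⟩ := display32 hA hA'ne hH hA'H hA₁ hA₂ hAqp hneA hBne
  rw [← hHfdef] at h32
  set C' := periodicPart H (A + B) with hC'
  set B' := periodicPart H B with hB'
  have hC'per : IsPeriodicWith H C' := isPeriodicWith_periodicPart H (A + B)
  have hB'per : IsPeriodicWith H B' := isPeriodicWith_periodicPart H B
  have hABne : (A + B).Nonempty := by rw [← card_pos, hAB]; have := hBne.card_pos; omega
  have hA₁A : A₁ ⊆ A := by rw [hA, union_assoc, union_comm A₁]; intro x hx; simp [hx]
  have hA₂A : A₂ ⊆ A := by rw [hA]; intro x hx; simp [hx]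
  -- the traces
  set T₁ := cosetTrace H B b₁ with hT₁
  set T₂ := cosetTrace H B b₂ with hT₂
  have hT₁sub : T₁ ⊆ B \ B' := cosetTrace_subset_sdiff_periodicPart hb₁
  have hT₂sub : T₂ ⊆ B \ B' := cosetTrace_subset_sdiff_periodicPart hb₂
  have hT₁ne : T₁.Nonempty := ⟨b₁, mem_cosetTrace_self (mem_sdiff.1 hb₁).1⟩
  have hT₂ne : T₂.Nonempty := ⟨b₂, mem_cosetTrace_self (mem_sdiff.1 hb₂).1⟩
  have hT₁₂ : Disjoint T₁ T₂ := by
    rcases cosetTrace_disjoint_or_eq H B b₁ b₂ with h | h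
    · exact h
    · exfalso
      have : b₂ ∈ T₁ := by rw [hT₁, h]; exact mem_cosetTrace_self (mem_sdiff.1 hb₂).1
      have := (mem_cosetTrace.1 this).2
      exact hb12 (by have := H.neg_mem this; rwa [neg_sub] at this)
  -- the two blocks
  set X₁ := A₁ + T₁ with hX₁
  set X₂ := A₂ + T₂ with hX₂
  have hX₁ne : X₁.Nonempty := hne₁.add hT₁ne
  have hX₂ne : X₂.Nonempty := hne₂.add hT₂ne
  have hX₁c : ∀ y ∈ X₁, y - (a₁ + b₁) ∈ H := by
    intro y hy
    obtain ⟨x, hx, t, ht, rfl⟩ := mem_add.1 hy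
    have e : x + t - (a₁ + b₁) = (x - a₁) + (t - b₁) := by abel
    rw [e]; exact H.add_mem (hA₁ x hx) (mem_cosetTrace.1 ht).2
  have hX₂c : ∀ y ∈ X₂, y - (a₂ + b₂) ∈ H := by
    intro y hy
    obtain ⟨x, hx, t, ht, rfl⟩ := mem_add.1 hy
    have e : x + t - (a₂ + b₂) = (x - a₂) + (t - b₂) := by abel
    rw [e]; exact H.add_mem (hA₂ x hx) (mem_cosetTrace.1 ht).2
  have hX₁cos : X₁ ⊆ (a₁ + b₁) +ᵥ Hf := fun y hy =>
    mem_vadd_finset.2 ⟨y - (a₁ + b₁), (hA'H _).2 (hX₁c y hy), by rw [vadd_eq_add, add_sub_cancel]⟩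
  have hX₂cos : X₂ ⊆ (a₂ + b₂) +ᵥ Hf := fun y hy =>
    mem_vadd_finset.2 ⟨y - (a₂ + b₂), (hA'H _).2 (hX₂c y hy), by rw [vadd_eq_add, add_sub_cancel]⟩
  have hX₁AB : X₁ ⊆ A + B := add_subset_add hA₁A (fun t ht => (mem_sdiff.1 (hT₁sub ht)).1)
  have hX₂AB : X₂ ⊆ A + B := add_subset_add hA₂A (fun t ht => (mem_sdiff.1 (hT₂sub ht)).1)
  -- no element of the two cosets lies in `C'`
  have hcos₁C : ∀ y, y - (a₁ + b₁) ∈ H → y ∉ C' := by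
    intro y hy hyC
    apply hw₁
    have := (mem_periodicPart.1 hyC).2 (w₁ - y) (by
      have e : w₁ - y = (w₁ - (a₁ + b₁)) - (y - (a₁ + b₁)) := by abel
      rw [e]; exact H.sub_mem hw₁c hy)
    rwa [sub_add_cancel] at this
  have hcos₂C : ∀ y, y - (a₂ + b₂) ∈ H → y ∉ C' := by
    intro y hy hyC
    apply hw₂
    have := (mem_periodicPart.1 hyC).2 (w₂ - y) (by
      have e : w₂ - y = (w₂ - (a₂ + b₂)) - (y - (a₂ + b₂)) := by abel
      rw [e]; exact H.sub_mem hw₂c hy)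
    rwa [sub_add_cancel] at this
  have hX₁E : X₁ ⊆ (A + B) \ C' := fun y hy => mem_sdiff.2 ⟨hX₁AB hy, hcos₁C y (hX₁c y hy)⟩
  have hX₂E : X₂ ⊆ (A + B) \ C' := fun y hy => mem_sdiff.2 ⟨hX₂AB hy, hcos₂C y (hX₂c y hy)⟩
  have hX₁₂ : Disjoint X₁ X₂ := by
    rw [disjoint_left]; intro y h1 h2
    apply hc12
    have e : a₁ + b₁ - (a₂ + b₂) = (y - (a₂ + b₂)) - (y - (a₁ + b₁)) := by abel
    rw [e]; exact H.sub_mem (hX₂c y h2) (hX₁c y h1)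
  -- cardinalities of `A`, `B`
  have hcardA : #A = #A' + #A₁ + #A₂ := by
    rw [hA, card_union_of_disjoint, card_union_of_disjoint hd₁]
    exact disjoint_union_left.2 ⟨hd₂, hd₁₂⟩
  set R := (B \ B') \ (T₁ ∪ T₂) with hR
  have hcardB : #B = #B' + #T₁ + #T₂ + #R := by
    have h1 : #(B \ B') + #B' = #B := card_sdiff_add_card_eq_card (periodicPart_subset H B)
    have h2 : #R + #(T₁ ∪ T₂) = #(B \ B') :=
      card_sdiff_add_card_eq_card (union_subset hT₁sub hT₂sub)
    have h3 : #(T₁ ∪ T₂) = #T₁ + #T₂ := card_union_of_disjoint hT₁₂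
    omega
  -- `E = ((A+B) ∖ C') ∖ (X₁ ∪ X₂)`
  set E := ((A + B) \ C') \ (X₁ ∪ X₂) with hE
  have hcardE : #((A + B) \ C') = #X₁ + #X₂ + #E := by
    have h1 : #E + #(X₁ ∪ X₂) = #((A + B) \ C') :=
      card_sdiff_add_card_eq_card (union_subset hX₁E hX₂E)
    have h2 : #(X₁ ∪ X₂) = #X₁ + #X₂ := card_union_of_disjoint hX₁₂
    omega
  -- lower bound for `|B + H|`
  have hR1 : R.Nonempty → #R + 1 ≤ #(R + Hf) := by
    rintro ⟨r, hr⟩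
    have hr' : r ∈ B \ B' := (mem_sdiff.1 hr).1
    obtain ⟨h, hhH, hrh⟩ := exists_add_notMem_of_mem_sdiff_periodicPart hr'
    have hsub : R ⊆ R + Hf := subset_add_left R h0Hf
    have hmem : r + h ∈ R + Hf := add_mem_add hr ((hA'H h).2 hhH)
    have hnot : r + h ∉ R := fun h' => hrh (by
      rw [add_comm]; exact (mem_sdiff.1 (mem_sdiff.1 h').1).1)
    have : #(insert (r + h) R) ≤ #(R + Hf) := card_le_card (insert_subset hmem hsub)
    rwa [card_insert_of_notMem hnot] at this
  have hBH : #B' + #Hf + #Hf + #(R + Hf) ≤ #(B + Hf) := by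
    -- four pairwise disjoint pieces of `B + Hf`
    have hB'sub : B' ⊆ B + Hf := (periodicPart_subset H B).trans (subset_add_left B h0Hf)
    have hb₁sub : b₁ +ᵥ Hf ⊆ B + Hf := fun y hy => by
      obtain ⟨h, hh, rfl⟩ := mem_vadd_finset.1 hy
      exact add_mem_add (mem_sdiff.1 hb₁).1 hh
    have hb₂sub : b₂ +ᵥ Hf ⊆ B + Hf := fun y hy => by
      obtain ⟨h, hh, rfl⟩ := mem_vadd_finset.1 hy
      exact add_mem_add (mem_sdiff.1 hb₂).1 hh
    have hRsub : R + Hf ⊆ B + Hf :=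
      add_subset_add_right fun r hr => (mem_sdiff.1 (mem_sdiff.1 hr).1).1
    -- `B'` misses every coset of `B ∖ B'`
    have hB'cos : ∀ {b h : G}, b ∈ B \ B' → h ∈ Hf → b + h ∉ B' := by
      intro b h hb hh hbh
      apply (mem_sdiff.1 hb).2
      have hneg : -h ∈ H := H.neg_mem ((hA'H h).1 hh)
      rw [← hB'per (-h) hneg]
      exact mem_vadd_finset.2 ⟨b + h, hbh, by rw [vadd_eq_add]; abel⟩
    have d1 : Disjoint B' (b₁ +ᵥ Hf) := by
      rw [disjoint_right]; intro y hy
      obtain ⟨h, hh, rfl⟩ := mem_vadd_finset.1 hy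
      exact hB'cos hb₁ hh
    have d2 : Disjoint B' (b₂ +ᵥ Hf) := by
      rw [disjoint_right]; intro y hy
      obtain ⟨h, hh, rfl⟩ := mem_vadd_finset.1 hy
      exact hB'cos hb₂ hh
    have d3 : Disjoint B' (R + Hf) := by
      rw [disjoint_right]; intro y hy
      obtain ⟨r, hr, h, hh, rfl⟩ := mem_add.1 hy
      exact hB'cos (mem_sdiff.1 hr).1 hh
    have d4 : Disjoint (b₁ +ᵥ Hf) (b₂ +ᵥ Hf) := by
      rw [disjoint_left]; intro y h1 h2
      obtain ⟨h, hh, rfl⟩ := mem_vadd_finset.1 h1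
      obtain ⟨h', hh', he⟩ := mem_vadd_finset.1 h2
      apply hb12
      have e : b₁ - b₂ = h' - h := by
        rw [vadd_eq_add, vadd_eq_add] at he
        rw [sub_eq_sub_iff_add_eq_add, add_comm h' b₂]
        exact he.symm
      rw [e]; exact H.sub_mem ((hA'H h').1 hh') ((hA'H h).1 hh)
    have hRcos : ∀ {b : G} {T : Finset G}, T = cosetTrace H B b → T ⊆ T₁ ∪ T₂ →
        Disjoint (b +ᵥ Hf) (R + Hf) := by
      intro b T hT hTsub
      rw [disjoint_left]; intro y h1 h2
      obtain ⟨h, hh, rfl⟩ := mem_vadd_finset.1 h1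
      obtain ⟨r, hr, h', hh', he⟩ := mem_add.1 h2
      have hrB : r ∈ B := (mem_sdiff.1 (mem_sdiff.1 hr).1).1
      have hrT : r ∈ T := by
        rw [hT, mem_cosetTrace]
        refine ⟨hrB, ?_⟩
        have e : r - b = h - h' := by
          rw [vadd_eq_add] at he
          rw [sub_eq_sub_iff_add_eq_add, add_comm h b]
          exact he
        rw [e]; exact H.sub_mem ((hA'H h).1 hh) ((hA'H h').1 hh')
      exact (mem_sdiff.1 hr).2 (hTsub hrT)
    have d5 : Disjoint (b₁ +ᵥ Hf) (R + Hf) := hRcos hT₁ subset_union_left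
    have d6 : Disjoint (b₂ +ᵥ Hf) (R + Hf) := hRcos hT₂ subset_union_right
    have hU : B' ∪ (b₁ +ᵥ Hf) ∪ (b₂ +ᵥ Hf) ∪ (R + Hf) ⊆ B + Hf :=
      union_subset (union_subset (union_subset hB'sub hb₁sub) hb₂sub) hRsub
    have := card_le_card hU
    rw [card_union_of_disjoint (disjoint_union_left.2 ⟨disjoint_union_left.2 ⟨d3, d5⟩, d6⟩),
      card_union_of_disjoint (disjoint_union_left.2 ⟨d2, d4⟩), card_union_of_disjoint d1,
      card_vadd_finset, card_vadd_finset] at this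
    exact this
  -- Kneser on the two blocks
  have kn₁ := card_add_card_le_card_add_add_card_addStab A₁ T₁ hne₁ hT₁ne
  have kn₂ := card_add_card_le_card_add_add_card_addStab A₂ T₂ hne₂ hT₂ne
  rw [← hX₁] at kn₁
  rw [← hX₂] at kn₂
  -- the stabilizers are proper subgroups of `H`
  have hH₁sub : X₁.addStab ⊆ Hf := addStab_subset_of_subset_vadd hA'H hX₁ne hX₁cos
  have hH₂sub : X₂.addStab ⊆ Hf := addStab_subset_of_subset_vadd hA'H hX₂ne hX₂cos
  have hfull : ∀ {X : Finset G} {c w : G}, X.Nonempty → (∀ y ∈ X, y - c ∈ H) → w ∉ A + B →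
      w - c ∈ H → X ⊆ A + B → X.addStab ≠ Hf := by
    intro X c w hXne hXc hw hwc hXAB heq
    obtain ⟨y, hy⟩ := hXne
    apply hw
    have hg : w - y ∈ X.addStab := by
      rw [heq, hA'H]
      have e : w - y = (w - c) - (y - c) := by abel
      rw [e]; exact H.sub_mem hwc (hXc y hy)
    have := (mem_addStab ⟨y, hy⟩).1 hg
    apply hXAB
    rw [← this]
    exact mem_vadd_finset.2 ⟨y, hy, by rw [vadd_eq_add, sub_add_cancel]⟩
  have hH₁ne : X₁.addStab ≠ Hf := hfull hX₁ne hX₁c hw₁ hw₁c hX₁AB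
  have hH₂ne : X₂.addStab ≠ Hf := hfull hX₂ne hX₂c hw₂ hw₂c hX₂AB
  have hH₁half : 2 * #X₁.addStab ≤ #Hf := two_mul_card_addStab_le hX₁ne hH₁sub hH₁ne
  have hH₂half : 2 * #X₂.addStab ≤ #Hf := two_mul_card_addStab_le hX₂ne hH₂sub hH₂ne
  -- the main count: everything is tight
  have hRe : R = ∅ := by
    by_contra hRne
    have := hR1 (nonempty_iff_ne_empty.2 hRne)
    omega
  have hR0 : #R = 0 := by rw [hRe, card_empty]
  have hRH0 : #(R + Hf) = 0 := by rw [hRe, empty_add, card_empty]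
  have hEe : #E = 0 := by omega
  have hH₁c : 2 * #X₁.addStab = #Hf := by omega
  have hH₂c : 2 * #X₂.addStab = #Hf := by omega
  have hkn₁ : #A₁ + #T₁ = #X₁ + #X₁.addStab := by omega
  have hkn₂ : #A₂ + #T₂ = #X₂ + #X₂.addStab := by omega
  -- `A + B = C' ∪ X₁ ∪ X₂`
  have hABeq : A + B = C' ∪ (X₁ ∪ X₂) := by
    have hE0 : E = ∅ := card_eq_zero.1 hEe
    rw [hE, sdiff_eq_empty_iff_subset] at hE0
    refine Subset.antisymm (fun y hy => ?_) (union_subset (periodicPart_subset H (A + B))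
      (union_subset hX₁AB hX₂AB))
    by_cases hyC : y ∈ C'
    · exact mem_union_left _ hyC
    · exact mem_union_right _ (hE0 (mem_sdiff.2 ⟨hy, hyC⟩))
  -- `A_i` is `H_i`-periodic
  have hA₁per : ∀ g ∈ X₁.addStab, g +ᵥ A₁ = A₁ := by
    have kn := add_kneser (s := A₁) (t := T₁)
    rw [← hX₁] at kn
    have h1 : #A₁ ≤ #(A₁ + X₁.addStab) := card_le_card_add_right hX₁ne.addStab
    have h2 : #T₁ ≤ #(T₁ + X₁.addStab) := card_le_card_add_right hX₁ne.addStab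
    have heq : A₁ + X₁.addStab = A₁ :=
      (eq_of_subset_of_card_le (subset_add_left A₁ hX₁ne.zero_mem_addStab) (by omega)).symm
    intro g hg
    refine eq_of_subset_of_card_le (fun y hy => ?_) (by rw [card_vadd_finset])
    obtain ⟨x, hx, rfl⟩ := mem_vadd_finset.1 hy
    rw [← heq, vadd_eq_add, add_comm g x]
    exact add_mem_add hx hg
  have hA₂per : ∀ g ∈ X₂.addStab, g +ᵥ A₂ = A₂ := by
    have kn := add_kneser (s := A₂) (t := T₂)
    rw [← hX₂] at kn
    have h1 : #A₂ ≤ #(A₂ + X₂.addStab) := card_le_card_add_right hX₂ne.addStab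
    have h2 : #T₂ ≤ #(T₂ + X₂.addStab) := card_le_card_add_right hX₂ne.addStab
    have heq : A₂ + X₂.addStab = A₂ :=
      (eq_of_subset_of_card_le (subset_add_left A₂ hX₂ne.zero_mem_addStab) (by omega)).symm
    intro g hg
    refine eq_of_subset_of_card_le (fun y hy => ?_) (by rw [card_vadd_finset])
    obtain ⟨x, hx, rfl⟩ := mem_vadd_finset.1 hy
    rw [← heq, vadd_eq_add, add_comm g x]
    exact add_mem_add hx hg
  -- `H₁ ∩ H₂ = 0`
  have hint : ∀ g ∈ X₁.addStab, g ∈ X₂.addStab → g = 0 := by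
    intro g hg₁ hg₂
    have hgA' : g +ᵥ A' = A' := (mem_addStab hA'ne).1 (hH₁sub hg₁)
    have hgA : g +ᵥ A = A := by
      rw [hA, vadd_finset_union, vadd_finset_union, hgA', hA₁per g hg₁, hA₂per g hg₂]
    have : g ∈ (A + B).addStab := by
      rw [mem_addStab hABne, ← vadd_add_assoc, hgA]
    rw [haper, mem_singleton] at this
    exact this
  have hprod : #X₁.addStab * #X₂.addStab ≤ #Hf :=
    card_mul_card_le_of_addStab_inter hX₁ne hX₂ne hA'ne hH₁sub hH₂sub hint
  -- hence `|H| ∈ {2, 4}`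
  have hHf2 : 2 ≤ #Hf := by
    obtain ⟨h, hhH, hh0⟩ : ∃ h ∈ H, h ≠ (0 : G) := by
      by_contra hne
      push Not at hne
      exact hH ((AddSubgroup.eq_bot_iff_forall _).2 hne)
    have : ({0, h} : Finset G) ⊆ Hf :=
      insert_subset h0Hf (singleton_subset_iff.2 ((hA'H h).2 hhH))
    have := card_le_card this
    rwa [card_pair hh0.symm] at this
  have hsq : #X₁.addStab * #X₁.addStab ≤ 2 * #X₁.addStab := by
    have : #X₂.addStab = #X₁.addStab := by omega
    rw [this] at hprod; omega
  have hH₁le : #X₁.addStab ≤ 2 := by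
    have hpos : 0 < #X₁.addStab := hX₁ne.addStab.card_pos
    exact Nat.le_of_mul_le_mul_right hsq hpos
  -- `P := (A + B) + K` with `K = Hf` if `|Hf| = 2`, else `K = H₁`
  have hcoset_card : ∀ {X : Finset G} {c : G} {K : Finset G}, X ⊆ c +ᵥ Hf → K ⊆ Hf →
      #(X + K) ≤ #Hf := by
    intro X c K hXc hK
    have : X + K ⊆ c +ᵥ Hf := by
      intro y hy
      obtain ⟨x, hx, k, hk, rfl⟩ := mem_add.1 hy
      obtain ⟨h, hh, rfl⟩ := mem_vadd_finset.1 (hXc hx)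
      refine mem_vadd_finset.2 ⟨h + k, ?_, by rw [vadd_eq_add, vadd_eq_add, add_assoc]⟩
      exact (hA'H _).2 (H.add_mem ((hA'H h).1 hh) ((hA'H k).1 (hK hk)))
    have := card_le_card this
    rwa [card_vadd_finset] at this
  have hC'K : ∀ {K : Finset G}, K ⊆ Hf → (0 : G) ∈ K → C' + K = C' := by
    intro K hK h0K
    refine Subset.antisymm (fun y hy => ?_) (subset_add_left C' h0K)
    obtain ⟨c, hc, k, hk, rfl⟩ := mem_add.1 hy
    rw [← hC'per k ((hA'H k).1 (hK hk)), add_comm]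
    exact mem_vadd_finset.2 ⟨c, hc, rfl⟩
  -- periodic supersets with few new elements
  have hfew : ∀ {K : Finset G}, K ⊆ Hf → (0 : G) ∈ K → (∃ g ∈ K, g ≠ 0) →
      (∀ g ∈ K, g +ᵥ K = K) → 3 ≤ #((X₁ + K) \ X₁) + #((X₂ + K) \ X₂) := by
    intro K hK h0K hgK hKK
    set P := (A + B) + K with hP
    have hABP : A + B ⊆ P := subset_add_left _ h0K
    have hPst : P.addStab ≠ {0} := by
      obtain ⟨g, hg, hg0⟩ := hgK
      intro heq
      have : g ∈ P.addStab := by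
        rw [mem_addStab (hABne.mono hABP), hP, add_comm (A + B) K, ← vadd_add_assoc, hKK g hg]
      rw [heq, mem_singleton] at this
      exact hg0 this
    have h3 := hP3 P hABP hPst
    have hPeq : P = C' ∪ ((X₁ + K) ∪ (X₂ + K)) := by
      rw [hP, hABeq, union_add, union_add, hC'K hK h0K]
    have hsub : P \ (A + B) ⊆ ((X₁ + K) \ X₁) ∪ ((X₂ + K) \ X₂) := by
      intro y hy
      rw [mem_sdiff, hPeq, hABeq] at hy
      obtain ⟨hyP, hyAB⟩ := hy
      simp only [mem_union, not_or] at hyP hyAB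
      rcases hyP with hyC | hy1 | hy2
      · exact absurd hyC hyAB.1
      · exact mem_union_left _ (mem_sdiff.2 ⟨hy1, hyAB.2.1⟩)
      · exact mem_union_right _ (mem_sdiff.2 ⟨hy2, hyAB.2.2⟩)
    exact h3.trans ((card_le_card hsub).trans (card_union_le _ _))
  have hsd : ∀ {X K : Finset G}, (0 : G) ∈ K → #((X + K) \ X) = #(X + K) - #X := by
    intro X K h0K
    have := card_sdiff_add_card_eq_card (subset_add_left X h0K)
    omega
  rcases Nat.lt_or_ge (#X₁.addStab) 2 with hlt | hge
  · -- `|H₁| = 1`, `|Hf| = 2`: use `K = Hf`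
    have hHf : #Hf = 2 := by have := hX₁ne.addStab.card_pos; omega
    have hgK : ∃ g ∈ Hf, g ≠ 0 := by
      by_contra hne
      push Not at hne
      have : Hf ⊆ {0} := fun g hg => mem_singleton.2 (hne g hg)
      have := card_le_card this
      rw [card_singleton] at this
      omega
    have h3 := hfew Subset.rfl h0Hf hgK (fun g hg => vadd_addStab hg)
    rw [hsd h0Hf, hsd h0Hf] at h3
    have c1 := hcoset_card hX₁cos Subset.rfl
    have c2 := hcoset_card hX₂cos Subset.rfl
    have p1 := hX₁ne.card_pos
    have p2 := hX₂ne.card_pos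
    omega
  · -- `|H₁| = |H₂| = 2`, `|Hf| = 4`: use `K = H₁`
    have hH₁2 : #X₁.addStab = 2 := by omega
    have hHf4 : #Hf = 4 := by omega
    have h0K : (0 : G) ∈ X₁.addStab := hX₁ne.zero_mem_addStab
    have hgK : ∃ g ∈ X₁.addStab, g ≠ 0 := by
      by_contra hne
      push Not at hne
      have : X₁.addStab ⊆ {0} := fun g hg => mem_singleton.2 (hne g hg)
      have := card_le_card this
      rw [card_singleton] at this
      omega
    have h3 := hfew hH₁sub h0K hgK (fun g hg => vadd_addStab hg)
    rw [hsd h0K, hsd h0K, add_addStab] at h3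
    have c2 := hcoset_card hX₂cos hH₁sub
    -- `#X₂ ≥ #H₂ = 2`
    have hX₂2 : 2 ≤ #X₂ := by
      have : #X₂.addStab ≤ #X₂ := by
        obtain ⟨y, hy⟩ := hX₂ne
        have hsub : y +ᵥ X₂.addStab ⊆ X₂ := by
          intro z hz
          obtain ⟨g, hg, rfl⟩ := mem_vadd_finset.1 hz
          rw [← (mem_addStab ⟨y, hy⟩).1 hg, vadd_eq_add, add_comm]
          exact mem_vadd_finset.2 ⟨y, hy, rfl⟩
        have := card_le_card hsub
        rwa [card_vadd_finset] at this
      omega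
    simp only [Nat.sub_self, zero_add] at h3
    omega

end Grynkiewicz2009

end Literature.Combinatorics.Additive
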